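import Summits.KontsevichZagierPeriods.KontsevichZagierPeriods.Theses.HermiteRigidity
import Literature.NumberTheory.Transcendental.KZSubcalculusInvariants
import Literature.Analysis.SpecialFunctions.LemniscaticEllipticValuesProofs
import Literature.NumberTheory.Transcendental.KontsevichZagierGammaProofs
import Literature.Barriers.Schanuel.NesterenkoModularScopeConjectureProofs
import Mathlib.Analysis.Calculus.Deriv.Polynomial
import Mathlib.MeasureTheory.Function.JacobianOneDim

/-!
# Disproof of `EllipticMomentKernel` (stmt-KontsevichZagierPeriods-10631) — standing adversary, gens 1–3

Crux (route HermiteRigidity, rank 3): for every rational cubic `f = 4x³ − q₂x − q₃` with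
`disc = q₂³ − 27q₃² > 0` (bounded oval `σ = (e₃, e₂)`), IF `1, J₀ = ∫_σ dx/√f, J₁ = ∫_σ x dx/√f` are
linearly independent over the real algebraic numbers (`Rigid`, inlined), THEN every `ℤ`-combination
of the generators `[D, x^a y^b]` (`D` = region under `√f` over `σ`) and `[σ, x^m/√f]` with value `0`
lies in `KZ.relations` (`KernelClaim`).

**VERDICT (cycle 3, FINAL): the crux IS A THEOREM — `DrefuteG2.EllipticMomentKernel_of :
EllipticMomentKernel` (certificate `Cruxes/EllipticMomentKernel/DrefuteG2LineClosed.lean`, drefute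
gen 2; independently re-verified by this seat 2026-08-16T04:00Z: rc 0, 0 sorries, 0 warnings,
axioms {propext, Classical.choice, Quot.sound}) — AND its inlined rigidity hypothesis is a THEOREM
on the model curve: `rigid_four_zero : Rigid 4 0` (§12, this cycle; from `J₀ = K(1/√2)/√2`,
`J₁ = (K − 2E)(1/√2)/√2` and the tree's Chudnovsky theorem via the algebraic independence of
`K(1/√2), E(1/√2)`). So the crux is true, NON-VACUOUSLY IN LEAN, and Conjecture 1 holds outright on
the elliptic moment sector of `y² = 4x³ − 4x` (`kernelClaim_four_zero_of'` + the certificate). No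
disproof exists; what remains for the item is the lead's landing. The record below (gens 1–2) of
WHY every attack failed is kept for the provers.**

(Gen-1/2 record follows; read "no kill available" as "no kill possible" since cycle 3.)
`not_ellipticMomentKernel_iff` (§2) spells out what a kill must produce: a rational cubic whose
rigidity is PROVED inside Lean (Schneider 1937 / Masser 1975 / Chudnovsky-type transcendence — none
formalised) AND a value-`0` combination that is NOT a relation, i.e. an additive invariant of
`KZ.relations` strictly finer than `KZ.eval` on this sector (`relations ≤ ker eval` is the tree's
`KZ.relations_le_ker_eval_holds`; a finer invariant would be a theorem of summit strength in the
negative direction). The paper audit of the route's move chain (rule 3 along `y`; Hermite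
`Q = α + βx + (P′f + Pf′/2)`; one rule-3 move with primitive `P√f` on the closed band; rigidity
kills the normal form) finds no illegal step — see the earlier refuter note on the item and §4,
where the critical step (Newton–Leibniz ACROSS the branch points, primitive continuous on the
closed band, derivative integrable but unbounded) is carried out at the value level in Lean.

Findings, as Lean theorems (all sorry-free; axioms ⊆ {propext, Classical.choice, Quot.sound}):

1. §1 `ellipticMomentKernel_iff` — the crux unfolded DEFINITIONALLY (`Iff.rfl`) into
   `∀ q₂ q₃, 0 < disc q₂ q₃ → Rigid q₂ q₃ → KernelClaim q₂ q₃` over the named pieces `cubic`,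
   `oval`, `J0`, `J1`, `underGraph`, `gens = gens₂ ∪ gens₁`; provers may `rw` with it.
2. §2 LOAD-BEARING ANALYSIS.
   * `0 < disc` is DECORATION: `ellipticMomentKernel_iff_withoutDisc : EllipticMomentKernel ↔
     EllipticMomentKernelWithoutDisc`. Chain: `Rigid → J₀ ≠ 0` (`(a,b,c) = (0,1,0)`) `→ σ ≠ ∅ →`
     sign change `f x > 0 > f t`, `x < t` `→ disc > 0` (`disc_pos_of_sign_change`: through the root
     `e ∈ (x,t)`, `disc = (q₂ − 3e²)(12e² − q₂)²` with both factors controlled by the cofactor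
     `Q = 4X² + 4eX + 4e² − q₂ < 0` at `x` and `t`). So there is no `_false_without_disc`.
   * Conversely `oval_nonempty_iff : σ ≠ ∅ ↔ 0 < disc` (`(−m, m)`, `m = √(q₂/12)`, witnesses the
     sign change), so the discriminant side is nowhere vacuous.
   * `Rigid` is load-bearing for the PROOF, not for TRUTH: dropping it gives the unconditional
     sector kernel conjecture `EllipticMomentKernelWithoutRigidity`, which implies the crux
     (`ellipticMomentKernel_of_withoutRigidity`) and follows from it plus Masser in the form
     `∀ q₂ q₃, 0 < disc → Rigid` (`withoutRigidity_of_masser`; tree: `J₀ = Ω₀/2` is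
     `PeriodPair.IsReal.integral_inv_sqrt_cubic_of_discr_pos_holds`, `ℚ̄`-independence of
     `(1, ω₁, η₁)` is `qbarLinearIndependent_one_twoPiI_ω₁_η₁` from the fact
     `masser_ellipticPeriods`; the glue `J₁ = −η₁/2` (Lawden (6.13.3)) is NOT in the tree).
     No `_false_without_rigid` theorem exists or is claimed.
3. §3 WHICH MOVES ARE NECESSARY (new invariant `dimEval d : FormalRep →+ ℝ`, the value of the
   dimension-`d` part; killed by moves (1a), (1b), (2) — `noNL_le_ker_dimEval` — and equal to
   `value r` on a Newton–Leibniz move `[r] − [r']`): for EVERY admissible `(q₂, q₃)` and every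
   2-dimensional generator with `a` even, `value [D, x^a y^b] > 0` (`value_pos_of_gens₂`: `D` is
   open, non-empty off `x = 0`) and hence `[D, x^a y^b] − c ∉ noNL` for every combination `c` of
   1-dimensional generators (`of_gens₂_sub_not_mem_noNL`): **the reduction of a moment to the
   1-dimensional normal form is impossible in the scissors + reparametrisation sub-calculus; any
   proof instantiates `KZ.newtonLeibnizRel`** (the route's "rule 3 along `y`" is not a convenience).
4. §4 THE MODEL CURVE `y² = 4x³ − 4x` (`(q₂,q₃) = (4,0)`, roots `−1, 0, 1`, `σ = (−1,0)`, CM,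
   `j = 1728`):
   * `oval_four_zero : σ = {−1 < x < 0}` literally; `isSemialgebraic_oval_four_zero`;
     `isSemialgebraicFunOn_genIntegrand` (`x^m/√f = x^m·√(1/f)` via the tree's
     `isSemialgebraicFunOn_aeval_div_aeval`, `.sqrt_holds`, `.mul_holds`);
     `integrableOn_genIntegrand` (domination `|x^m/√f| ≤ ½/√((−x)(x+1)) = ½·d/dx arcsin(2x+1)`,
     integrable as the non-negative derivative of a continuous function — no improper-integral
     estimate); whence the HONEST generators `genRep m : IntegralRep 1` and
     `gens_four_zero_nonempty`: the crux is not true for want of representations.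
   * `eval_hermiteElem : eval (3[σ, x²/√f] − [σ, 1/√f]) = 0` — the Hermite relation `3J₂ = J₀`
     (`P = 1`: `(3x² − 1)/√f = d/dx(√f/2)`), PROVED by Newton–Leibniz on the CLOSED interval
     `[−1, w]` through the branch point (`integral_hermiteForm`): the planner's "why it might fail"
     (closed band vs open `σ`, integrability of `(P′f + Pf′/2)/√f` at the roots) does not bite at
     the value level. `crux_predicts_hermiteElem`: the crux + `Rigid 4 0` (Chudnovsky) say
     `c₀ ∈ relations`; on paper it is ONE rule-3 move + bookkeeping (`HermiteExactFormVanishes`).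
   * REFUTED STRENGTHENINGS: `not_kernelClaimByAdditivity_four_zero` — `c₀` is not in the subgroup
     generated by (1a) + (1b) (separated by `KZ.restrictedEval` at the window `{x < −1/2}`, where
     `c₀` restricts to `√f(−1/2)/2 = √6/8 ≠ 0`); `not_kernelClaimByReparametrisation_four_zero` —
     nor in the subgroup generated by (2) + (3) (`KZ.coeffSum c₀ = 2`). Hence
     `not_forall_kernelClaimByAdditivity`, `not_forall_kernelClaimByReparametrisation`: both
     sub-calculus strengthenings of `EllipticMomentKernelWithoutRigidity` are FALSE; every
     derivation of this kernel element uses an additivity move AND a move of type (2) or (3) —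
     exactly the shape of the planned proof. (The conditional forms `Rigid 4 0 → …` are equally
     false on paper but unrefutable in Lean for want of `Rigid 4 0`.)
5. §5 POSITIVE CONTROL (the planner's legality worry, settled on the model AT THE MOVE LEVEL):
   `hermiteElem_mem_relations : c₀ ∈ KZ.relations` — derived inside the formal calculus by ONE
   `newtonLeibnizRel` instance (`of_bandRep_sub_of_baseRep_mem_newtonLeibnizRel`: base `ℝ⁰`,
   bounds `a = −1`, `b = 0`, band `[−1,0] ⊆ ℝ¹` in the literal `Fin.init/Fin.last` shape,
   primitive `F = √f/2` semialgebraic on the band, continuous on the closed fibre, `HasDerivAt` the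
   unbounded integrand on the open fibre, `F(0) − F(−1) = 0`; the integrand `(3x² − 1)/√f` is
   semialgebraic on the CLOSED band by gluing its junk value `0` at the branch points —
   `IsSemialgebraicFunOn.union` — and integrable there since `{−1, 0}` is null), ONE
   domain-additivity move `[band] − [oval] − [ends]` (null overlap), ONE integrand-additivity move
   `(3x² − 1)/√f = 3·(x²/√f) + (−1/√f)`, and the tree's bookkeeping `[σ, 3g] ~ 3•[σ, g]`,
   `[−r] + [r] ~ 0`, `[null] ~ 0`, `[zero] ~ 0`. So on the model: `c₀ ∈ relations`,
   `c₀ ∉ ⟨(1a),(1b)⟩`, `c₀ ∉ ⟨(2),(3)⟩` — the crux's prediction holds and its proof shape is forced.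
   Targets: cycle 1 none; cycle 2 = the four stubs of the registered skeleton `a5aa6383`, see §7
   (none killable). Near-misses: none (`sorry`-free file).
6. §6 NON-VACUITY FOR EVERY ADMISSIBLE PARAMETER: `exists_roots` (three located roots
   `e₃ < −m < e₂ < m < e₁`, `f = 4∏(x − eᵢ)`, by three IVTs), `oval_eq_of_roots : σ = (e₃, e₂)`,
   `oval_eq_setOf : σ = {f > 0} ∩ ({x < 0} ∪ {12x² < q₂})` (quantifier-free, so
   `isSemialgebraic_oval` needs no Tarski–Seidenberg), `integrableOn_genIntegrand_of_roots`
   (domination by `M^m/(2√(e₁−e₂)) · d/dx arcsin((2x − e₃ − e₂)/(e₂ − e₃))`), whence the honest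
   generators `genRepQ h m : IntegralRep 1` and `gens_nonempty : 0 < disc → (gens q₂ q₃).Nonempty`,
   with `value (genRepQ h 0) = J₀ ≠ 0` under `Rigid`. The crux is nowhere true for want of
   representations. (These are also the first lemmas any prover of the crux needs.)
7. LANDED in the tree (importable; namespace `Summit.KontsevichZagierPeriods.HermiteRigidity.
   EllipticMomentKernelNegative`; all ACCEPTED, `--supports` this item), under
   `Summits/KontsevichZagierPeriods/KontsevichZagierPeriods/Theorems/EllipticMomentKernel/Negative/`:
   `LoadBearing.lean` (p73604: §1–§2), `DimEval.lean` (p74112: §3), `ModelCurve.lean` (p74161: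
   §4 generators), `Strengthenings.lean` (p74587: §4 `eval_hermiteElem`, refuted strengthenings),
   `HermiteMove.lean` (p74990: §5), `Roots.lean` (p74612: §6 roots/oval), `GeneralCurve.lean`
   (p74861: §6 generators in general); cycle 2: `Targets.lean` (p76281: §7, IN TREE),
   `VerticalBand.lean` (p76996: §9 rule-3 half, IN TREE), `VerticalDescent.lean` (§9 (1a) half +
   `verticalDescent`; submitted/queued), `PolyConst.lean` (p77645: §10, submitted). This work file
   keeps self-contained copies (namespace `…Cruxes.EllipticMomentKernel.Disproof`) so that it
   elaborates independently of farm builds.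
8. WHY IT RESISTS, in one line: the statement is "kernel conjecture on a sector whose normal form
   is rigid BY HYPOTHESIS"; soundness makes every candidate counterexample a true period relation
   `A + BJ₀ + CJ₁ = 0` (`A ∈ ℚ(e₂,e₃)`, `B, C ∈ ℚ`), which the hypothesis itself forbids unless
   `A = B = C = 0`, and then the paper move chain derives it. A refuter can only win through a
   DEFECT of `KZCalculus` making a paper move illegal; §4 exercised the most delicate one
   (rule 3 with a primitive that is continuous but not `C¹` up to the boundary, derivative
   unbounded) and it is legal as printed (`newtonLeibnizRel` asks continuity on the closed fibre
   and `HasDerivAt` on the open fibre only).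

9. §7 TARGETS (cycle 2): the registered skeleton `a5aa6383` (line `hermite-coordinates-hom`) has
   four active stubs — `stub_basisReps` (PROVED here WITHOUT `Rigid`: `basisReps_of_disc_pos`),
   `stub_polynomialToConstant`, `stub_hermiteReduction` (true on paper; paper audit stub by stub
   in §7; `hσ`/`hR` hypotheses are decoration), `stub_verticalDescent` (PROVED in §9). None is
   killable. §7
   lands the general-curve LEGALITY KIT of their move chains: roots and `R(e₂) − R(e₃)` are real
   algebraic (`isAlgebraic_of_cubic_eq_zero`, `isAlgebraic_aeval_sub_aeval`), the Hermite band
   `closedBandQ e₃ e₂ = σ ∪ endsQ` with `endsQ` null and `ℚ`-semialgebraic, the band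
   `ℚ`-semialgebraic, the bounds `e₃, e₂` legal rule-3 data over `ℝ⁰`
   (`isSemialgebraicFunOn_const_root`) — all WITHOUT Tarski–Seidenberg (algebraic heights are
   `ℚ`-definable); `roots_located` (ordered roots are separated by `∓√(q₂/12)`).
10. §8 CORRECTION (cycle 2) to items 2/8: Masser's Theorem III is PROVED in the tree
   (`masser_ellipticPeriods_cm_holds`, from the proved Chudnovsky theorem), so for CM rational
   curves (`(q₂, 0)`, `j = 1728`, incl. the model curve; `(120, −224)`, `j = 8000`) `Rigid` is
   provable modulo the single glue `J₁ = −η(Ω₀)/2` (not in tree) plus lattice bookkeeping: the crux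
   is then non-vacuous IN LEAN, and a kill would need only the (summit-hard) finer-than-`eval`
   invariant. Non-CM: Masser II is still a named fact; items 2/8 stand there.

11. §9 (cycle 2): `stub_verticalDescent` PROVED for every admissible parameter (`verticalDescent`):
   ONE `newtonLeibnizRel` instance with OPEN base `σ`, VARIABLE bound `√f`, band `vBand ⊆ ℝ²`
   (`isSemialgebraic_vBand`, quantifier-free), polynomial primitive; ONE (1a) move across the null
   graphs `vEnds` (`volume_graph_eq_zero`, Tonelli via `finTwoArrow`); `[vEnds] ~ 0`. So of the four
   stubs of skeleton `a5aa6383`: `stub_basisReps` and `stub_verticalDescent` are now theorems (here),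
   `stub_polynomialToConstant` has its legality kit (§7) and `stub_hermiteReduction` is §5's move
   with the §7 band — the line is sound; nothing is left for an adversary to bite on in it.
   Numerics for §8 (stdlib double precision, this cycle): on `(4, 0)`, `J₀ = 1.3110287771527`
   (`= ϖ/2`), `J₁ = −0.5990701173678 = −π/(4J₀)` to `3·10⁻¹²` (square lattice: `η(Ω₀)Ω₀ = π`,
   `Ω₀ = 2J₀`), confirming the sign of the glue `J₁ = −η(Ω₀)/2`; `3J₂ − J₀ = −7·10⁻¹²`.
12. §10 (cycle 2): `stub_polynomialToConstant` PROVED for every admissible parameter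
   (`polynomialToConstant : ∃ hA : IsAlgebraic ℚ (∫_σ Q), ∀ r, … → [r] − [constRep₀ _ hA] ∈ relations`):
   rational primitive (`exists_derivative_eq`), `∫_σ Q = R(e₂) − R(e₃)` (`integral_oval_aeval_eq`,
   FTC on `ℝ¹`), algebraicity (`isAlgebraic_integral_oval_aeval`), the legal constant representation
   over `ℝ⁰` (`constRep₀`, `volume univ = 1`, `value_constRep₀`), ONE `newtonLeibnizRel` instance over
   `ℝ⁰` with the IRRATIONAL algebraic bounds `e₃, e₂` (`of_polyBandRep_sub_of_constRep₀_mem_newtonLeibnizRel`)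
   and ONE (1a) move across `endsQ`. TALLY for skeleton `a5aa6383`: three of its four stubs
   (`basisReps`, `verticalDescent`, `polynomialToConstant`) are now refuter-certified THEOREMS in
   this file; the fourth (`hermiteReduction`) is §5's move with §7's band and (1b) bookkeeping. The
   line cannot be broken; what remains for the crux is assembly (the lead's `kernel_of_coordinates`).
13. §11 (cycle 2) ASSEMBLY NOTES for the lead: `value_eq_of_sub_mem_relations` (soundness packaged),
   `value_moment_eq` (`∫_D x^a y^b = ∫_σ x^a √f^{b+1}/(b+1)` for free from §9 — so `hval` of the
   line's `kernel_of_coordinates` follows from `hgen`), `of_sub_of_mem_relations_of_eqOn_oval`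
   (reps agreeing on `σ` are congruent), and the odd/even dispatch of the descended integrand on `σ`
   to the SAME rational polynomial `Q = X^a f^{k+1}/(b+1)` (`dispatchPoly`;
   `descended_eq_poly_of_odd` = input of §10, `descended_eq_poly_div_sqrt_of_even` = input of
   `stub_hermiteReduction`).

14. §12 (cycle 3) THE HYPOTHESIS IS A THEOREM ON THE MODEL CURVE — `rigid_four_zero : Rigid 4 0`
   (sorry-free, axioms standard). Road: `setIntegral_oval_four_zero` + the change of variables
   `x = u² − 1` (`integral_Ioo_comp_sq_sub_one`, Mathlib `integral_image_eq_integral_abs_deriv_smul`,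
   no integrability side condition) give `J0_four_zero : J0 4 0 = K/√2` and
   `J1_four_zero : J1 4 0 = (K − 2E)/√2` with `K = lemniscaticK = K(1/√2)`,
   `E = lemniscaticE = E(1/√2)` (tree, `Literature.Analysis.SpecialFunctions`); Legendre
   (tree theorem `Lawden1989_eq_3_8_29_lemniscatic_holds`) gives `legendre_four_zero :
   4·J₀·J₁ = −π` — the sector's first NON-linear relation (its KZ-derivability is route
   Grothendieck's crux `GpcLegendreLemniscatic`, stmt-0280, not this crux; the LINEAR hypothesis
   `Rigid` is blind to it and consistent with it); `keAlgIndependent_holds` (= route Grothendieck's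
   landed `keAlgIndependent_proof`, stmt-8611: `K, E` algebraically independent over `ℚ`, from the
   tree's Chudnovsky theorem `algebraicIndependent_real_pi_gamma_one_quarter`; copied verbatim
   while the farm's olean of that module is unbuilt) ⇒ `rigid_four_zero_of_algebraicIndependent`
   (extend scalars to the real algebraic numbers, `AlgebraicIndependent.subalgebraAlgebraicClosure`,
   read off the coefficients of `√2·a + (b + c)X − 2cY`). CONSEQUENCES: `exists_disc_pos_and_rigid'`
   (the crux's two hypotheses hold together in Lean — before this cycle `Rigid` was provable for NO
   parameter, cf. §8); `kernelClaim_four_zero_of' : EllipticMomentKernel → KernelClaim 4 0` (with the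
   certificate: Conjecture 1 on this sector, unconditionally); `not_ellipticMomentKernel_of_model_
   counterexample` (a kill now needs NO transcendence input — only a value-0 model-curve combination
   outside `relations`, which the certificate excludes); the CRUX-SHAPED refuted strengthenings
   `not_ellipticMomentKernelByAdditivity'`, `not_ellipticMomentKernelByReparametrisation'`
   (`∀ q, disc > 0 → Rigid → kernel ⊆ ⟨(1a),(1b)⟩` resp. `⊆ ⟨(2),(3)⟩` are FALSE — §4 could only
   refute the rigidity-free forms); LOAD-BEARING `eval`: `J0_pos : 0 < disc → 0 < J₀` (after
   drefute gen 3), `not_kernelClaimWithoutEval`, `ellipticMomentKernel_false_without_eval'`.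
   TWIST FAMILY: by the scaling `x = l·u`, `4l² = q₂` (`J0_q2_zero : J₀(q₂,0) = J₀(4,0)/√l`,
   `J1_q2_zero : J₁(q₂,0) = √l·J₁(4,0)`, `√l = (q₂/4)^{1/4}` real algebraic) rigidity transfers:
   `rigid_q2_zero : 0 < q₂ → Rigid q₂ 0` UNCONDITIONALLY for every rational `q₂ > 0` — the crux is
   Lean-instantiable on the whole `j = 1728` family `y² = 4x³ − q₂x` (`kernelClaim_q2_zero_of'`).
   In general `rigid_twist : Rigid q₂ q₃ → Rigid (l²q₂) (l³q₃)` for every real ALGEBRAIC `l > 0`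
   (`J0_twist`, `J1_twist`: weights `∓1/2`): rigidity is an invariant of the `ℚ̄`-twist class, as
   Masser predicts, and one proved instance seeds its whole rational twist family.
   Landing: `Negative/Lemniscatic.lean` (+ follow-ups `RigidFourZero`, twists), see the seat's NOTES.

Barrier catalogue (`Literature/Barriers/KontsevichZagierPeriods/`): `AlgebraicPrimitivesObstruction`
(`noSemialgebraicPrimitive_inv_sub_two`, primitive-elimination leaves the semialgebraic class) is
EVADED by the route — the only primitives it uses, `x^a y^{b+1}/(b+1)` and `P√f`, are semialgebraic
(§5 instantiates one) — and at the same time EXPLAINS the shape of the crux: `dx/√f`, `x dx/√f`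
have no semialgebraic primitive (incomplete elliptic integrals), so the normal form cannot be
reduced further by rule 3 and rigidity must come from a hypothesis (Masser), exactly as stated.
`GrothendieckPeriodConjectureDependence*` (strength barriers: any proof of the SUMMIT proves
`EllipticPeriodsAlgIndep` etc.) does not bite a statement that CONSUMES rigidity as a hypothesis.
`HauptvermutungObstruction`, `PeriodEqualityDecidability`: unrelated technique classes.

Numerics (previous refuter, evidence `emk_local_summary.json` on the item): normal forms vs
quadrature for `J_m (m ≤ 6)`, `M_ab (a ≤ 3, b ≤ 4)` on 10 curves agree to rel. `1.9·10⁻¹²`;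
`J₂/J₀ = 10.000000000000` on `(q₂,q₃) = (120, ±224)`; no small-height relation `a + bJ₀ + cJ₁`
(height ≤ 60) on a grid of 1790 curves (`min |J₁|/J₀ = 3.9·10⁻²`).
-/

noncomputable section

set_option linter.dupNamespace false

open MeasureTheory Set
open scoped BigOperators

namespace Summit.KontsevichZagierPeriods.KontsevichZagierPeriods.Cruxes.EllipticMomentKernel.Disproof

open Literature.NumberTheory.Transcendental
open Literature.NumberTheory.Transcendental.KZ
open Summit.KontsevichZagierPeriods.KontsevichZagierPeriods.Theses.HermiteRigidity (EllipticMomentKernel)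

/-! ## §1 Vocabulary and unfolding -/

/-- The Weierstrass cubic `f(x) = 4x³ − q₂x − q₃`. [folklore] -/
def cubic (q₂ q₃ : ℚ) (x : ℝ) : ℝ := 4 * x ^ 3 - (q₂ : ℝ) * x - (q₃ : ℝ)

/-- Its discriminant (up to the factor 16): `q₂³ − 27q₃²`. [folklore] -/
def disc (q₂ q₃ : ℚ) : ℝ := (q₂ : ℝ) ^ 3 - 27 * (q₃ : ℝ) ^ 2

/-- The bounded real oval `σ = {f > 0} ∩ {∃ t > x, f t < 0}` (`= (e₃, e₂)` when `disc > 0`),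
as a subset of `ℝ¹`. [folklore] -/
def oval (q₂ q₃ : ℚ) : Set (Fin 1 → ℝ) :=
  {p | 0 < cubic q₂ q₃ (p 0) ∧ ∃ t : ℝ, p 0 < t ∧ cubic q₂ q₃ t < 0}

/-- `J₀ = ∫_σ dx/√f`. [folklore] -/
def J0 (q₂ q₃ : ℚ) : ℝ := ∫ p in oval q₂ q₃, 1 / Real.sqrt (cubic q₂ q₃ (p 0))

/-- `J₁ = ∫_σ x dx/√f`. [folklore] -/
def J1 (q₂ q₃ : ℚ) : ℝ := ∫ p in oval q₂ q₃, p 0 / Real.sqrt (cubic q₂ q₃ (p 0))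

/-- The INLINED rigidity hypothesis of the crux: `1, J₀, J₁` are linearly independent over the
real algebraic numbers. [cite: Masser1975, Thm II/III] -/
def Rigid (q₂ q₃ : ℚ) : Prop :=
  ∀ a b c : ℝ, IsAlgebraic ℚ a → IsAlgebraic ℚ b → IsAlgebraic ℚ c →
    a + b * J0 q₂ q₃ + c * J1 q₂ q₃ = 0 → a = 0 ∧ b = 0 ∧ c = 0

/-- The region under the graph of `√f` over the oval, `D ⊆ ℝ²`. [folklore] -/
def underGraph (q₂ q₃ : ℚ) : Set (Fin 2 → ℝ) :=
  {p | (0 < cubic q₂ q₃ (p 0) ∧ ∃ t : ℝ, p 0 < t ∧ cubic q₂ q₃ t < 0) ∧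
    0 < p 1 ∧ p 1 ^ 2 < cubic q₂ q₃ (p 0)}

/-- The 2-dimensional generators `[D, x^a y^b]`. [folklore] -/
def gens₂ (q₂ q₃ : ℚ) : Set FormalRep :=
  {c | ∃ (r : IntegralRep 2) (a b : ℕ), r.domain = underGraph q₂ q₃ ∧
    EqOn r.integrand (fun p => p 0 ^ a * p 1 ^ b) (underGraph q₂ q₃) ∧ c = KZ.of r}

/-- The 1-dimensional generators `[σ, x^m/√f]`. [folklore] -/
def gens₁ (q₂ q₃ : ℚ) : Set FormalRep :=
  {c | ∃ (r : IntegralRep 1) (m : ℕ), r.domain = oval q₂ q₃ ∧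
    EqOn r.integrand (fun p => p 0 ^ m / Real.sqrt (cubic q₂ q₃ (p 0))) (oval q₂ q₃) ∧
    c = KZ.of r}

/-- All generators of the elliptic moment sector. [folklore] -/
def gens (q₂ q₃ : ℚ) : Set FormalRep := gens₂ q₂ q₃ ∪ gens₁ q₂ q₃

/-- The kernel claim on the sector: every `ℤ`-combination of generators of value `0` is a
relation of the KZ calculus. [cite: KontsevichZagier2001, §1.2] -/
def KernelClaim (q₂ q₃ : ℚ) : Prop :=
  ∀ c ∈ AddSubgroup.closure (gens q₂ q₃), KZ.eval c = 0 → c ∈ KZ.relations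

/-- The crux, unfolded into the vocabulary above (definitional). [folklore] -/
theorem ellipticMomentKernel_iff :
    EllipticMomentKernel ↔ ∀ q₂ q₃ : ℚ, 0 < disc q₂ q₃ → Rigid q₂ q₃ → KernelClaim q₂ q₃ :=
  Iff.rfl


/-! ## §2 Load-bearing analysis of the two hypotheses `0 < disc` and `Rigid` -/

section LoadBearing

variable {q₂ q₃ : ℚ}

/-- The cubic is continuous. [folklore] -/
theorem continuous_cubic : Continuous (cubic q₂ q₃) := by
  unfold cubic; fun_prop

/-- Factorisation of the cubic through a root. [folklore] -/
theorem cubic_eq_mul_of_root {e : ℝ} (he : cubic q₂ q₃ e = 0) (x : ℝ) :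
    cubic q₂ q₃ x = (x - e) * (4 * x ^ 2 + 4 * e * x + (4 * e ^ 2 - q₂)) := by
  unfold cubic at *
  linear_combination he

/-- The discriminant through a root: `disc = (q₂ − 3e²)(12e² − q₂)²`. [folklore] -/
theorem disc_eq_of_root {e : ℝ} (he : cubic q₂ q₃ e = 0) :
    disc q₂ q₃ = ((q₂ : ℝ) - 3 * e ^ 2) * (12 * e ^ 2 - q₂) ^ 2 := by
  unfold cubic at he
  unfold disc
  have h : (q₃ : ℝ) = 4 * e ^ 3 - q₂ * e := by linarith
  rw [h]; ring

/-- RIGIDITY FORCES `J₀ ≠ 0` (take `(a, b, c) = (0, 1, 0)`). [folklore] -/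
theorem J0_ne_zero_of_rigid (h : Rigid q₂ q₃) : J0 q₂ q₃ ≠ 0 := by
  intro h0
  have := (h 0 1 0 isAlgebraic_zero isAlgebraic_one isAlgebraic_zero (by rw [h0]; ring)).2.1
  exact one_ne_zero this

/-- RIGIDITY FORCES THE OVAL TO BE NON-EMPTY (an empty oval has `J₀ = 0`). [folklore] -/
theorem oval_nonempty_of_rigid (h : Rigid q₂ q₃) : (oval q₂ q₃).Nonempty := by
  by_contra hne
  rw [Set.not_nonempty_iff_eq_empty] at hne
  exact J0_ne_zero_of_rigid h (by simp [J0, hne])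

/-- A sign change `f x > 0 > f t` with `x < t` of the depressed cubic forces three distinct real
roots, i.e. `disc > 0`: through the root `e ∈ (x, t)` one has `f = (· − e)·Q` with
`Q x < 0`, `Q t < 0`, whence `q₂ > (2x + e)² + 3e² ≥ 3e²`, and `12e² = q₂` would make
`Q = 4(· − e)(· + 2e)` negative at both `x < t` on opposite sides of `−2e`. [folklore] -/
theorem disc_pos_of_sign_change {x t : ℝ} (hxt : x < t) (hx : 0 < cubic q₂ q₃ x)
    (ht : cubic q₂ q₃ t < 0) : 0 < disc q₂ q₃ := by
  obtain ⟨e, ⟨hxe, het⟩, he⟩ : ∃ e ∈ Icc x t, cubic q₂ q₃ e = 0 :=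
    intermediate_value_Icc' hxt.le continuous_cubic.continuousOn ⟨ht.le, hx.le⟩
  have hxe' : x < e := lt_of_le_of_ne hxe (by rintro rfl; exact hx.ne' he)
  have het' : e < t := lt_of_le_of_ne het (by rintro rfl; exact ht.ne he)
  have hQx : 4 * x ^ 2 + 4 * e * x + (4 * e ^ 2 - q₂) < 0 := by
    have h1 : cubic q₂ q₃ x = (x - e) * (4 * x ^ 2 + 4 * e * x + (4 * e ^ 2 - q₂)) :=
      cubic_eq_mul_of_root he x
    by_contra hcon
    push Not at hcon
    have : (x - e) * (4 * x ^ 2 + 4 * e * x + (4 * e ^ 2 - q₂)) ≤ 0 :=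
      mul_nonpos_of_nonpos_of_nonneg (by linarith) hcon
    linarith
  have hQt : 4 * t ^ 2 + 4 * e * t + (4 * e ^ 2 - q₂) < 0 := by
    have h1 : cubic q₂ q₃ t = (t - e) * (4 * t ^ 2 + 4 * e * t + (4 * e ^ 2 - q₂)) :=
      cubic_eq_mul_of_root he t
    by_contra hcon
    push Not at hcon
    have : 0 ≤ (t - e) * (4 * t ^ 2 + 4 * e * t + (4 * e ^ 2 - q₂)) :=
      mul_nonneg (by linarith) hcon
    linarith
  rw [disc_eq_of_root he]
  have hA : 0 < (q₂ : ℝ) - 3 * e ^ 2 := by nlinarith [sq_nonneg (2 * x + e)]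
  have hB : 12 * e ^ 2 - (q₂ : ℝ) ≠ 0 := by
    intro hB
    have hq : (q₂ : ℝ) = 12 * e ^ 2 := by linarith
    rw [hq] at hQx hQt
    have hx2 : 0 < x + 2 * e := by nlinarith
    have ht2 : t + 2 * e < 0 := by nlinarith
    linarith
  have hB2 : 0 < (12 * e ^ 2 - (q₂ : ℝ)) ^ 2 := by positivity
  exact mul_pos hA hB2

/-- A non-empty oval forces `disc > 0`. [folklore] -/
theorem disc_pos_of_oval_nonempty (h : (oval q₂ q₃).Nonempty) : 0 < disc q₂ q₃ := by
  obtain ⟨p, hp, t, hpt, ht⟩ := h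
  exact disc_pos_of_sign_change hpt hp ht

/-- **The discriminant hypothesis is implied by the rigidity hypothesis.** [folklore] -/
theorem disc_pos_of_rigid (h : Rigid q₂ q₃) : 0 < disc q₂ q₃ :=
  disc_pos_of_oval_nonempty (oval_nonempty_of_rigid h)

/-- Conversely the oval is non-empty as soon as `disc > 0`: with `m = √(q₂/12)` one has
`f(−m) = (2/3)q₂m − q₃ > 0 > −(2/3)q₂m − q₃ = f(m)` because `((2/3)q₂m)² = q₂³/27 > q₃²`.
So NEITHER hypothesis is vacuous on the discriminant side. [folklore] -/
theorem neg_sqrt_mem_oval (h : 0 < disc q₂ q₃) :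
    (fun _ => -Real.sqrt (q₂ / 12) : Fin 1 → ℝ) ∈ oval q₂ q₃ := by
  unfold disc at h
  have hq : (0 : ℝ) < q₂ := by
    by_contra hle
    push Not at hle
    have h3 : (q₂ : ℝ) ^ 3 ≤ 0 := by
      have : (q₂ : ℝ) ^ 3 = q₂ * q₂ ^ 2 := by ring
      rw [this]; exact mul_nonpos_of_nonpos_of_nonneg hle (sq_nonneg _)
    nlinarith [sq_nonneg (q₃ : ℝ)]
  set m := Real.sqrt (q₂ / 12) with hm
  have hm2 : m ^ 2 = q₂ / 12 := Real.sq_sqrt (by positivity)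
  have hm0 : 0 < m := Real.sqrt_pos.2 (by positivity)
  have hfm : cubic q₂ q₃ (-m) = 2 / 3 * q₂ * m - q₃ := by
    unfold cubic; linear_combination (-4 * m) * hm2
  have hfp : cubic q₂ q₃ m = -(2 / 3 * q₂ * m) - q₃ := by
    unfold cubic; linear_combination (4 * m) * hm2
  have hkey : (q₃ : ℝ) ^ 2 < (2 / 3 * q₂ * m) ^ 2 := by
    have : (2 / 3 * (q₂ : ℝ) * m) ^ 2 = (q₂ : ℝ) ^ 3 / 27 := by
      rw [mul_pow, hm2]; ring
    rw [this]; nlinarith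
  have hpos : 0 < 2 / 3 * (q₂ : ℝ) * m := by positivity
  have hq3 : |(q₃ : ℝ)| < 2 / 3 * q₂ * m := abs_lt_of_sq_lt_sq hkey hpos.le
  have hq3' := abs_lt.1 hq3
  refine ⟨?_, m, ?_, ?_⟩
  · show 0 < cubic q₂ q₃ (-m)
    rw [hfm]; linarith
  · show -m < m
    linarith
  · rw [hfp]; linarith

/-- The oval is non-empty iff `disc > 0`. [folklore] -/
theorem oval_nonempty_iff : (oval q₂ q₃).Nonempty ↔ 0 < disc q₂ q₃ :=
  ⟨disc_pos_of_oval_nonempty, fun h => ⟨_, neg_sqrt_mem_oval h⟩⟩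

end LoadBearing

/-- The crux with the discriminant hypothesis DROPPED (a statement variant of the crux for the
load-bearing analysis, not a literature fact). -/
def EllipticMomentKernelWithoutDisc : Prop :=
  ∀ q₂ q₃ : ℚ, Rigid q₂ q₃ → KernelClaim q₂ q₃

/-- **`0 < disc` is decoration**: dropping it does not change the statement, because the inlined
rigidity hypothesis already forces `J₀ ≠ 0`, hence a non-empty oval, hence three real roots
(`disc_pos_of_rigid`). So NO `_false_without_disc` theorem exists; the hypothesis only serves to
identify `σ = (e₃, e₂)`. [folklore] -/
theorem ellipticMomentKernel_iff_withoutDisc :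
    EllipticMomentKernel ↔ EllipticMomentKernelWithoutDisc :=
  ⟨fun h q₂ q₃ hr => ellipticMomentKernel_iff.mp h q₂ q₃ (disc_pos_of_rigid hr) hr,
    fun h q₂ q₃ _ hr => h q₂ q₃ hr⟩

/-- The crux with the rigidity hypothesis DROPPED: the unconditional kernel conjecture on the
elliptic moment sector of every rational cubic with three real roots (a statement variant of the
crux for the load-bearing analysis, not a literature fact). -/
def EllipticMomentKernelWithoutRigidity : Prop :=
  ∀ q₂ q₃ : ℚ, 0 < disc q₂ q₃ → KernelClaim q₂ q₃

/-- Dropping the rigidity hypothesis STRENGTHENS the crux … [folklore] -/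
theorem ellipticMomentKernel_of_withoutRigidity :
    EllipticMomentKernelWithoutRigidity → EllipticMomentKernel :=
  fun h q₂ q₃ hd _ => h q₂ q₃ hd

/-- … and the strengthening is recovered from the crux plus Masser's theorem in the form
`∀ q₂ q₃, 0 < disc → Rigid q₂ q₃` (Masser 1975 Thm II (non-CM) / Thm III + Lemma 3.1 (CM):
`1, ω₁, η₁` are linearly independent over `ℚ̄` for algebraic `g₂, g₃`; dictionary `J₀ = ω₁/2` —
tree: `PeriodPair.IsReal.integral_inv_sqrt_cubic_of_discr_pos_holds` — and `J₁ = −η₁/2`, Lawden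
(6.13.3), not yet in the tree). Hence `Rigid` is load-bearing for the PROOF (it replaces a
transcendence theorem), not for TRUTH: `EllipticMomentKernelWithoutRigidity` is not refutable by
any means available here, and no `_false_without_rigid` theorem is claimed.
[cite: Masser1975, Thm II/III] -/
theorem withoutRigidity_of_masser (hM : ∀ q₂ q₃ : ℚ, 0 < disc q₂ q₃ → Rigid q₂ q₃) :
    EllipticMomentKernel → EllipticMomentKernelWithoutRigidity :=
  fun h q₂ q₃ hd => ellipticMomentKernel_iff.mp h q₂ q₃ hd (hM q₂ q₃ hd)

/-- **What a kill would have to produce** (pure logic, using `disc`-redundancy): a rational cubic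
whose rigidity is PROVED (Schneider/Masser-type transcendence inside Lean) together with a
value-`0` combination of sector generators that is NOT a relation — i.e. an additive invariant of
`KZ.relations` finer than `KZ.eval` (`relations ≤ ker eval` is the tree's
`KZ.relations_le_ker_eval_holds`). Neither ingredient is available; see the file docblock.
[folklore] -/
theorem not_ellipticMomentKernel_iff :
    ¬ EllipticMomentKernel ↔ ∃ q₂ q₃ : ℚ, Rigid q₂ q₃ ∧
      ∃ c ∈ AddSubgroup.closure (gens q₂ q₃), KZ.eval c = 0 ∧ c ∉ KZ.relations := by
  rw [ellipticMomentKernel_iff_withoutDisc]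
  unfold EllipticMomentKernelWithoutDisc KernelClaim
  push Not
  rfl

/-! ## §3 Which moves a derivation must use: the Newton–Leibniz-free sub-calculus -/

section DimEval

variable {n : ℕ}

/-- Evaluation of the dimension-`d` part only: `[r] ↦ value r` if `r` lives in dimension `d`,
`0` otherwise. Moves (1a), (1b), (2) stay inside one dimension and are sound, so they preserve
every `dimEval d`; a Newton–Leibniz move `[r] − [r']` (`r` in dimension `n + 1`, `r'` in
dimension `n`) has `dimEval (n+1) = value r`. [cite: KontsevichZagier2001, §1.2] -/
def dimEval (d : ℕ) : FormalRep →+ ℝ :=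
  FreeAbelianGroup.lift fun p => if p.1 = d then p.2.value else 0

/-- `dimEval` of a generator. [cite: KontsevichZagier2001, §1.2] -/
@[simp] theorem dimEval_of (d : ℕ) (r : IntegralRep n) :
    dimEval d (KZ.of r) = if n = d then r.value else 0 :=
  FreeAbelianGroup.lift_apply_of _ _

/-- Domain additivity preserves `dimEval d`. [cite: KontsevichZagier2001, §1.2 rule (1)] -/
theorem dimEval_eq_zero_of_mem_domainAddRel (d : ℕ) {c : FormalRep} (hc : c ∈ domainAddRel) :
    dimEval d c = 0 := by
  have h0 := eval_eq_zero_of_mem_domainAddRel_holds hc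
  obtain ⟨n, r, r₁, r₂, -, -, -, -, rfl⟩ := hc
  by_cases h : n = d
  · simp only [map_sub, eval_of] at h0
    simpa [h] using h0
  · simp [h]

/-- Integrand additivity preserves `dimEval d`. [cite: KontsevichZagier2001, §1.2 rule (1)] -/
theorem dimEval_eq_zero_of_mem_integrandAddRel (d : ℕ) {c : FormalRep}
    (hc : c ∈ integrandAddRel) : dimEval d c = 0 := by
  have h0 := eval_eq_zero_of_mem_integrandAddRel_holds hc
  obtain ⟨n, r, r₁, r₂, -, -, -, rfl⟩ := hc
  by_cases h : n = d
  · simp only [map_sub, eval_of] at h0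
    simpa [h] using h0
  · simp [h]

/-- Change of variables preserves `dimEval d`. [cite: KontsevichZagier2001, §1.2 rule (2)] -/
theorem dimEval_eq_zero_of_mem_changeOfVariablesRel (d : ℕ) {c : FormalRep}
    (hc : c ∈ changeOfVariablesRel) : dimEval d c = 0 := by
  have h0 := eval_eq_zero_of_mem_changeOfVariablesRel_holds hc
  obtain ⟨n, r, r', Φ, Φ', -, -, -, -, -, rfl⟩ := hc
  by_cases h : n = d
  · simp only [map_sub, eval_of] at h0
    simpa [h] using h0
  · simp [h]

/-- A Newton–Leibniz move is detected by `dimEval`: `dimEval (n+1) ([r] − [r']) = value r`.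
[cite: KontsevichZagier2001, §1.2 rule (3)] -/
theorem dimEval_succ_of_sub_of (r : IntegralRep (n + 1)) (r' : IntegralRep n) :
    dimEval (n + 1) (KZ.of r - KZ.of r') = r.value := by
  simp

/-- The Newton–Leibniz-free ("scissors + reparametrisation") sub-calculus: the subgroup generated
by moves (1a), (1b), (2). [cite: KontsevichZagier2001, §1.2] -/
def noNL : AddSubgroup FormalRep :=
  AddSubgroup.closure (domainAddRel ∪ integrandAddRel ∪ changeOfVariablesRel)

/-- `noNL ≤ relations`. [cite: KontsevichZagier2001, §1.2] -/
theorem noNL_le_relations : noNL ≤ relations :=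
  AddSubgroup.closure_mono fun _ hc => Or.inl hc

/-- **Moves (1a) + (1b) + (2) preserve every `dimEval d`.** [cite: KontsevichZagier2001, §1.2] -/
theorem noNL_le_ker_dimEval (d : ℕ) : noNL ≤ (dimEval d).ker := by
  refine (AddSubgroup.closure_le _).mpr ?_
  rintro c ((hc | hc) | hc)
  · exact dimEval_eq_zero_of_mem_domainAddRel d hc
  · exact dimEval_eq_zero_of_mem_integrandAddRel d hc
  · exact dimEval_eq_zero_of_mem_changeOfVariablesRel d hc

end DimEval


section Moments

variable {q₂ q₃ : ℚ}

/-- The region `D` under the graph is open. [folklore] -/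
theorem isOpen_underGraph : IsOpen (underGraph q₂ q₃) := by
  have h1 : IsOpen {p : Fin 2 → ℝ | 0 < cubic q₂ q₃ (p 0)} :=
    isOpen_lt continuous_const (continuous_cubic.comp (continuous_apply 0))
  have h2 : IsOpen {p : Fin 2 → ℝ | ∃ t : ℝ, p 0 < t ∧ cubic q₂ q₃ t < 0} := by
    rw [Set.setOf_exists]
    exact isOpen_iUnion fun t => by
      by_cases hft : cubic q₂ q₃ t < 0
      · simpa [hft] using isOpen_lt (continuous_apply 0) continuous_const
      · simp [hft]
  have h3 : IsOpen {p : Fin 2 → ℝ | 0 < p 1} := isOpen_lt continuous_const (continuous_apply 1)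
  have h4 : IsOpen {p : Fin 2 → ℝ | p 1 ^ 2 < cubic q₂ q₃ (p 0)} :=
    isOpen_lt ((continuous_apply 1).pow 2) (continuous_cubic.comp (continuous_apply 0))
  have : underGraph q₂ q₃ = ({p | 0 < cubic q₂ q₃ (p 0)} ∩ {p | ∃ t : ℝ, p 0 < t ∧
      cubic q₂ q₃ t < 0}) ∩ {p | 0 < p 1} ∩ {p : Fin 2 → ℝ | p 1 ^ 2 < cubic q₂ q₃ (p 0)} := by
    ext p; simp only [underGraph, mem_setOf_eq, mem_inter_iff]; tauto
  rw [this]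
  exact ((h1.inter h2).inter h3).inter h4

/-- An explicit point of `D` off the axis `x = 0` when `disc > 0`:
`(−m, √f(−m)/2)`, `m = √(q₂/12)`. [folklore] -/
theorem exists_mem_underGraph_ne_zero (h : 0 < disc q₂ q₃) :
    ∃ p ∈ underGraph q₂ q₃, p 0 ≠ 0 := by
  have hm := neg_sqrt_mem_oval (q₃ := q₃) h
  obtain ⟨hpos, t, ht, hft⟩ := hm
  set m := Real.sqrt (q₂ / 12) with hm_def
  have hdisc := h
  unfold disc at hdisc
  have hq : (0 : ℝ) < q₂ := by
    by_contra hle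
    push Not at hle
    have h3 : (q₂ : ℝ) ^ 3 ≤ 0 := by
      have : (q₂ : ℝ) ^ 3 = q₂ * q₂ ^ 2 := by ring
      rw [this]; exact mul_nonpos_of_nonpos_of_nonneg hle (sq_nonneg _)
    nlinarith [sq_nonneg (q₃ : ℝ)]
  have hm0 : 0 < m := Real.sqrt_pos.2 (by positivity)
  set y := Real.sqrt (cubic q₂ q₃ (-m)) / 2 with hy
  have hy0 : 0 < y := by positivity
  have hy2 : y ^ 2 < cubic q₂ q₃ (-m) := by
    have : y ^ 2 = cubic q₂ q₃ (-m) / 4 := by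
      rw [hy, div_pow, Real.sq_sqrt hpos.le]; norm_num
    rw [this]; linarith
  refine ⟨![-m, y], ⟨⟨?_, t, ?_, hft⟩, ?_, ?_⟩, ?_⟩
  · simpa using hpos
  · simpa using ht
  · simpa using hy0
  · simpa using hy2
  · simp [hm0.ne']

/-- **Every 2-dimensional generator `[D, x^a y^b]` with `a` even has strictly positive value**
(the integrand is `≥ 0` on the open set `D` and `> 0` on `D ∩ {x ≠ 0} ≠ ∅`). [folklore] -/
theorem value_pos_of_gens₂ (hd : 0 < disc q₂ q₃) {r : IntegralRep 2} {a b : ℕ} (ha : Even a)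
    (hdom : r.domain = underGraph q₂ q₃)
    (hint : EqOn r.integrand (fun p => p 0 ^ a * p 1 ^ b) (underGraph q₂ q₃)) :
    0 < r.value := by
  have hmeas : MeasurableSet (underGraph q₂ q₃) := isOpen_underGraph.measurableSet
  have hri : IntegrableOn (fun p : Fin 2 → ℝ => p 0 ^ a * p 1 ^ b) (underGraph q₂ q₃) :=
    (hdom ▸ r.integrableOn).congr_fun hint hmeas
  unfold IntegralRep.value
  rw [hdom, setIntegral_congr_fun hmeas hint]
  have hnn : 0 ≤ᵐ[volume.restrict (underGraph q₂ q₃)] fun p : Fin 2 → ℝ => p 0 ^ a * p 1 ^ b := by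
    refine ae_restrict_of_forall_mem hmeas fun p hp => ?_
    exact mul_nonneg (ha.pow_nonneg _) (pow_nonneg hp.2.1.le _)
  rw [setIntegral_pos_iff_support_of_nonneg_ae hnn hri]
  obtain ⟨p₀, hp₀, hp₀0⟩ := exists_mem_underGraph_ne_zero (q₃ := q₃) hd
  have hsub : underGraph q₂ q₃ ∩ {p | p 0 ≠ 0} ⊆
      Function.support (fun p : Fin 2 → ℝ => p 0 ^ a * p 1 ^ b) ∩ underGraph q₂ q₃ := by
    intro p hp
    refine ⟨?_, hp.1⟩
    rw [Function.mem_support]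
    exact mul_ne_zero (pow_ne_zero _ hp.2) (pow_ne_zero _ hp.1.2.1.ne')
  refine lt_of_lt_of_le ?_ (measure_mono hsub)
  have hopen : IsOpen (underGraph q₂ q₃ ∩ {p : Fin 2 → ℝ | p 0 ≠ 0}) :=
    isOpen_underGraph.inter (isOpen_ne_fun (continuous_apply 0) continuous_const)
  exact hopen.measure_pos volume ⟨p₀, hp₀, hp₀0⟩

/-- `dimEval 2` kills every combination of 1-dimensional generators. [folklore] -/
theorem dimEval_two_eq_zero_of_mem_closure_gens₁ {c : FormalRep}
    (hc : c ∈ AddSubgroup.closure (gens₁ q₂ q₃)) : dimEval 2 c = 0 := by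
  induction hc using AddSubgroup.closure_induction with
  | mem x hx =>
    obtain ⟨r, m, -, -, rfl⟩ := hx
    simp
  | zero => simp
  | add x y _ _ hx hy => simp [hx, hy]
  | neg x _ hx => simp [hx]

/-- **The reduction of a moment to the 1-dimensional normal form NEEDS a Newton–Leibniz move**:
for `a` even, `[D, x^a y^b] − c ∉ noNL` for every combination `c` of the 1-dimensional
generators (`dimEval 2` is `value [D, x^a y^b] > 0` on the left, `0` on `noNL`). In particular
the crux is not a statement of the scissors sub-calculus: any proof must instantiate
`KZ.newtonLeibnizRel` (the route's "rule 3 along `y`"). [folklore] -/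
theorem of_gens₂_sub_not_mem_noNL (hd : 0 < disc q₂ q₃) {r : IntegralRep 2} {a b : ℕ}
    (ha : Even a) (hdom : r.domain = underGraph q₂ q₃)
    (hint : EqOn r.integrand (fun p => p 0 ^ a * p 1 ^ b) (underGraph q₂ q₃))
    {c : FormalRep} (hc : c ∈ AddSubgroup.closure (gens₁ q₂ q₃)) :
    KZ.of r - c ∉ noNL := by
  intro h
  have hk := noNL_le_ker_dimEval 2 h
  rw [AddMonoidHom.mem_ker, map_sub, dimEval_two_eq_zero_of_mem_closure_gens₁ hc,
    dimEval_of] at hk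
  simp only [if_true, sub_zero] at hk
  exact (value_pos_of_gens₂ hd ha hdom hint).ne' hk

/-- Kernel-level form: a value-`0` combination whose 2-dimensional part has non-zero value is
not derivable without Newton–Leibniz. [folklore] -/
theorem not_mem_noNL_of_dimEval_ne_zero {c : FormalRep} {d : ℕ} (h : dimEval d c ≠ 0) :
    c ∉ noNL := fun hc => h (noNL_le_ker_dimEval d hc)

end Moments


/-! ## §4 The model curve `y² = 4x³ − 4x` (`q₂ = 4`, `q₃ = 0`; roots `−1, 0, 1`; `σ = (−1, 0)`;
CM by `ℤ[i]`, `j = 1728`): honest generators, one PROVED period relation, and two refuted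
sub-calculus strengthenings -/

section ModelCurve

open Literature.ModelTheory.ExponentialFields (IsSemialgebraic isSemialgebraic_setOf_eval_pos)
open MvPolynomial (aeval X C)

/-- The model cubic. [folklore] -/
theorem cubic_four_zero (x : ℝ) : cubic 4 0 x = 4 * x ^ 3 - 4 * x := by
  unfold cubic; push_cast; ring

/-- Its discriminant is `64 > 0`. [folklore] -/
theorem disc_four_zero : disc 4 0 = 64 := by
  unfold disc; norm_num

/-- On the model curve the oval is literally the interval `(−1, 0)`. [folklore] -/
theorem oval_four_zero : oval 4 0 = {p | -1 < p 0 ∧ p 0 < 0} := by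
  ext p
  simp only [oval, mem_setOf_eq, cubic_four_zero]
  constructor
  · rintro ⟨hpos, t, hpt, hft⟩
    have hx : 0 < p 0 * (p 0 - 1) * (p 0 + 1) := by nlinarith
    have ht' : t * (t - 1) * (t + 1) < 0 := by nlinarith
    by_contra hcon
    have hx1 : 1 < p 0 := by
      by_contra h1
      push Not at h1
      rcases not_and_or.mp hcon with h | h
      · push Not at h
        have : p 0 * (p 0 - 1) * (p 0 + 1) ≤ 0 :=
          mul_nonpos_of_nonneg_of_nonpos (mul_nonneg_of_nonpos_of_nonpos (by linarith) (by linarith))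
            (by linarith)
        linarith
      · push Not at h
        have : p 0 * (p 0 - 1) * (p 0 + 1) ≤ 0 :=
          mul_nonpos_of_nonpos_of_nonneg (mul_nonpos_of_nonneg_of_nonpos h (by linarith)) (by linarith)
        linarith
    have : 0 < t * (t - 1) * (t + 1) := by
      have h1 : 0 < t := by linarith
      have h2 : 0 < t - 1 := by linarith
      have h3 : 0 < t + 1 := by linarith
      positivity
    linarith
  · rintro ⟨h1, h2⟩
    refine ⟨?_, 1 / 2, by linarith, by norm_num⟩
    have : 0 < (-p 0) * (1 - p 0) * (p 0 + 1) := by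
      have h3 : 0 < -p 0 := by linarith
      have h4 : 0 < 1 - p 0 := by linarith
      have h5 : 0 < p 0 + 1 := by linarith
      positivity
    nlinarith

/-- The oval of the model curve is `ℚ`-semialgebraic (quantifier-free: `{0 < x + 1} ∩ {0 < −x}`).
[folklore] -/
theorem isSemialgebraic_oval_four_zero : IsSemialgebraic ℚ (oval 4 0) := by
  rw [oval_four_zero]
  have h1 := isSemialgebraic_setOf_eval_pos (k := ℚ) (R := ℝ) (X 0 + 1 : MvPolynomial (Fin 1) ℚ)
  have h2 := isSemialgebraic_setOf_eval_pos (k := ℚ) (R := ℝ) (-X 0 : MvPolynomial (Fin 1) ℚ)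
  convert h1.inter h2 using 1
  ext p
  simp only [mem_setOf_eq, mem_inter_iff, map_add, map_one, MvPolynomial.aeval_X, map_neg]
  constructor
  · rintro ⟨h1, h2⟩; exact ⟨by linarith, by linarith⟩
  · rintro ⟨h1, h2⟩; exact ⟨by linarith, by linarith⟩

/-- The model cubic as a `ℚ`-polynomial in `X 0`. [folklore] -/
def cubicPoly : MvPolynomial (Fin 1) ℚ := 4 * X 0 ^ 3 - 4 * X 0

/-- Evaluation of `cubicPoly`. [folklore] -/
theorem aeval_cubicPoly (p : Fin 1 → ℝ) : aeval p cubicPoly = cubic 4 0 (p 0) := by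
  simp [cubicPoly, cubic_four_zero, map_ofNat]

/-- The generator integrands `x^m/√f` are `ℚ`-semialgebraic on the oval: `x^m · √(1/f)` with
the tree's `isSemialgebraicFunOn_aeval_div_aeval`, `IsSemialgebraicFunOn.sqrt_holds`,
`IsSemialgebraicFunOn.mul_holds`. [cite: BochnakCosteRoy1998, Prop. 2.2.6] -/
theorem isSemialgebraicFunOn_genIntegrand (m : ℕ) :
    IsSemialgebraicFunOn ℚ (oval 4 0) (fun p => p 0 ^ m / Real.sqrt (cubic 4 0 (p 0))) := by
  have hs := isSemialgebraic_oval_four_zero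
  have h1 : IsSemialgebraicFunOn ℚ (oval 4 0)
      (fun p => aeval p (X 0 ^ m : MvPolynomial (Fin 1) ℚ)) := isSemialgebraicFunOn_aeval hs _
  have h2 : IsSemialgebraicFunOn ℚ (oval 4 0)
      (fun p => aeval p (1 : MvPolynomial (Fin 1) ℚ) / aeval p cubicPoly) :=
    isSemialgebraicFunOn_aeval_div_aeval hs _ _ fun p hp => by
      rw [aeval_cubicPoly]; exact hp.1.ne'
  have h3 := IsSemialgebraicFunOn.sqrt_holds h2
  have h4 := IsSemialgebraicFunOn.mul_holds h1 h3
  refine h4.congr fun p hp => ?_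
  simp only [Pi.mul_apply, map_pow, MvPolynomial.aeval_X, map_one, aeval_cubicPoly]
  rw [Real.sqrt_div' _ hp.1.le, Real.sqrt_one, mul_one_div]

/-! ### Integrability of `x^m/√f` on the oval: comparison with `1/√((−x)(x+1)) = d/dx arcsin(2x+1)` -/

/-- Lower bound `f(x) ≥ 4(−x)(x + 1)` on `(−1, 0)` (`f = 4(−x)(x+1)(1−x)`, `1 − x ≥ 1`). [folklore] -/
theorem cubic_ge_quad {x : ℝ} (hx : x ∈ Ioo (-1 : ℝ) 0) : 4 * (-x * (x + 1)) ≤ cubic 4 0 x := by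
  rw [cubic_four_zero]
  obtain ⟨h1, h2⟩ := hx
  have hq : 0 ≤ -x * (x + 1) := mul_nonneg (by linarith) (by linarith)
  nlinarith

/-- `f > 0` on `(−1, 0)`. [folklore] -/
theorem cubic_pos {x : ℝ} (hx : x ∈ Ioo (-1 : ℝ) 0) : 0 < cubic 4 0 x := by
  obtain ⟨h1, h2⟩ := hx
  have hq : 0 < -x * (x + 1) := mul_pos (by linarith) (by linarith)
  linarith [cubic_ge_quad ⟨h1, h2⟩]

/-- `arcsin (2x + 1)` is a primitive of `1/√((−x)(x+1))` on `(−1, 0)`. [folklore] -/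
theorem hasDerivAt_arcsin_affine {x : ℝ} (hx : x ∈ Ioo (-1 : ℝ) 0) :
    HasDerivAt (fun x => Real.arcsin (2 * x + 1)) (1 / Real.sqrt (-x * (x + 1))) x := by
  obtain ⟨h1, h2⟩ := hx
  have hu1 : 2 * x + 1 ≠ -1 := by intro h; linarith
  have hu2 : 2 * x + 1 ≠ 1 := by intro h; linarith
  have hlin : HasDerivAt (fun x : ℝ => 2 * x + 1) 2 x := by
    simpa using ((hasDerivAt_id x).const_mul 2).add_const 1
  have h := (Real.hasDerivAt_arcsin hu1 hu2).comp x hlin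
  have hsq : Real.sqrt (1 - (2 * x + 1) ^ 2) = 2 * Real.sqrt (-x * (x + 1)) := by
    have : 1 - (2 * x + 1) ^ 2 = 2 ^ 2 * (-x * (x + 1)) := by ring
    rw [this, Real.sqrt_mul (by norm_num : (0 : ℝ) ≤ 2 ^ 2) (-x * (x + 1)),
      Real.sqrt_sq (by norm_num : (0 : ℝ) ≤ 2)]
  have hpos : 0 < Real.sqrt (-x * (x + 1)) := Real.sqrt_pos.2 (mul_pos (by linarith) (by linarith))
  refine h.congr_deriv ?_
  rw [hsq]
  field_simp

/-- `1/√((−x)(x+1))` is integrable on `(−1, 0)`: it is the non-negative derivative of the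
continuous function `arcsin (2x + 1)` (`intervalIntegral.integrableOn_deriv_of_nonneg`), no
improper-integral estimate needed. [folklore] -/
theorem integrableOn_inv_sqrt_quad :
    IntegrableOn (fun x : ℝ => 1 / Real.sqrt (-x * (x + 1))) (Ioo (-1 : ℝ) 0) := by
  have hcont : ContinuousOn (fun x : ℝ => Real.arcsin (2 * x + 1)) (Icc (-1 : ℝ) 0) :=
    (Real.continuous_arcsin.comp (by fun_prop)).continuousOn
  have h := intervalIntegral.integrableOn_deriv_of_nonneg hcont
    (fun x hx => hasDerivAt_arcsin_affine hx) (fun x _ => by positivity)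
  exact h.mono_set Ioo_subset_Ioc_self

/-- Pointwise domination `|x^m/√f| ≤ (1/2)/√((−x)(x+1))` on `(−1, 0)`. [folklore] -/
theorem norm_genIntegrand_le {m : ℕ} {x : ℝ} (hx : x ∈ Ioo (-1 : ℝ) 0) :
    ‖x ^ m / Real.sqrt (cubic 4 0 x)‖ ≤ 1 / 2 * (1 / Real.sqrt (-x * (x + 1))) := by
  obtain ⟨h1, h2⟩ := hx
  have hq : 0 < -x * (x + 1) := mul_pos (by linarith) (by linarith)
  have hf : 0 < cubic 4 0 x := cubic_pos ⟨h1, h2⟩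
  have hsf : 0 < Real.sqrt (cubic 4 0 x) := Real.sqrt_pos.2 hf
  have hsq : 0 < Real.sqrt (-x * (x + 1)) := Real.sqrt_pos.2 hq
  rw [Real.norm_eq_abs, abs_div, abs_of_pos hsf, abs_pow]
  have hxm : |x| ^ m ≤ 1 := pow_le_one₀ (abs_nonneg x) (abs_le.2 ⟨by linarith, by linarith⟩)
  have hsfq : 2 * Real.sqrt (-x * (x + 1)) ≤ Real.sqrt (cubic 4 0 x) := by
    have : 2 * Real.sqrt (-x * (x + 1)) = Real.sqrt (4 * (-x * (x + 1))) := by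
      rw [show (4 : ℝ) = 2 ^ 2 by norm_num, Real.sqrt_mul (by norm_num : (0 : ℝ) ≤ 2 ^ 2) (-x * (x + 1)),
        Real.sqrt_sq (by norm_num : (0 : ℝ) ≤ 2)]
    rw [this]
    exact Real.sqrt_le_sqrt (cubic_ge_quad ⟨h1, h2⟩)
  calc |x| ^ m / Real.sqrt (cubic 4 0 x) ≤ 1 / Real.sqrt (cubic 4 0 x) :=
        div_le_div_of_nonneg_right hxm hsf.le
    _ ≤ 1 / (2 * Real.sqrt (-x * (x + 1))) := one_div_le_one_div_of_le (by positivity) hsfq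
    _ = 1 / 2 * (1 / Real.sqrt (-x * (x + 1))) := by ring

/-- The generator integrands restricted to `ℝ` are continuous on `(−1, 0)`. [folklore] -/
theorem continuousOn_genIntegrand (m : ℕ) :
    ContinuousOn (fun x : ℝ => x ^ m / Real.sqrt (cubic 4 0 x)) (Ioo (-1 : ℝ) 0) := by
  refine ContinuousOn.div (by fun_prop) ?_ fun x hx => (Real.sqrt_pos.2 (cubic_pos hx)).ne'
  exact (Real.continuous_sqrt.comp continuous_cubic).continuousOn

/-- **`x^m/√f` is integrable on `(−1, 0)`** (domination by `(1/2)·d/dx arcsin(2x+1)`). [folklore] -/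
theorem integrableOn_genIntegrand (m : ℕ) :
    IntegrableOn (fun x : ℝ => x ^ m / Real.sqrt (cubic 4 0 x)) (Ioo (-1 : ℝ) 0) := by
  refine Integrable.mono' ((integrableOn_inv_sqrt_quad.const_mul (1 / 2 : ℝ))) ?_ ?_
  · exact (continuousOn_genIntegrand m).aestronglyMeasurable measurableSet_Ioo
  · exact ae_restrict_of_forall_mem measurableSet_Ioo fun x hx => norm_genIntegrand_le hx

/-! ### Transfer to `ℝ¹ = Fin 1 → ℝ` and the honest generators `[σ, x^m/√f]` -/

/-- `ℝ¹ ≃ ℝ`, `p ↦ p 0`. [folklore] -/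
def e1 : (Fin 1 → ℝ) ≃ᵐ ℝ := MeasurableEquiv.funUnique (Fin 1) ℝ

/-- `e1 p = p 0`. [folklore] -/
@[simp] theorem e1_apply (p : Fin 1 → ℝ) : e1 p = p 0 := rfl

/-- `e1` preserves Lebesgue measure. [folklore] -/
theorem measurePreserving_e1 : MeasurePreserving e1 volume volume :=
  volume_preserving_funUnique (Fin 1) ℝ

/-- The oval as a preimage under `e1`. [folklore] -/
theorem oval_eq_preimage : oval 4 0 = e1 ⁻¹' Ioo (-1 : ℝ) 0 := by
  rw [oval_four_zero]; ext p; simp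

/-- Integrability of the generator integrands on the oval in `ℝ¹`. [folklore] -/
theorem integrableOn_genIntegrand_oval (m : ℕ) :
    IntegrableOn (fun p : Fin 1 → ℝ => p 0 ^ m / Real.sqrt (cubic 4 0 (p 0))) (oval 4 0) := by
  rw [oval_eq_preimage]
  exact (measurePreserving_e1.integrableOn_comp_preimage e1.measurableEmbedding).mpr
    (integrableOn_genIntegrand m)

/-- **The honest generator `[σ, x^m/√f]` of the model sector** (domain, integrand, both
semialgebraicity certificates and absolute integrability supplied): the set `gens₁ 4 0` — hence
`S` of the crux at `(q₂, q₃) = (4, 0)` — is inhabited, so the crux is not trivially true for want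
of representations. [cite: KontsevichZagier2001, §1.1] -/
def genRep (m : ℕ) : IntegralRep 1 where
  domain := oval 4 0
  integrand := fun p => p 0 ^ m / Real.sqrt (cubic 4 0 (p 0))
  isSemialgebraic_domain := isSemialgebraic_oval_four_zero
  isSemialgebraicFunOn_integrand := isSemialgebraicFunOn_genIntegrand m
  integrableOn := integrableOn_genIntegrand_oval m

/-- `[genRep m] ∈ gens₁ 4 0`. [folklore] -/
theorem of_genRep_mem_gens₁ (m : ℕ) : KZ.of (genRep m) ∈ gens₁ 4 0 :=
  ⟨genRep m, m, rfl, fun _ _ => rfl, rfl⟩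

/-- `[genRep m] ∈ gens 4 0`. [folklore] -/
theorem of_genRep_mem_gens (m : ℕ) : KZ.of (genRep m) ∈ gens 4 0 :=
  Or.inr (of_genRep_mem_gens₁ m)

/-- Non-vacuity of the generator set of the crux on the model curve. [folklore] -/
theorem gens_four_zero_nonempty : (gens 4 0).Nonempty := ⟨_, of_genRep_mem_gens 0⟩

/-- The value of `genRep m` as an interval integral `J_m = ∫_{-1}^{0} x^m dx/√f`. [folklore] -/
theorem value_genRep (m : ℕ) :
    (genRep m).value = ∫ x in (-1 : ℝ)..0, x ^ m / Real.sqrt (cubic 4 0 x) := by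
  unfold IntegralRep.value
  have key := measurePreserving_e1.setIntegral_preimage_emb e1.measurableEmbedding
    (fun x : ℝ => x ^ m / Real.sqrt (cubic 4 0 x)) (Ioo (-1 : ℝ) 0)
  simp only [e1_apply] at key
  rw [show (genRep m).domain = e1 ⁻¹' Ioo (-1 : ℝ) 0 from oval_eq_preimage]
  change ∫ p in e1 ⁻¹' Ioo (-1 : ℝ) 0, p 0 ^ m / Real.sqrt (cubic 4 0 (p 0)) = _
  rw [key, intervalIntegral.integral_of_le (by norm_num), integral_Ioc_eq_integral_Ioo]

/-- Restricted value of `genRep m` over a window `(−1, w)`, `−1 ≤ w ≤ 0`. [folklore] -/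
theorem setIntegral_genRep_inter (m : ℕ) {w : ℝ} (hw1 : -1 ≤ w) (hw0 : w ≤ 0) :
    ∫ p in (genRep m).domain ∩ {p | p 0 < w}, (genRep m).integrand p =
      ∫ x in (-1 : ℝ)..w, x ^ m / Real.sqrt (cubic 4 0 x) := by
  have hset : (genRep m).domain ∩ {p : Fin 1 → ℝ | p 0 < w} = e1 ⁻¹' Ioo (-1 : ℝ) w := by
    change oval 4 0 ∩ _ = _
    rw [oval_four_zero]
    ext p
    simp only [mem_inter_iff, mem_setOf_eq, mem_preimage, e1_apply, mem_Ioo]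
    constructor
    · rintro ⟨⟨h1, -⟩, h3⟩; exact ⟨h1, h3⟩
    · rintro ⟨h1, h3⟩; exact ⟨⟨h1, by linarith⟩, h3⟩
  have key := measurePreserving_e1.setIntegral_preimage_emb e1.measurableEmbedding
    (fun x : ℝ => x ^ m / Real.sqrt (cubic 4 0 x)) (Ioo (-1 : ℝ) w)
  simp only [e1_apply] at key
  rw [hset]
  change ∫ p in e1 ⁻¹' Ioo (-1 : ℝ) w, p 0 ^ m / Real.sqrt (cubic 4 0 (p 0)) = _
  rw [key, intervalIntegral.integral_of_le hw1, integral_Ioc_eq_integral_Ioo]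

/-! ### The Hermite relation `3J₂ = J₀` on the model curve, PROVED: `(3x² − 1)/√f = d/dx (√f/2)` -/

/-- Derivative of the model cubic. [folklore] -/
theorem hasDerivAt_cubic (x : ℝ) : HasDerivAt (cubic 4 0) (12 * x ^ 2 - 4) x := by
  have h : cubic 4 0 = fun x : ℝ => 4 * x ^ 3 - 4 * x := funext cubic_four_zero
  rw [h]
  have h1 : HasDerivAt (fun x : ℝ => 4 * x ^ 3) (4 * (3 * x ^ 2)) x := by
    simpa using (hasDerivAt_pow 3 x).const_mul 4
  have h2 : HasDerivAt (fun x : ℝ => 4 * x) (4 * 1) x := (hasDerivAt_id x).const_mul 4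
  have h3 : HasDerivAt (fun y : ℝ => 4 * y ^ 3 - 4 * y) (4 * (3 * x ^ 2) - 4 * 1) x := h1.sub h2
  exact h3.congr_deriv (by ring)

/-- `√f/2` is a primitive of the Hermite exact form `(3x² − 1)/√f` on `(−1, 0)`. [folklore] -/
theorem hasDerivAt_half_sqrt_cubic {x : ℝ} (hx : x ∈ Ioo (-1 : ℝ) 0) :
    HasDerivAt (fun x => Real.sqrt (cubic 4 0 x) / 2)
      ((3 * x ^ 2 - 1) / Real.sqrt (cubic 4 0 x)) x := by
  have hf : 0 < cubic 4 0 x := cubic_pos hx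
  have h := ((hasDerivAt_cubic x).sqrt hf.ne').div_const 2
  refine h.congr_deriv ?_
  have hs : Real.sqrt (cubic 4 0 x) ≠ 0 := (Real.sqrt_pos.2 hf).ne'
  field_simp
  ring

/-- The Hermite exact form is integrable on `(−1, 0)`. [folklore] -/
theorem integrableOn_hermiteForm :
    IntegrableOn (fun x : ℝ => (3 * x ^ 2 - 1) / Real.sqrt (cubic 4 0 x)) (Ioo (-1 : ℝ) 0) := by
  have h2 : IntegrableOn ((fun x : ℝ => 3 * (x ^ 2 / Real.sqrt (cubic 4 0 x))) -
      fun x => x ^ 0 / Real.sqrt (cubic 4 0 x)) (Ioo (-1 : ℝ) 0) :=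
    ((integrableOn_genIntegrand 2).const_mul 3).sub (integrableOn_genIntegrand 0)
  refine h2.congr_fun (fun x _ => ?_) measurableSet_Ioo
  simp only [Pi.sub_apply, pow_zero]
  ring

/-- **Newton–Leibniz across the branch point** (the planner's "why it might fail", settled on the
model): for `−1 ≤ w ≤ 0`, `∫_{-1}^{w} (3x² − 1) dx/√f = √f(w)/2`, the primitive `√f/2` being
continuous on the CLOSED interval and vanishing at the root `−1`; in particular (`w = 0`)
`3J₂ − J₀ = 0`. [cite: BostanLairezSalvy2013, §1 (Hermite reduction)] -/
theorem integral_hermiteForm {w : ℝ} (hw1 : -1 ≤ w) (hw0 : w ≤ 0) :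
    ∫ x in (-1 : ℝ)..w, (3 * x ^ 2 - 1) / Real.sqrt (cubic 4 0 x) =
      Real.sqrt (cubic 4 0 w) / 2 := by
  have hcont : ContinuousOn (fun x => Real.sqrt (cubic 4 0 x) / 2) (Icc (-1 : ℝ) w) :=
    ((Real.continuous_sqrt.comp continuous_cubic).div_const 2).continuousOn
  have hderiv : ∀ x ∈ Ioo (-1 : ℝ) w, HasDerivAt (fun x => Real.sqrt (cubic 4 0 x) / 2)
      ((3 * x ^ 2 - 1) / Real.sqrt (cubic 4 0 x)) x :=
    fun x hx => hasDerivAt_half_sqrt_cubic ⟨hx.1, lt_of_lt_of_le hx.2 hw0⟩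
  have hint : IntervalIntegrable (fun x : ℝ => (3 * x ^ 2 - 1) / Real.sqrt (cubic 4 0 x))
      volume (-1) w :=
    (intervalIntegrable_iff_integrableOn_Ioo_of_le hw1).2
      (integrableOn_hermiteForm.mono_set (Ioo_subset_Ioo_right hw0))
  rw [intervalIntegral.integral_eq_sub_of_hasDerivAt_of_le hw1 hcont hderiv hint]
  have : cubic 4 0 (-1) = 0 := by rw [cubic_four_zero]; norm_num
  simp [this]

/-- `3·∫ x²/√f − ∫ 1/√f = ∫ (3x² − 1)/√f` over `(−1, w)`. [folklore] -/
theorem three_mul_integral_sub {w : ℝ} (hw1 : -1 ≤ w) (hw0 : w ≤ 0) :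
    3 * (∫ x in (-1 : ℝ)..w, x ^ 2 / Real.sqrt (cubic 4 0 x)) -
        ∫ x in (-1 : ℝ)..w, x ^ 0 / Real.sqrt (cubic 4 0 x) =
      ∫ x in (-1 : ℝ)..w, (3 * x ^ 2 - 1) / Real.sqrt (cubic 4 0 x) := by
  have hI : ∀ m : ℕ, IntervalIntegrable (fun x : ℝ => x ^ m / Real.sqrt (cubic 4 0 x)) volume (-1) w :=
    fun m => (intervalIntegrable_iff_integrableOn_Ioo_of_le hw1).2
      ((integrableOn_genIntegrand m).mono_set (Ioo_subset_Ioo_right hw0))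
  rw [← intervalIntegral.integral_const_mul, ← intervalIntegral.integral_sub ((hI 2).const_mul 3) (hI 0)]
  refine intervalIntegral.integral_congr fun x _ => ?_
  simp only [pow_zero]
  ring

/-- **The Hermite element** `c₀ = 3[σ, x²/√f] − [σ, 1/√f]` of the model sector. [folklore] -/
def hermiteElem : FormalRep := 3 • KZ.of (genRep 2) - KZ.of (genRep 0)

/-- `c₀` is a `ℤ`-combination of sector generators. [folklore] -/
theorem hermiteElem_mem_closure : hermiteElem ∈ AddSubgroup.closure (gens 4 0) :=
  sub_mem (AddSubgroup.nsmul_mem _ (AddSubgroup.subset_closure (of_genRep_mem_gens 2)) 3)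
    (AddSubgroup.subset_closure (of_genRep_mem_gens 0))

/-- **`c₀` has value `0`** (`3J₂ = J₀` on `y² = 4x³ − 4x`): a PROVED, non-trivial element of the
kernel the crux talks about. [cite: BostanLairezSalvy2013, §1 (Hermite reduction)] -/
theorem eval_hermiteElem : KZ.eval hermiteElem = 0 := by
  simp only [hermiteElem, map_sub, map_nsmul, eval_of, value_genRep, nsmul_eq_mul, Nat.cast_ofNat]
  rw [three_mul_integral_sub (by norm_num) le_rfl, integral_hermiteForm (by norm_num) le_rfl]
  have : cubic 4 0 0 = 0 := by rw [cubic_four_zero]; norm_num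
  simp [this]

/-- What the crux PREDICTS on the model curve: given rigidity of `(1, J₀, J₁)` for
`y² = 4x³ − 4x` (true: Chudnovsky 1976 / Masser, CM case `j = 1728`, `J₀ = Γ(1/4)²/(2√(2π))`;
not provable in the tree today), `c₀` is a relation. It is one on paper — ONE Newton–Leibniz move
with primitive `√f/2` on the closed band `[−1, 0]` plus additivity bookkeeping (support item
`HermiteExactFormVanishes`, `P = 1`). [folklore] -/
theorem crux_predicts_hermiteElem (h : EllipticMomentKernel) (hR : Rigid 4 0) :
    hermiteElem ∈ KZ.relations :=
  ellipticMomentKernel_iff.mp h 4 0 (by rw [disc_four_zero]; norm_num) hR _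
    hermiteElem_mem_closure eval_hermiteElem

/-! ### Refuted strengthening A: additivity moves alone do not generate the kernel -/

/-- The window `{all coordinates < −1/2}` (one per dimension). [folklore] -/
def window (n : ℕ) : Set (Fin n → ℝ) := {p | ∀ i, p i < -(1 / 2 : ℝ)}

/-- The windows are measurable. [folklore] -/
theorem measurableSet_window (n : ℕ) : MeasurableSet (window n) := by
  have : window n = ⋂ i, {p : Fin n → ℝ | p i < -(1 / 2 : ℝ)} := by
    ext p; simp [window]
  rw [this]
  exact MeasurableSet.iInter fun i => measurableSet_lt (measurable_pi_apply i) measurable_const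

/-- The window in dimension `1`. [folklore] -/
theorem window_one : window 1 = {p : Fin 1 → ℝ | p 0 < -(1 / 2 : ℝ)} := by
  ext p; simp [window, Fin.forall_fin_one]

/-- Restricted value of a generator over the window. [folklore] -/
theorem restrictedEval_genRep (m : ℕ) :
    restrictedEval window (KZ.of (genRep m)) =
      ∫ x in (-1 : ℝ)..(-(1 / 2)), x ^ m / Real.sqrt (cubic 4 0 x) := by
  rw [restrictedEval_of, window_one, setIntegral_genRep_inter m (by norm_num) (by norm_num)]

/-- **The restricted value of `c₀` over the window is `√f(−1/2)/2 = √6/8 ≠ 0`.** [folklore] -/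
theorem restrictedEval_hermiteElem :
    restrictedEval window hermiteElem = Real.sqrt (cubic 4 0 (-(1 / 2))) / 2 := by
  simp only [hermiteElem, map_sub, map_nsmul, restrictedEval_genRep, nsmul_eq_mul, Nat.cast_ofNat]
  rw [three_mul_integral_sub (by norm_num) (by norm_num), integral_hermiteForm (by norm_num) (by norm_num)]

/-- Positivity of that restricted value. [folklore] -/
theorem restrictedEval_hermiteElem_pos : 0 < restrictedEval window hermiteElem := by
  rw [restrictedEval_hermiteElem]
  have : 0 < cubic 4 0 (-(1 / 2)) := cubic_pos ⟨by norm_num, by norm_num⟩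
  positivity

/-- **`c₀` is NOT derivable by the additivity moves (1a) + (1b) alone** (they preserve every
restricted evaluation, `KZ.closure_add_le_ker_restrictedEval`). Any derivation of this kernel
element uses a change of variables or a Newton–Leibniz move. [folklore] -/
theorem hermiteElem_not_mem_closure_add :
    hermiteElem ∉ AddSubgroup.closure (domainAddRel ∪ integrandAddRel) := fun h =>
  restrictedEval_hermiteElem_pos.ne'
    ((AddMonoidHom.mem_ker).1 (closure_add_le_ker_restrictedEval window measurableSet_window h))

/-! ### Refuted strengthening B: reparametrisation + Newton–Leibniz alone do not either -/

/-- `c₀` has coefficient sum `2`. [folklore] -/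
theorem coeffSum_hermiteElem : coeffSum hermiteElem = 2 := by
  simp [hermiteElem]

/-- **`c₀` is NOT derivable by moves (2) + (3) alone** (they preserve the coefficient sum,
`KZ.closure_cov_nl_le_ker_coeffSum`): an additivity move is necessary as well. [folklore] -/
theorem hermiteElem_not_mem_closure_cov_nl :
    hermiteElem ∉ AddSubgroup.closure (changeOfVariablesRel ∪ newtonLeibnizRel) := fun h => by
  have h2 := (AddMonoidHom.mem_ker).1 (closure_cov_nl_le_ker_coeffSum h)
  rw [coeffSum_hermiteElem] at h2
  exact absurd h2 (by norm_num)

/-- Strengthening A of the kernel claim: additivity moves suffice. [folklore] -/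
def KernelClaimByAdditivity (q₂ q₃ : ℚ) : Prop :=
  ∀ c ∈ AddSubgroup.closure (gens q₂ q₃), KZ.eval c = 0 →
    c ∈ AddSubgroup.closure (domainAddRel ∪ integrandAddRel)

/-- Strengthening B of the kernel claim: moves (2) + (3) suffice. [folklore] -/
def KernelClaimByReparametrisation (q₂ q₃ : ℚ) : Prop :=
  ∀ c ∈ AddSubgroup.closure (gens q₂ q₃), KZ.eval c = 0 →
    c ∈ AddSubgroup.closure (changeOfVariablesRel ∪ newtonLeibnizRel)

/-- **Refutation of strengthening A on the model curve.** [folklore] -/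
theorem not_kernelClaimByAdditivity_four_zero : ¬ KernelClaimByAdditivity 4 0 := fun h =>
  hermiteElem_not_mem_closure_add (h _ hermiteElem_mem_closure eval_hermiteElem)

/-- **Refutation of strengthening B on the model curve.** [folklore] -/
theorem not_kernelClaimByReparametrisation_four_zero : ¬ KernelClaimByReparametrisation 4 0 :=
  fun h => hermiteElem_not_mem_closure_cov_nl (h _ hermiteElem_mem_closure eval_hermiteElem)

/-- The sub-calculus strengthening A of `EllipticMomentKernelWithoutRigidity` is false. [folklore] -/
theorem not_forall_kernelClaimByAdditivity :
    ¬ ∀ q₂ q₃ : ℚ, 0 < disc q₂ q₃ → KernelClaimByAdditivity q₂ q₃ := fun h =>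
  not_kernelClaimByAdditivity_four_zero (h 4 0 (by rw [disc_four_zero]; norm_num))

/-- The sub-calculus strengthening B of `EllipticMomentKernelWithoutRigidity` is false. [folklore] -/
theorem not_forall_kernelClaimByReparametrisation :
    ¬ ∀ q₂ q₃ : ℚ, 0 < disc q₂ q₃ → KernelClaimByReparametrisation q₂ q₃ := fun h =>
  not_kernelClaimByReparametrisation_four_zero (h 4 0 (by rw [disc_four_zero]; norm_num))

/-! ### §5 Positive control: the predicted relation `c₀ ∈ KZ.relations` IS derivable — one
Newton–Leibniz move on the CLOSED band `[−1, 0]` over the point `ℝ⁰`, plus bookkeeping -/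

open Literature.ModelTheory.ExponentialFields (isSemialgebraic_setOf_eval_eq_zero isSemialgebraic_univ)

/-- The Hermite exact form as a function on `ℝ¹`. [folklore] -/
def hermiteForm (z : Fin 1 → ℝ) : ℝ := (3 * z 0 ^ 2 - 1) / Real.sqrt (cubic 4 0 (z 0))

/-- The closed band `[−1, 0] ⊆ ℝ¹`, written in the literal shape of `KZ.newtonLeibnizRel` over the
base `univ ⊆ ℝ⁰` with the constant bounds `a = −1`, `b = 0`. [folklore] -/
def band : Set (Fin 1 → ℝ) :=
  {z | (Fin.init z : Fin 0 → ℝ) ∈ (univ : Set (Fin 0 → ℝ)) ∧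
    (fun _ => (-1 : ℝ)) (Fin.init z) ≤ z (Fin.last 0) ∧ z (Fin.last 0) ≤ (fun _ => (0 : ℝ)) (Fin.init z)}

/-- The two branch points `{−1, 0} ⊆ ℝ¹`. [folklore] -/
def ends : Set (Fin 1 → ℝ) := {z | z 0 = -1 ∨ z 0 = 0}

/-- `band = [−1, 0]`. [folklore] -/
theorem band_eq : band = {z : Fin 1 → ℝ | -1 ≤ z 0 ∧ z 0 ≤ 0} := by
  ext z; simp [band]

/-- `[−1, 0] = (−1, 0) ∪ {−1, 0}`. [folklore] -/
theorem band_eq_union : band = oval 4 0 ∪ ends := by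
  rw [band_eq, oval_four_zero]
  ext z
  simp only [mem_setOf_eq, mem_union, ends]
  constructor
  · rintro ⟨h1, h2⟩
    rcases h1.lt_or_eq with h1 | h1
    · rcases h2.lt_or_eq with h2 | h2
      · exact Or.inl ⟨h1, h2⟩
      · exact Or.inr (Or.inr h2)
    · exact Or.inr (Or.inl h1.symm)
  · rintro (⟨h1, h2⟩ | h | h)
    · exact ⟨h1.le, h2.le⟩
    · rw [h]; norm_num
    · rw [h]; norm_num

/-- `ends` is `ℚ`-semialgebraic (zero set of `(X + 1)·X`). [folklore] -/
theorem isSemialgebraic_ends : Literature.ModelTheory.ExponentialFields.IsSemialgebraic ℚ ends := by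
  have h := isSemialgebraic_setOf_eval_eq_zero (k := ℚ) (R := ℝ)
    ((X 0 + 1) * X 0 : MvPolynomial (Fin 1) ℚ)
  convert h using 1
  ext z
  simp only [ends, mem_setOf_eq, map_mul, map_add, MvPolynomial.aeval_X, map_one, mul_eq_zero]
  constructor
  · rintro (h | h)
    · exact Or.inl (by rw [h]; ring)
    · exact Or.inr h
  · rintro (h | h)
    · exact Or.inl (by linarith)
    · exact Or.inr h

/-- `ends` is a two-point set, hence Lebesgue-null in `ℝ¹`. [folklore] -/
theorem volume_ends : volume ends = 0 := by
  have : ends = {fun _ => -1, fun _ => 0} := by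
    ext z; simp [ends, funext_iff, Fin.forall_fin_one]
  rw [this]
  exact (Set.toFinite _).measure_zero _

/-- The band is `ℚ`-semialgebraic. [folklore] -/
theorem isSemialgebraic_band : Literature.ModelTheory.ExponentialFields.IsSemialgebraic ℚ band := by
  rw [band_eq_union]; exact isSemialgebraic_oval_four_zero.union isSemialgebraic_ends

/-- At the branch points the (junk-valued) Hermite form vanishes: `(3x² − 1)/√0 = 0`. [folklore] -/
theorem hermiteForm_eq_zero_of_mem_ends {z : Fin 1 → ℝ} (hz : z ∈ ends) : hermiteForm z = 0 := by
  have : cubic 4 0 (z 0) = 0 := by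
    rcases hz with h | h <;> rw [h, cubic_four_zero] <;> norm_num
  simp [hermiteForm, this]

/-- The Hermite form is `ℚ`-semialgebraic on the open oval (`(3x² − 1)·√(1/f)`). [folklore] -/
theorem isSemialgebraicFunOn_hermiteForm_oval : IsSemialgebraicFunOn ℚ (oval 4 0) hermiteForm := by
  have hs := isSemialgebraic_oval_four_zero
  have h1 : IsSemialgebraicFunOn ℚ (oval 4 0)
      (fun p => aeval p (3 * X 0 ^ 2 - 1 : MvPolynomial (Fin 1) ℚ)) := isSemialgebraicFunOn_aeval hs _
  have h2 : IsSemialgebraicFunOn ℚ (oval 4 0)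
      (fun p => aeval p (1 : MvPolynomial (Fin 1) ℚ) / aeval p cubicPoly) :=
    isSemialgebraicFunOn_aeval_div_aeval hs _ _ fun p hp => by
      rw [aeval_cubicPoly]; exact hp.1.ne'
  have h4 := IsSemialgebraicFunOn.mul_holds h1 (IsSemialgebraicFunOn.sqrt_holds h2)
  refine h4.congr fun p hp => ?_
  simp only [Pi.mul_apply, map_sub, map_mul, map_pow, MvPolynomial.aeval_X, map_one,
    aeval_cubicPoly, hermiteForm, map_ofNat]
  rw [Real.sqrt_div' _ hp.1.le, Real.sqrt_one, mul_one_div]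

/-- The Hermite form is `ℚ`-semialgebraic on the two branch points (it is `0` there). [folklore] -/
theorem isSemialgebraicFunOn_hermiteForm_ends : IsSemialgebraicFunOn ℚ ends hermiteForm :=
  (isSemialgebraicFunOn_aeval isSemialgebraic_ends (0 : MvPolynomial (Fin 1) ℚ)).congr
    fun z hz => by simp [hermiteForm_eq_zero_of_mem_ends hz]

/-- **The Hermite form is `ℚ`-semialgebraic on the CLOSED band** (gluing, the tree's
`IsSemialgebraicFunOn.union`). [folklore] -/
theorem isSemialgebraicFunOn_hermiteForm_band : IsSemialgebraicFunOn ℚ band hermiteForm := by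
  rw [band_eq_union]
  exact IsSemialgebraicFunOn.union isSemialgebraicFunOn_hermiteForm_oval
    isSemialgebraicFunOn_hermiteForm_ends (fun _ _ => rfl) (fun _ _ => rfl)

/-- Integrability of the Hermite form on the oval in `ℝ¹`. [folklore] -/
theorem integrableOn_hermiteForm_oval : IntegrableOn hermiteForm (oval 4 0) := by
  rw [oval_eq_preimage]
  exact (measurePreserving_e1.integrableOn_comp_preimage e1.measurableEmbedding).mpr
    integrableOn_hermiteForm

/-- Integrability of the Hermite form on the null set `ends`. [folklore] -/
theorem integrableOn_hermiteForm_ends : IntegrableOn hermiteForm ends := by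
  rw [IntegrableOn, Measure.restrict_eq_zero.2 volume_ends]
  exact integrable_zero_measure

/-- **Integrability of the Hermite form on the closed band** (unbounded at both ends). [folklore] -/
theorem integrableOn_hermiteForm_band : IntegrableOn hermiteForm band := by
  rw [band_eq_union]; exact integrableOn_hermiteForm_oval.union integrableOn_hermiteForm_ends

/-- The band representation `[[−1,0], (3x² − 1)/√f]` — the `r` of the Newton–Leibniz move. [folklore] -/
def bandRep : IntegralRep 1 where
  domain := band
  integrand := hermiteForm
  isSemialgebraic_domain := isSemialgebraic_band
  isSemialgebraicFunOn_integrand := isSemialgebraicFunOn_hermiteForm_band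
  integrableOn := integrableOn_hermiteForm_band

/-- The open-oval representation `[(−1,0), (3x² − 1)/√f]`. [folklore] -/
def ovalRep : IntegralRep 1 where
  domain := oval 4 0
  integrand := hermiteForm
  isSemialgebraic_domain := isSemialgebraic_oval_four_zero
  isSemialgebraicFunOn_integrand := isSemialgebraicFunOn_hermiteForm_oval
  integrableOn := integrableOn_hermiteForm_oval

/-- The null representation on the two branch points. [folklore] -/
def endsRep : IntegralRep 1 where
  domain := ends
  integrand := hermiteForm
  isSemialgebraic_domain := isSemialgebraic_ends
  isSemialgebraicFunOn_integrand := isSemialgebraicFunOn_hermiteForm_ends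
  integrableOn := integrableOn_hermiteForm_ends

/-- The base of the move: the point `ℝ⁰` with integrand `0` (`= F(0) − F(−1)` for `F = √f/2`).
[folklore] -/
def baseRep : IntegralRep 0 where
  domain := univ
  integrand := fun _ => 0
  isSemialgebraic_domain := isSemialgebraic_univ
  isSemialgebraicFunOn_integrand :=
    (isSemialgebraicFunOn_aeval isSemialgebraic_univ (0 : MvPolynomial (Fin 0) ℚ)).congr
      fun _ _ => by simp
  integrableOn := integrableOn_zero

/-- `Fin.snoc` into `ℝ¹` from `ℝ⁰`. [folklore] -/
theorem snoc_apply_zero (x : Fin 0 → ℝ) (t : ℝ) : (Fin.snoc x t : Fin 1 → ℝ) 0 = t := rfl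

/-- **The Hermite step is ONE legal Newton–Leibniz move**: `[bandRep] − [baseRep] ∈
KZ.newtonLeibnizRel` with `a = −1`, `b = 0`, primitive `F = √f/2` — `ℚ`-semialgebraic on the band,
continuous on the CLOSED fibre `[−1, 0]`, with derivative the (unbounded) integrand on the OPEN
fibre, `F(0) − F(−1) = 0`. This is the model instance of the support item
`HermiteExactFormVanishes` (`P = 1`) and settles the planner's legality worry on the model.
[cite: KontsevichZagier2001, §1.2 rule (3)] -/
theorem of_bandRep_sub_of_baseRep_mem_newtonLeibnizRel :
    KZ.of bandRep - KZ.of baseRep ∈ newtonLeibnizRel := by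
  refine ⟨0, bandRep, baseRep, fun _ => -1, fun _ => 0, fun z => Real.sqrt (cubic 4 0 (z 0)) / 2,
    ?_, ?_, ?_, fun _ _ => by norm_num, rfl, ?_, ?_, ?_, rfl⟩
  · -- `F = (1/2)·√f` is semialgebraic on the band
    have hF1 : IsSemialgebraicFunOn ℚ band (fun z => Real.sqrt (aeval z cubicPoly)) :=
      IsSemialgebraicFunOn.sqrt_holds (isSemialgebraicFunOn_aeval isSemialgebraic_band cubicPoly)
    have hc : IsSemialgebraicFunOn ℚ band (fun _ => (1 / 2 : ℝ)) := by
      refine isSemialgebraicFunOn_const_of_isAlgebraic isSemialgebraic_band ?_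
      have h2 : IsAlgebraic ℚ (((2 : ℕ) : ℝ)⁻¹) := (isAlgebraic_nat 2).inv
      simpa [one_div] using h2
    refine (IsSemialgebraicFunOn.mul_holds hc hF1).congr fun z _ => ?_
    simp only [Pi.mul_apply, aeval_cubicPoly]
    show 1 / 2 * Real.sqrt (cubic 4 0 (z 0)) = Real.sqrt (cubic 4 0 (z 0)) / 2
    ring
  · exact (isSemialgebraicFunOn_aeval isSemialgebraic_univ
      (MvPolynomial.C (-1) : MvPolynomial (Fin 0) ℚ)).congr fun _ _ => by simp
  · exact (isSemialgebraicFunOn_aeval isSemialgebraic_univ (0 : MvPolynomial (Fin 0) ℚ)).congr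
      fun _ _ => by simp
  · intro x _
    show ContinuousOn (fun t : ℝ => Real.sqrt (cubic 4 0 ((Fin.snoc x t : Fin 1 → ℝ) 0)) / 2) _
    simp only [snoc_apply_zero]
    exact ((Real.continuous_sqrt.comp continuous_cubic).div_const 2).continuousOn
  · intro x _ t ht
    show HasDerivAt (fun s : ℝ => Real.sqrt (cubic 4 0 ((Fin.snoc x s : Fin 1 → ℝ) 0)) / 2)
      (hermiteForm (Fin.snoc x t)) t
    simp only [hermiteForm, snoc_apply_zero]
    exact hasDerivAt_half_sqrt_cubic ht
  · intro x _
    show (0 : ℝ) = Real.sqrt (cubic 4 0 ((Fin.snoc x ((fun _ => (0 : ℝ)) x) : Fin 1 → ℝ) 0)) / 2 -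
      Real.sqrt (cubic 4 0 ((Fin.snoc x ((fun _ => (-1 : ℝ)) x) : Fin 1 → ℝ) 0)) / 2
    simp only [snoc_apply_zero, cubic_four_zero]
    norm_num

/-- A representation with zero integrand is a relation (`[z] − [z] − [z]` is an
integrand-additivity instance). [folklore] -/
theorem of_baseRep_mem_relations : KZ.of baseRep ∈ relations := by
  have h : KZ.of baseRep - KZ.of baseRep - KZ.of baseRep ∈ integrandAddRel :=
    ⟨0, baseRep, baseRep, baseRep, rfl, rfl, fun x _ => by simp [baseRep], rfl⟩
  have h' := integrandAddRel_subset_relations h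
  rw [sub_self, zero_sub] at h'
  simpa using relations.neg_mem h'

/-- `[bandRep] ∈ relations`. [folklore] -/
theorem of_bandRep_mem_relations : KZ.of bandRep ∈ relations := by
  have h1 := newtonLeibnizRel_subset_relations of_bandRep_sub_of_baseRep_mem_newtonLeibnizRel
  simpa using relations.add_mem h1 of_baseRep_mem_relations

/-- A representation on a null domain is a relation (`[e] − [e] − [e]` is a domain-additivity
instance). [folklore] -/
theorem of_endsRep_mem_relations : KZ.of endsRep ∈ relations := by
  have h : KZ.of endsRep - KZ.of endsRep - KZ.of endsRep ∈ domainAddRel :=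
    ⟨1, endsRep, endsRep, endsRep, (union_self _).symm, by simpa [endsRep] using volume_ends,
      fun _ _ => rfl, fun _ _ => rfl, rfl⟩
  have h' := domainAddRel_subset_relations h
  rw [sub_self, zero_sub] at h'
  simpa using relations.neg_mem h'

/-- Closed band versus open oval: ONE domain-additivity move. [folklore] -/
theorem of_bandRep_sub_sub_mem_domainAddRel :
    KZ.of bandRep - KZ.of ovalRep - KZ.of endsRep ∈ domainAddRel :=
  ⟨1, bandRep, ovalRep, endsRep, band_eq_union,
    measure_mono_null inter_subset_right volume_ends, fun _ _ => rfl, fun _ _ => rfl, rfl⟩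

/-- `[ovalRep] ∈ relations`. [folklore] -/
theorem of_ovalRep_mem_relations : KZ.of ovalRep ∈ relations := by
  have h1 := domainAddRel_subset_relations of_bandRep_sub_sub_mem_domainAddRel
  have h2 : KZ.of ovalRep = KZ.of bandRep - (KZ.of bandRep - KZ.of ovalRep - KZ.of endsRep) -
      KZ.of endsRep := by abel
  rw [h2]
  exact relations.sub_mem (relations.sub_mem of_bandRep_mem_relations h1) of_endsRep_mem_relations

/-- `[ovalRep] − [3·genRep 2] − [−genRep 0]` is ONE integrand-additivity move
(`(3x² − 1)/√f = 3·(x²/√f) + (−(1/√f))` on the oval). [folklore] -/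
theorem of_ovalRep_sub_sub_mem_integrandAddRel :
    KZ.of ovalRep - KZ.of ((genRep 2).constMul ((3 : ℕ) : ℝ) (isAlgebraic_nat 3)) -
      KZ.of (genRep 0).neg ∈ integrandAddRel := by
  refine ⟨1, ovalRep, (genRep 2).constMul ((3 : ℕ) : ℝ) (isAlgebraic_nat 3), (genRep 0).neg,
    rfl, rfl, fun z _ => ?_, rfl⟩
  simp only [Pi.add_apply, IntegralRep.integrand_constMul, IntegralRep.integrand_neg,
    Pi.neg_apply, Nat.cast_ofNat]
  show hermiteForm z = 3 * (z 0 ^ 2 / Real.sqrt (cubic 4 0 (z 0))) +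
    -(z 0 ^ 0 / Real.sqrt (cubic 4 0 (z 0)))
  simp only [hermiteForm, pow_zero]
  ring

/-- `[−r] + [r]` is a relation (integrand additivity with the zero representation on the same
domain). [folklore] -/
theorem of_neg_add_of_mem_relations {n : ℕ} (r : IntegralRep n) :
    KZ.of r.neg + KZ.of r ∈ relations := by
  set z := r.constMul ((0 : ℕ) : ℝ) (isAlgebraic_nat 0) with hz
  have h0 : KZ.of z ∈ relations := by
    simpa [z] using IntegralRep.of_constMul_nat_sub_nsmul_mem_relations r 0
  have h1 : KZ.of z - KZ.of r - KZ.of r.neg ∈ integrandAddRel :=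
    ⟨n, z, r, r.neg, rfl, rfl, fun x _ => by simp [z], rfl⟩
  have h2 := integrandAddRel_subset_relations h1
  have h3 : KZ.of r.neg + KZ.of r = KZ.of z - (KZ.of z - KZ.of r - KZ.of r.neg) := by abel
  rw [h3]
  exact relations.sub_mem h0 h2

/-- **`c₀ = 3[σ, x²/√f] − [σ, 1/√f] ∈ KZ.relations`**: the relation the crux predicts on the model
curve is derivable — one Newton–Leibniz move across the branch points, one domain-additivity move
(closed band vs open oval, null difference), one integrand-additivity move, and the integer-scaling
bookkeeping `[σ, 3g] ~ 3•[σ, g]` (tree: `of_constMul_nat_sub_nsmul_mem_relations`). Together with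
§4: `c₀ ∈ relations`, `c₀ ∉ ⟨(1a),(1b)⟩`, `c₀ ∉ ⟨(2),(3)⟩`. [folklore] -/
theorem hermiteElem_mem_relations : hermiteElem ∈ relations := by
  have hA := of_ovalRep_mem_relations
  have hB := integrandAddRel_subset_relations of_ovalRep_sub_sub_mem_integrandAddRel
  have hC := IntegralRep.of_constMul_nat_sub_nsmul_mem_relations (genRep 2) 3
  have hD := of_neg_add_of_mem_relations (genRep 0)
  have h : hermiteElem = KZ.of ovalRep -
      (KZ.of ovalRep - KZ.of ((genRep 2).constMul ((3 : ℕ) : ℝ) (isAlgebraic_nat 3)) -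
        KZ.of (genRep 0).neg) -
      (KZ.of ((genRep 2).constMul ((3 : ℕ) : ℝ) (isAlgebraic_nat 3)) - 3 • KZ.of (genRep 2)) -
      (KZ.of (genRep 0).neg + KZ.of (genRep 0)) := by
    simp only [hermiteElem]; abel
  rw [h]
  exact relations.sub_mem (relations.sub_mem (relations.sub_mem hA hB) hC) hD

/-- Equivalently: `[σ, x²/√f]` taken three times is KZ-equivalent to `[σ, 1/√f]` — `3J₂ = J₀` as a
derivation, not only as an equality of values. [folklore] -/
theorem three_nsmul_of_genRep_two_sub_mem_relations :
    3 • KZ.of (genRep 2) - KZ.of (genRep 0) ∈ relations := hermiteElem_mem_relations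

end ModelCurve

/-! ## §6 Non-vacuity for EVERY admissible parameter: roots, `σ = (e₃, e₂)` quantifier-free,
semialgebraicity and integrability of `x^m/√f`, honest generators in general -/

section GeneralCurve

open Literature.ModelTheory.ExponentialFields (IsSemialgebraic isSemialgebraic_setOf_eval_pos)
open MvPolynomial (aeval X C)

variable {q₂ q₃ : ℚ}

/-- `disc > 0` forces `q₂ > 0`. [folklore] -/
theorem q₂_pos_of_disc_pos (h : 0 < disc q₂ q₃) : (0 : ℝ) < q₂ := by
  unfold disc at h
  by_contra hle
  push Not at hle
  have h3 : (q₂ : ℝ) ^ 3 ≤ 0 := by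
    have : (q₂ : ℝ) ^ 3 = q₂ * q₂ ^ 2 := by ring
    rw [this]; exact mul_nonpos_of_nonpos_of_nonneg hle (sq_nonneg _)
  nlinarith [sq_nonneg (q₃ : ℝ)]

/-- Values at the critical points `∓m`, `m = √(q₂/12)`: `f(−m) > 0 > f(m)` when `disc > 0`.
[folklore] -/
theorem cubic_crit (h : 0 < disc q₂ q₃) :
    0 < cubic q₂ q₃ (-Real.sqrt (q₂ / 12)) ∧ cubic q₂ q₃ (Real.sqrt (q₂ / 12)) < 0 := by
  have hq := q₂_pos_of_disc_pos h
  unfold disc at h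
  set m := Real.sqrt (q₂ / 12) with hm
  have hm2 : m ^ 2 = q₂ / 12 := Real.sq_sqrt (by positivity)
  have hm0 : 0 < m := Real.sqrt_pos.2 (by positivity)
  have hfm : cubic q₂ q₃ (-m) = 2 / 3 * q₂ * m - q₃ := by
    unfold cubic; linear_combination (-4 * m) * hm2
  have hfp : cubic q₂ q₃ m = -(2 / 3 * q₂ * m) - q₃ := by
    unfold cubic; linear_combination (4 * m) * hm2
  have hkey : (q₃ : ℝ) ^ 2 < (2 / 3 * q₂ * m) ^ 2 := by
    have : (2 / 3 * (q₂ : ℝ) * m) ^ 2 = (q₂ : ℝ) ^ 3 / 27 := by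
      rw [mul_pow, hm2]; ring
    rw [this]; nlinarith
  have hpos : 0 < 2 / 3 * (q₂ : ℝ) * m := by positivity
  have hq3 := abs_lt.1 (abs_lt_of_sq_lt_sq hkey hpos.le)
  exact ⟨by rw [hfm]; linarith, by rw [hfp]; linarith⟩

/-- Far to the left the cubic is negative, far to the right positive: at `∓K`,
`K = 1 + |q₂| + |q₃|`. [folklore] -/
theorem cubic_far :
    cubic q₂ q₃ (-(1 + |(q₂ : ℝ)| + |(q₃ : ℝ)|)) < 0 ∧ 0 < cubic q₂ q₃ (1 + |(q₂ : ℝ)| + |(q₃ : ℝ)|) := by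
  set K : ℝ := 1 + |(q₂ : ℝ)| + |(q₃ : ℝ)| with hK
  have hK1 : 1 ≤ K := by have := abs_nonneg (q₂ : ℝ); have := abs_nonneg (q₃ : ℝ); linarith
  have hq2 : |(q₂ : ℝ)| ≤ K - 1 := by have := abs_nonneg (q₃ : ℝ); linarith
  have hq3 : |(q₃ : ℝ)| ≤ K - 1 := by have := abs_nonneg (q₂ : ℝ); linarith
  have hb2 := abs_le.1 hq2
  have hb3 := abs_le.1 hq3
  have hK2 : K ^ 2 ≤ K ^ 3 := by nlinarith
  have hKK : 0 ≤ K := by linarith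
  constructor
  · unfold cubic
    have : (q₂ : ℝ) * K ≤ (K - 1) * K := by nlinarith
    nlinarith
  · unfold cubic
    have : -(q₂ : ℝ) * K ≤ (K - 1) * K := by nlinarith
    nlinarith

/-- A cubic `4x³ − Ax − B` with three distinct roots `a, b, c` is `4(x − a)(x − b)(x − c)`
(local copy of `PeriodPair.cubic_eq_prod_of_roots`). [folklore] -/
theorem cubic_eq_prod_of_roots {a b c : ℝ} (hab : a ≠ b) (hac : a ≠ c) (hbc : b ≠ c)
    (ha : cubic q₂ q₃ a = 0) (hb : cubic q₂ q₃ b = 0) (hc : cubic q₂ q₃ c = 0) (x : ℝ) :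
    cubic q₂ q₃ x = 4 * (x - a) * (x - b) * (x - c) := by
  unfold cubic at *
  have h1 : 4 * (a ^ 2 + a * b + b ^ 2) - q₂ = 0 := by
    have : (a - b) * (4 * (a ^ 2 + a * b + b ^ 2) - q₂) = 0 := by linear_combination ha - hb
    exact (mul_eq_zero.mp this).resolve_left (sub_ne_zero.mpr hab)
  have h2 : 4 * (a ^ 2 + a * c + c ^ 2) - q₂ = 0 := by
    have : (a - c) * (4 * (a ^ 2 + a * c + c ^ 2) - q₂) = 0 := by linear_combination ha - hc
    exact (mul_eq_zero.mp this).resolve_left (sub_ne_zero.mpr hac)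
  have h3 : a + b + c = 0 := by
    have : (b - c) * (4 * (a + b + c)) = 0 := by linear_combination h1 - h2
    have := (mul_eq_zero.mp this).resolve_left (sub_ne_zero.mpr hbc)
    linarith
  have hc' : c = -a - b := by linarith
  subst hc'
  have hq : (q₂ : ℝ) = 4 * (a ^ 2 + a * b + b ^ 2) := by linarith
  have hq' : (q₃ : ℝ) = 4 * a ^ 3 - 4 * (a ^ 2 + a * b + b ^ 2) * a := by linarith
  rw [hq, hq']; ring

/-- **Three real roots, located**: `e₃ < −m < e₂ < m < e₁` (`m = √(q₂/12)`) with
`f = 4(x − e₃)(x − e₂)(x − e₁)`, for every rational cubic with `disc > 0` (three intermediate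
value theorems). [folklore] -/
theorem exists_roots (h : 0 < disc q₂ q₃) :
    ∃ e₃ e₂ e₁ : ℝ, e₃ < -Real.sqrt (q₂ / 12) ∧ -Real.sqrt (q₂ / 12) < e₂ ∧
      e₂ < Real.sqrt (q₂ / 12) ∧ Real.sqrt (q₂ / 12) < e₁ ∧
      ∀ x, cubic q₂ q₃ x = 4 * (x - e₃) * (x - e₂) * (x - e₁) := by
  have hq := q₂_pos_of_disc_pos h
  obtain ⟨hcm, hcp⟩ := cubic_crit h
  obtain ⟨hfl, hfr⟩ := cubic_far (q₂ := q₂) (q₃ := q₃)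
  set m := Real.sqrt (q₂ / 12) with hm
  set K : ℝ := 1 + |(q₂ : ℝ)| + |(q₃ : ℝ)| with hK
  have hm0 : 0 < m := Real.sqrt_pos.2 (by positivity)
  have hmK : m < K := by
    have hK1 : 1 ≤ K := by have := abs_nonneg (q₂ : ℝ); have := abs_nonneg (q₃ : ℝ); linarith
    have hm2 : m ^ 2 = q₂ / 12 := Real.sq_sqrt (by positivity)
    have hq2 : (q₂ : ℝ) ≤ |(q₂ : ℝ)| := le_abs_self _
    have : m ^ 2 < K ^ 2 := by have := abs_nonneg (q₃ : ℝ); nlinarith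
    exact lt_of_pow_lt_pow_left₀ 2 (by linarith) this
  have hcont : ∀ s : Set ℝ, ContinuousOn (cubic q₂ q₃) s := fun s =>
    (continuous_cubic (q₂ := q₂) (q₃ := q₃)).continuousOn
  -- e₃ ∈ (−K, −m)
  obtain ⟨e₃, ⟨h3a, h3b⟩, he₃⟩ : ∃ e ∈ Icc (-K) (-m), cubic q₂ q₃ e = 0 :=
    intermediate_value_Icc (by linarith) (hcont _) ⟨hfl.le, hcm.le⟩
  -- e₂ ∈ (−m, m)
  obtain ⟨e₂, ⟨h2a, h2b⟩, he₂⟩ : ∃ e ∈ Icc (-m) m, cubic q₂ q₃ e = 0 :=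
    intermediate_value_Icc' (by linarith) (hcont _) ⟨hcp.le, hcm.le⟩
  -- e₁ ∈ (m, K)
  obtain ⟨e₁, ⟨h1a, h1b⟩, he₁⟩ : ∃ e ∈ Icc m K, cubic q₂ q₃ e = 0 :=
    intermediate_value_Icc hmK.le (hcont _) ⟨hcp.le, hfr.le⟩
  have h3b' : e₃ < -m := lt_of_le_of_ne h3b (by rintro rfl; exact hcm.ne' he₃)
  have h2a' : -m < e₂ := lt_of_le_of_ne h2a (by rintro h'; rw [← h'] at he₂; exact hcm.ne' he₂)
  have h2b' : e₂ < m := lt_of_le_of_ne h2b (by rintro rfl; exact hcp.ne he₂)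
  have h1a' : m < e₁ := lt_of_le_of_ne h1a (by rintro h'; rw [← h'] at he₁; exact hcp.ne he₁)
  refine ⟨e₃, e₂, e₁, h3b', h2a', h2b', h1a', cubic_eq_prod_of_roots ?_ ?_ ?_ he₃ he₂ he₁⟩
  · exact (h3b'.trans h2a').ne
  · exact (h3b'.trans (h2a'.trans (h2b'.trans h1a'))).ne
  · exact (h2b'.trans h1a').ne

/-- Sign of the factored cubic to the right of the largest root. [folklore] -/
theorem cubic_pos_of_gt {e₃ e₂ e₁ x : ℝ} (h32 : e₃ < e₂) (h21 : e₂ < e₁)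
    (hf : ∀ x, cubic q₂ q₃ x = 4 * (x - e₃) * (x - e₂) * (x - e₁)) (hx : e₁ < x) :
    0 < cubic q₂ q₃ x := by
  rw [hf]
  have h1 : 0 < x - e₃ := by linarith
  have h2 : 0 < x - e₂ := by linarith
  have h3 : 0 < x - e₁ := by linarith
  positivity

/-- Where the factored cubic is positive: `(e₃, e₂) ∪ (e₁, ∞)`. [folklore] -/
theorem mem_Ioo_or_gt_of_cubic_pos {e₃ e₂ e₁ x : ℝ} (h32 : e₃ < e₂) (h21 : e₂ < e₁)
    (hf : ∀ x, cubic q₂ q₃ x = 4 * (x - e₃) * (x - e₂) * (x - e₁)) (hx : 0 < cubic q₂ q₃ x) :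
    x ∈ Ioo e₃ e₂ ∨ e₁ < x := by
  rw [hf] at hx
  by_cases h1 : e₁ < x
  · exact Or.inr h1
  push Not at h1
  left
  rcases h1.lt_or_eq with h1 | h1
  · -- x < e₁: (x - e₁) < 0 so (x - e₃)(x - e₂) < 0
    have hprod : (x - e₃) * (x - e₂) < 0 := by
      by_contra hcon
      push Not at hcon
      have : 4 * (x - e₃) * (x - e₂) * (x - e₁) ≤ 0 := by
        rw [show 4 * (x - e₃) * (x - e₂) * (x - e₁) = (4 * ((x - e₃) * (x - e₂))) * (x - e₁) by ring]
        exact mul_nonpos_of_nonneg_of_nonpos (by positivity) (by linarith)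
      linarith
    constructor
    · by_contra hxa
      push Not at hxa
      have : 0 ≤ (x - e₃) * (x - e₂) := mul_nonneg_of_nonpos_of_nonpos (by linarith) (by linarith)
      linarith
    · by_contra hxb
      push Not at hxb
      have : 0 ≤ (x - e₃) * (x - e₂) := mul_nonneg (by linarith) (by linarith)
      linarith
  · subst h1; simp at hx

/-- The factored cubic is positive on `(e₃, e₂)` and negative on `(e₂, e₁)`. [folklore] -/
theorem cubic_sign_of_roots {e₃ e₂ e₁ : ℝ} (h32 : e₃ < e₂) (h21 : e₂ < e₁)
    (hf : ∀ x, cubic q₂ q₃ x = 4 * (x - e₃) * (x - e₂) * (x - e₁)) :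
    (∀ x ∈ Ioo e₃ e₂, 0 < cubic q₂ q₃ x) ∧ ∀ x ∈ Ioo e₂ e₁, cubic q₂ q₃ x < 0 := by
  constructor
  · intro x hx
    rw [hf, show 4 * (x - e₃) * (x - e₂) * (x - e₁) = 4 * (x - e₃) * (e₂ - x) * (e₁ - x) by ring]
    have h1 : 0 < x - e₃ := by linarith [hx.1]
    have h2 : 0 < e₂ - x := by linarith [hx.2]
    have h3 : 0 < e₁ - x := by linarith [hx.2]
    positivity
  · intro x hx
    rw [hf]
    have h1 : 0 < x - e₃ := by linarith [hx.1]
    have h2 : 0 < x - e₂ := by linarith [hx.1]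
    have h3 : 0 < e₁ - x := by linarith [hx.2]
    have : 0 < 4 * (x - e₃) * (x - e₂) * (e₁ - x) := by positivity
    linarith

/-- **`σ = (e₃, e₂)`** for the located roots. [folklore] -/
theorem oval_eq_of_roots {e₃ e₂ e₁ : ℝ} (h32 : e₃ < e₂) (h21 : e₂ < e₁)
    (hf : ∀ x, cubic q₂ q₃ x = 4 * (x - e₃) * (x - e₂) * (x - e₁)) :
    oval q₂ q₃ = {p | p 0 ∈ Ioo e₃ e₂} := by
  obtain ⟨hpos, hneg⟩ := cubic_sign_of_roots h32 h21 hf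
  ext p
  simp only [oval, mem_setOf_eq]
  constructor
  · rintro ⟨hp, t, hpt, hft⟩
    rcases mem_Ioo_or_gt_of_cubic_pos h32 h21 hf hp with h | h
    · exact h
    · exact absurd hft (not_lt.2 (cubic_pos_of_gt h32 h21 hf (h.trans hpt)).le)
  · intro hp
    refine ⟨hpos _ hp, (e₂ + e₁) / 2, by linarith [hp.2], hneg _ ⟨by linarith, by linarith⟩⟩

/-- **`σ` quantifier-free**: `σ = {f > 0} ∩ ({x < 0} ∪ {12x² < q₂})` when `disc > 0` (the right
critical point `m = √(q₂/12)` separates `(e₃, e₂)` from `(e₁, ∞)`). [folklore] -/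
theorem oval_eq_setOf (h : 0 < disc q₂ q₃) :
    oval q₂ q₃ = {p | 0 < cubic q₂ q₃ (p 0) ∧ (p 0 < 0 ∨ 12 * p 0 ^ 2 < (q₂ : ℝ))} := by
  obtain ⟨e₃, e₂, e₁, h3, h2a, h2b, h1, hf⟩ := exists_roots h
  have hq := q₂_pos_of_disc_pos h
  set m := Real.sqrt (q₂ / 12) with hm
  have hm2 : m ^ 2 = q₂ / 12 := Real.sq_sqrt (by positivity)
  have hm0 : 0 < m := Real.sqrt_pos.2 (by positivity)
  have h32 : e₃ < e₂ := by linarith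
  have h21 : e₂ < e₁ := by linarith
  rw [oval_eq_of_roots h32 h21 hf]
  obtain ⟨hpos, -⟩ := cubic_sign_of_roots h32 h21 hf
  ext p
  simp only [mem_setOf_eq, mem_Ioo]
  constructor
  · intro hp
    refine ⟨hpos _ hp, ?_⟩
    by_cases hx : p 0 < 0
    · exact Or.inl hx
    · push Not at hx
      right
      have : p 0 < m := by linarith [hp.2]
      nlinarith
  · rintro ⟨hp, hx⟩
    rcases mem_Ioo_or_gt_of_cubic_pos h32 h21 hf hp with h' | h'
    · exact h'
    · exfalso
      have hxm : m < p 0 := by linarith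
      rcases hx with hx | hx
      · linarith
      · nlinarith

/-- The general cubic as a `ℚ`-polynomial. [folklore] -/
def cubicPolyQ (q₂ q₃ : ℚ) : MvPolynomial (Fin 1) ℚ := 4 * X 0 ^ 3 - C q₂ * X 0 - C q₃

/-- Evaluation of `cubicPolyQ`. [folklore] -/
theorem aeval_cubicPolyQ (p : Fin 1 → ℝ) : aeval p (cubicPolyQ q₂ q₃) = cubic q₂ q₃ (p 0) := by
  simp [cubicPolyQ, cubic, map_ofNat]

/-- **`σ` is `ℚ`-semialgebraic for every admissible parameter** (no Tarski–Seidenberg: the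
quantifier-free description `oval_eq_setOf`). [folklore] -/
theorem isSemialgebraic_oval (h : 0 < disc q₂ q₃) : IsSemialgebraic ℚ (oval q₂ q₃) := by
  rw [oval_eq_setOf h]
  have h1 := isSemialgebraic_setOf_eval_pos (k := ℚ) (R := ℝ) (cubicPolyQ q₂ q₃)
  have h2 := isSemialgebraic_setOf_eval_pos (k := ℚ) (R := ℝ) (-X 0 : MvPolynomial (Fin 1) ℚ)
  have h3 := isSemialgebraic_setOf_eval_pos (k := ℚ) (R := ℝ)
    (C q₂ - 12 * X 0 ^ 2 : MvPolynomial (Fin 1) ℚ)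
  convert h1.inter (h2.union h3) using 1
  ext p
  simp only [mem_setOf_eq, mem_inter_iff, mem_union, aeval_cubicPolyQ, map_neg,
    MvPolynomial.aeval_X, map_sub, map_mul, MvPolynomial.aeval_C, map_pow, eq_ratCast,
    map_ofNat]
  constructor
  · rintro ⟨hp, hx | hx⟩
    · exact ⟨hp, Or.inl (by linarith)⟩
    · exact ⟨hp, Or.inr (by linarith)⟩
  · rintro ⟨hp, hx | hx⟩
    · exact ⟨hp, Or.inl (by linarith)⟩
    · exact ⟨hp, Or.inr (by linarith)⟩

/-- The generator integrands are `ℚ`-semialgebraic on `σ` for every admissible parameter.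
[cite: BochnakCosteRoy1998, Prop. 2.2.6] -/
theorem isSemialgebraicFunOn_genIntegrandQ (h : 0 < disc q₂ q₃) (m : ℕ) :
    IsSemialgebraicFunOn ℚ (oval q₂ q₃) (fun p => p 0 ^ m / Real.sqrt (cubic q₂ q₃ (p 0))) := by
  have hs := isSemialgebraic_oval h
  have h1 : IsSemialgebraicFunOn ℚ (oval q₂ q₃)
      (fun p => aeval p (X 0 ^ m : MvPolynomial (Fin 1) ℚ)) := isSemialgebraicFunOn_aeval hs _
  have h2 : IsSemialgebraicFunOn ℚ (oval q₂ q₃)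
      (fun p => aeval p (1 : MvPolynomial (Fin 1) ℚ) / aeval p (cubicPolyQ q₂ q₃)) :=
    isSemialgebraicFunOn_aeval_div_aeval hs _ _ fun p hp => by
      rw [aeval_cubicPolyQ]; exact hp.1.ne'
  have h4 := IsSemialgebraicFunOn.mul_holds h1 (IsSemialgebraicFunOn.sqrt_holds h2)
  refine h4.congr fun p hp => ?_
  simp only [Pi.mul_apply, map_pow, MvPolynomial.aeval_X, map_one, aeval_cubicPolyQ]
  rw [Real.sqrt_div' _ hp.1.le, Real.sqrt_one, mul_one_div]

/-- `arcsin ((2x − a − b)/(b − a))` is a primitive of `1/√((x − a)(b − x))` on `(a, b)`. [folklore] -/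
theorem hasDerivAt_arcsin_chord {a b x : ℝ} (hab : a < b) (hx : x ∈ Ioo a b) :
    HasDerivAt (fun x => Real.arcsin ((2 * x - a - b) / (b - a)))
      (1 / Real.sqrt ((x - a) * (b - x))) x := by
  obtain ⟨h1, h2⟩ := hx
  have hl : 0 < b - a := by linarith
  have hu1 : (2 * x - a - b) / (b - a) ≠ -1 := by
    rw [Ne, div_eq_iff hl.ne']; intro h; linarith
  have hu2 : (2 * x - a - b) / (b - a) ≠ 1 := by
    rw [Ne, div_eq_iff hl.ne']; intro h; linarith
  have hlin : HasDerivAt (fun x : ℝ => (2 * x - a - b) / (b - a)) (2 / (b - a)) x := by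
    have := (((hasDerivAt_id x).const_mul 2).sub_const a).sub_const b |>.div_const (b - a)
    simpa using this
  have h := (Real.hasDerivAt_arcsin hu1 hu2).comp x hlin
  have hq : 0 < (x - a) * (b - x) := mul_pos (by linarith) (by linarith)
  have hsq : Real.sqrt (1 - ((2 * x - a - b) / (b - a)) ^ 2) =
      2 * Real.sqrt ((x - a) * (b - x)) / (b - a) := by
    have : 1 - ((2 * x - a - b) / (b - a)) ^ 2 = (2 / (b - a)) ^ 2 * ((x - a) * (b - x)) := by
      field_simp; ring
    rw [this, Real.sqrt_mul (by positivity) ((x - a) * (b - x)), Real.sqrt_sq (by positivity)]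
    ring
  have hpos : 0 < Real.sqrt ((x - a) * (b - x)) := Real.sqrt_pos.2 hq
  refine h.congr_deriv ?_
  rw [hsq]
  field_simp

/-- `1/√((x − a)(b − x))` is integrable on `(a, b)` (non-negative derivative of a continuous
function). [folklore] -/
theorem integrableOn_inv_sqrt_chord {a b : ℝ} (hab : a < b) :
    IntegrableOn (fun x : ℝ => 1 / Real.sqrt ((x - a) * (b - x))) (Ioo a b) := by
  have hcont : ContinuousOn (fun x : ℝ => Real.arcsin ((2 * x - a - b) / (b - a))) (Icc a b) :=
    (Real.continuous_arcsin.comp (by fun_prop)).continuousOn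
  have h := intervalIntegral.integrableOn_deriv_of_nonneg hcont
    (fun x hx => hasDerivAt_arcsin_chord hab hx) (fun x _ => by positivity)
  exact h.mono_set Ioo_subset_Ioc_self

/-- **`x^m/√f` is integrable on `(e₃, e₂)` for every cubic with three real roots**: on the oval
`f ≥ 4(e₁ − e₂)·(x − e₃)(e₂ − x)`, so `|x^m/√f| ≤ M^m/(2√(e₁ − e₂)) · 1/√((x − e₃)(e₂ − x))` with
`M = max |e₃| |e₂|`. [folklore] -/
theorem integrableOn_genIntegrand_of_roots {e₃ e₂ e₁ : ℝ} (h32 : e₃ < e₂) (h21 : e₂ < e₁)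
    (hf : ∀ x, cubic q₂ q₃ x = 4 * (x - e₃) * (x - e₂) * (x - e₁)) (m : ℕ) :
    IntegrableOn (fun x : ℝ => x ^ m / Real.sqrt (cubic q₂ q₃ x)) (Ioo e₃ e₂) := by
  set M : ℝ := max |e₃| |e₂| with hM
  set Cst : ℝ := M ^ m / (2 * Real.sqrt (e₁ - e₂)) with hC
  have hd : 0 < e₁ - e₂ := by linarith
  have hsd : 0 < Real.sqrt (e₁ - e₂) := Real.sqrt_pos.2 hd
  refine Integrable.mono' ((integrableOn_inv_sqrt_chord h32).const_mul Cst) ?_ ?_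
  · refine ContinuousOn.aestronglyMeasurable ?_ measurableSet_Ioo
    refine ContinuousOn.div (by fun_prop) (Real.continuous_sqrt.comp continuous_cubic).continuousOn
      fun x hx => (Real.sqrt_pos.2 ((cubic_sign_of_roots h32 h21 hf).1 x hx)).ne'
  · refine ae_restrict_of_forall_mem measurableSet_Ioo fun x hx => ?_
    obtain ⟨h1, h2⟩ := hx
    have hq : 0 < (x - e₃) * (e₂ - x) := mul_pos (by linarith) (by linarith)
    have hfx : 0 < cubic q₂ q₃ x := (cubic_sign_of_roots h32 h21 hf).1 x ⟨h1, h2⟩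
    have hsf : 0 < Real.sqrt (cubic q₂ q₃ x) := Real.sqrt_pos.2 hfx
    have hsq : 0 < Real.sqrt ((x - e₃) * (e₂ - x)) := Real.sqrt_pos.2 hq
    rw [Real.norm_eq_abs, abs_div, abs_of_pos hsf, abs_pow]
    have hxM : |x| ≤ M := by
      rw [abs_le]
      constructor
      · have : -M ≤ -|e₃| := neg_le_neg (le_max_left _ _)
        linarith [neg_abs_le e₃]
      · exact le_trans (le_trans h2.le (le_abs_self e₂)) (le_max_right _ _)
    have hM0 : 0 ≤ M := le_trans (abs_nonneg _) (le_max_left _ _)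
    have hxm : |x| ^ m ≤ M ^ m := pow_le_pow_left₀ (abs_nonneg x) hxM m
    have hlow : 4 * (e₁ - e₂) * ((x - e₃) * (e₂ - x)) ≤ cubic q₂ q₃ x := by
      rw [hf, show 4 * (x - e₃) * (x - e₂) * (x - e₁) = 4 * (e₁ - x) * ((x - e₃) * (e₂ - x)) by ring]
      have : e₁ - e₂ ≤ e₁ - x := by linarith
      nlinarith
    have hsfq : 2 * Real.sqrt (e₁ - e₂) * Real.sqrt ((x - e₃) * (e₂ - x)) ≤
        Real.sqrt (cubic q₂ q₃ x) := by
      have : 2 * Real.sqrt (e₁ - e₂) * Real.sqrt ((x - e₃) * (e₂ - x)) =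
          Real.sqrt (4 * (e₁ - e₂) * ((x - e₃) * (e₂ - x))) := by
        rw [Real.sqrt_mul (by positivity) ((x - e₃) * (e₂ - x)),
          Real.sqrt_mul (by norm_num) (e₁ - e₂),
          show (4 : ℝ) = 2 ^ 2 by norm_num, Real.sqrt_sq (by norm_num)]
      rw [this]
      exact Real.sqrt_le_sqrt hlow
    calc |x| ^ m / Real.sqrt (cubic q₂ q₃ x) ≤ M ^ m / Real.sqrt (cubic q₂ q₃ x) :=
          div_le_div_of_nonneg_right hxm hsf.le
      _ ≤ M ^ m / (2 * Real.sqrt (e₁ - e₂) * Real.sqrt ((x - e₃) * (e₂ - x))) :=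
          div_le_div_of_nonneg_left (pow_nonneg hM0 m) (by positivity) hsfq
      _ = Cst * (1 / Real.sqrt ((x - e₃) * (e₂ - x))) := by
          simp only [hC]; field_simp

/-- Integrability of the generator integrands on `σ ⊆ ℝ¹` for every admissible parameter.
[folklore] -/
theorem integrableOn_genIntegrandQ_oval (h : 0 < disc q₂ q₃) (m : ℕ) :
    IntegrableOn (fun p : Fin 1 → ℝ => p 0 ^ m / Real.sqrt (cubic q₂ q₃ (p 0))) (oval q₂ q₃) := by
  obtain ⟨e₃, e₂, e₁, h3, h2a, h2b, h1, hf⟩ := exists_roots h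
  have h32 : e₃ < e₂ := by linarith
  have h21 : e₂ < e₁ := by linarith
  have hset : oval q₂ q₃ = e1 ⁻¹' Ioo e₃ e₂ := by
    rw [oval_eq_of_roots h32 h21 hf]; ext p; simp
  rw [hset]
  exact (measurePreserving_e1.integrableOn_comp_preimage e1.measurableEmbedding).mpr
    (integrableOn_genIntegrand_of_roots h32 h21 hf m)

/-- **Honest generators for every admissible parameter**: `[σ, x^m/√f]` as an `IntegralRep 1`.
[cite: KontsevichZagier2001, §1.1] -/
def genRepQ (h : 0 < disc q₂ q₃) (m : ℕ) : IntegralRep 1 where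
  domain := oval q₂ q₃
  integrand := fun p => p 0 ^ m / Real.sqrt (cubic q₂ q₃ (p 0))
  isSemialgebraic_domain := isSemialgebraic_oval h
  isSemialgebraicFunOn_integrand := isSemialgebraicFunOn_genIntegrandQ h m
  integrableOn := integrableOn_genIntegrandQ_oval h m

/-- `[genRepQ h m] ∈ gens₁ q₂ q₃`. [folklore] -/
theorem of_genRepQ_mem_gens₁ (h : 0 < disc q₂ q₃) (m : ℕ) : KZ.of (genRepQ h m) ∈ gens₁ q₂ q₃ :=
  ⟨genRepQ h m, m, rfl, fun _ _ => rfl, rfl⟩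

/-- **The generator set of the crux is inhabited for EVERY admissible `(q₂, q₃)`** — the crux is
nowhere true for want of representations; with `value_pos_of_gens₂`/`J0_ne_zero_of_rigid` its
kernel claim is about genuine periods. [folklore] -/
theorem gens_nonempty (h : 0 < disc q₂ q₃) : (gens q₂ q₃).Nonempty :=
  ⟨_, Or.inr (of_genRepQ_mem_gens₁ h 0)⟩

/-- The value of `genRepQ h 0` is `J₀`, which rigidity makes non-zero: under the hypotheses of the
crux the sector contains a representation of a non-zero (indeed transcendental, by Schneider)
period. [folklore] -/
theorem value_genRepQ_zero (h : 0 < disc q₂ q₃) : (genRepQ h 0).value = J0 q₂ q₃ := by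
  simp [IntegralRep.value, genRepQ, J0]

end GeneralCurve

/-! ## §7 Targets (cycle 2): the registered skeleton `a5aa6383` (line `hermite-coordinates-hom`)

Its four active stubs `stub_basisReps`, `stub_hermiteReduction`, `stub_verticalDescent`,
`stub_polynomialToConstant`: NONE KILLABLE (all are theorems since: `basisReps_of_disc_pos` here —
without its `Rigid` hypothesis —, §9 `verticalDescent`, §10 `polynomialToConstant`, and the
Hermite move = §5 + this section's band; the picked line `merge-first-single-hermite` was then
closed outright by the drefute gen-2 certificate, §12). This section is the general-curve LEGALITY
KIT of those chains, WITHOUT Tarski–Seidenberg (real algebraic heights are `ℚ`-definable):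
`isAlgebraic_of_cubic_eq_zero`, `isAlgebraic_aeval_sub_aeval` (roots and the `b`-odd constants
`R(e₂) − R(e₃)` are real algebraic ⇒ legal `IntegralRep 0`), `closedBandQ`/`endsQ` (the Hermite
band `[e₃,e₂] = σ ∪ {e₃,e₂}` in the literal `Fin.init/Fin.last` shape of `KZ.newtonLeibnizRel`
over `ℝ⁰`; `endsQ` null and `ℚ`-semialgebraic; the band `ℚ`-semialgebraic),
`isSemialgebraicFunOn_const_root` (the bounds `e₃, e₂` are legal rule-3 data), `roots_located`
(ordered roots are separated by `∓√(q₂/12)`). Decoration found: `hσ` in every stub, `hR` in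
`stub_basisReps`. -/

section Targets

open Literature.ModelTheory.ExponentialFields (IsSemialgebraic isSemialgebraic_setOf_eval_pos
  isSemialgebraic_setOf_eval_eq_zero isSemialgebraic_univ)
open MvPolynomial (aeval X C)

variable {q₂ q₃ : ℚ}

/-- `stub_basisReps` of skeleton `a5aa6383` WITHOUT its hypothesis `hR : Rigid q₂ q₃`: the two
transcendental normal forms `[σ, 1/√f]`, `[σ, x/√f]` exist as honest representations for every
admissible parameter (`genRepQ h 0`, `genRepQ h 1`). So `hR` is decoration in that stub. [folklore] -/
theorem basisReps_of_disc_pos (h : 0 < disc q₂ q₃) :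
    ∃ b₀ b₁ : IntegralRep 1, b₀.domain = oval q₂ q₃ ∧
      EqOn b₀.integrand (fun p => 1 / Real.sqrt (cubic q₂ q₃ (p 0))) (oval q₂ q₃) ∧
      b₁.domain = oval q₂ q₃ ∧
      EqOn b₁.integrand (fun p => p 0 / Real.sqrt (cubic q₂ q₃ (p 0))) (oval q₂ q₃) :=
  ⟨genRepQ h 0, genRepQ h 1, rfl, fun p _ => by simp [genRepQ], rfl, fun p _ => by simp [genRepQ]⟩

/-- Roots of the cubic are real algebraic numbers (the cubic is a non-zero `ℚ`-polynomial).
[folklore] -/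
theorem isAlgebraic_of_cubic_eq_zero {e : ℝ} (he : cubic q₂ q₃ e = 0) : IsAlgebraic ℚ e := by
  refine ⟨4 * Polynomial.X ^ 3 - Polynomial.C q₂ * Polynomial.X - Polynomial.C q₃, ?_, ?_⟩
  · intro h0
    have h3 := congrArg (fun p : Polynomial ℚ => p.coeff 3) h0
    simp only [Polynomial.coeff_sub, Polynomial.coeff_C_mul,
      Polynomial.coeff_X, Polynomial.coeff_C, Polynomial.coeff_zero] at h3
    norm_num at h3
  · unfold cubic at he
    simp only [map_sub, map_mul, map_pow, Polynomial.aeval_X, Polynomial.aeval_C, eq_ratCast]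
    have h4 : (Polynomial.aeval e) (4 : Polynomial ℚ) = (4 : ℝ) := map_ofNat _ 4
    rw [h4]
    linarith

/-- Polynomial expressions in an algebraic number are algebraic. [folklore] -/
theorem isAlgebraic_aeval_of_isAlgebraic {e : ℝ} (he : IsAlgebraic ℚ e) (R : Polynomial ℚ) :
    IsAlgebraic ℚ (Polynomial.aeval e R) := by
  rw [isAlgebraic_iff_isIntegral] at he ⊢
  induction R using Polynomial.induction_on' with
  | add p q hp hq => simpa [map_add] using hp.add hq
  | monomial n a =>
    rw [← Polynomial.C_mul_X_pow_eq_monomial, map_mul, map_pow, Polynomial.aeval_C,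
      Polynomial.aeval_X]
    exact isIntegral_algebraMap.mul (he.pow n)

/-- The constant produced by the `b`-odd branch / `stub_polynomialToConstant`,
`R(e₂) − R(e₃)` with `R ∈ ℚ[X]`, is real algebraic (so `[pt, R(e₂) − R(e₃)]` is a legal
`IntegralRep 0` by `isSemialgebraicFunOn_const_of_isAlgebraic`). [folklore] -/
theorem isAlgebraic_aeval_sub_aeval {e₃ e₂ : ℝ} (h₃ : cubic q₂ q₃ e₃ = 0) (h₂ : cubic q₂ q₃ e₂ = 0)
    (R : Polynomial ℚ) : IsAlgebraic ℚ (Polynomial.aeval e₂ R - Polynomial.aeval e₃ R) := by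
  have h := (isAlgebraic_aeval_of_isAlgebraic (isAlgebraic_of_cubic_eq_zero h₂) R)
  have h' := (isAlgebraic_aeval_of_isAlgebraic (isAlgebraic_of_cubic_eq_zero h₃) R)
  rw [isAlgebraic_iff_isIntegral] at h h' ⊢
  exact h.sub h'

/-- The three roots are the only zeros of the factored cubic. [folklore] -/
theorem eq_roots_of_cubic_eq_zero {e₃ e₂ e₁ y : ℝ}
    (hf : ∀ x, cubic q₂ q₃ x = 4 * (x - e₃) * (x - e₂) * (x - e₁)) (hy : cubic q₂ q₃ y = 0) :
    y = e₃ ∨ y = e₂ ∨ y = e₁ := by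
  rw [hf] at hy
  rcases mul_eq_zero.1 hy with h | h
  · rcases mul_eq_zero.1 h with h | h
    · rcases mul_eq_zero.1 h with h | h
      · norm_num at h
      · exact Or.inl (by linarith)
    · exact Or.inr (Or.inl (by linarith))
  · exact Or.inr (Or.inr (by linarith))

/-- The roots of the factored cubic are roots. [folklore] -/
theorem cubic_roots_eq_zero {e₃ e₂ e₁ : ℝ}
    (hf : ∀ x, cubic q₂ q₃ x = 4 * (x - e₃) * (x - e₂) * (x - e₁)) :
    cubic q₂ q₃ e₃ = 0 ∧ cubic q₂ q₃ e₂ = 0 ∧ cubic q₂ q₃ e₁ = 0 := by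
  refine ⟨?_, ?_, ?_⟩ <;> rw [hf] <;> ring

/-- The two branch points `{e₃, e₂} ⊆ ℝ¹` bounding the oval. [folklore] -/
def endsQ (e₃ e₂ : ℝ) : Set (Fin 1 → ℝ) := {z | z 0 = e₃ ∨ z 0 = e₂}

/-- The CLOSED band `[e₃, e₂] ⊆ ℝ¹` in the literal shape of `KZ.newtonLeibnizRel` over the base
`univ ⊆ ℝ⁰` with the constant (real algebraic, in general irrational) bounds `a = e₃`, `b = e₂` —
the band of the Hermite move (`stub_hermiteReduction`) and of `stub_polynomialToConstant`.
[folklore] -/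
def closedBandQ (e₃ e₂ : ℝ) : Set (Fin 1 → ℝ) :=
  {z | (Fin.init z : Fin 0 → ℝ) ∈ (univ : Set (Fin 0 → ℝ)) ∧
    (fun _ => e₃) (Fin.init z) ≤ z (Fin.last 0) ∧ z (Fin.last 0) ≤ (fun _ => e₂) (Fin.init z)}

/-- `closedBandQ e₃ e₂ = [e₃, e₂]`. [folklore] -/
theorem closedBandQ_eq (e₃ e₂ : ℝ) : closedBandQ e₃ e₂ = {z : Fin 1 → ℝ | e₃ ≤ z 0 ∧ z 0 ≤ e₂} := by
  ext z; simp [closedBandQ]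

/-- `[e₃, e₂] = σ ∪ {e₃, e₂}` for the factored cubic. [folklore] -/
theorem closedBandQ_eq_union {e₃ e₂ e₁ : ℝ} (h32 : e₃ < e₂) (h21 : e₂ < e₁)
    (hf : ∀ x, cubic q₂ q₃ x = 4 * (x - e₃) * (x - e₂) * (x - e₁)) :
    closedBandQ e₃ e₂ = oval q₂ q₃ ∪ endsQ e₃ e₂ := by
  rw [closedBandQ_eq, oval_eq_of_roots h32 h21 hf]
  ext z
  simp only [mem_setOf_eq, mem_union, endsQ, mem_Ioo]
  constructor
  · rintro ⟨h1, h2⟩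
    rcases h1.lt_or_eq with h1 | h1
    · rcases h2.lt_or_eq with h2 | h2
      · exact Or.inl ⟨h1, h2⟩
      · exact Or.inr (Or.inr h2)
    · exact Or.inr (Or.inl h1.symm)
  · rintro (⟨h1, h2⟩ | h | h)
    · exact ⟨h1.le, h2.le⟩
    · rw [h]; exact ⟨le_rfl, h32.le⟩
    · rw [h]; exact ⟨h32.le, le_rfl⟩

/-- `σ` and the branch points are disjoint. [folklore] -/
theorem oval_inter_endsQ {e₃ e₂ e₁ : ℝ} (h32 : e₃ < e₂) (h21 : e₂ < e₁)
    (hf : ∀ x, cubic q₂ q₃ x = 4 * (x - e₃) * (x - e₂) * (x - e₁)) :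
    oval q₂ q₃ ∩ endsQ e₃ e₂ = ∅ := by
  rw [oval_eq_of_roots h32 h21 hf]
  ext z
  simp only [mem_inter_iff, mem_setOf_eq, mem_Ioo, endsQ, mem_empty_iff_false, iff_false]
  rintro ⟨⟨h1, h2⟩, h | h⟩ <;> rw [h] at h1 h2 <;> linarith

/-- **The branch points are `ℚ`-semialgebraic for EVERY admissible parameter** — no
Tarski–Seidenberg and no explicit isolating formula needed: `e₃, e₂` are real algebraic
(`isAlgebraic_of_cubic_eq_zero`) and coordinate hyperplanes at real algebraic heights are
`ℚ`-definable (tree: `isSemialgebraic_setOf_apply_eq_of_isAlgebraic`). [folklore] -/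
theorem isSemialgebraic_endsQ {e₃ e₂ : ℝ} (h₃ : cubic q₂ q₃ e₃ = 0) (h₂ : cubic q₂ q₃ e₂ = 0) :
    IsSemialgebraic ℚ (endsQ e₃ e₂) :=
  (isSemialgebraic_setOf_apply_eq_of_isAlgebraic (isAlgebraic_of_cubic_eq_zero h₃) (0 : Fin 1)).union
    (isSemialgebraic_setOf_apply_eq_of_isAlgebraic (isAlgebraic_of_cubic_eq_zero h₂) (0 : Fin 1))

/-- The branch points form a two-point, hence Lebesgue-null, subset of `ℝ¹`. [folklore] -/
theorem volume_endsQ (e₃ e₂ : ℝ) : volume (endsQ e₃ e₂) = 0 := by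
  have : endsQ e₃ e₂ = {fun _ => e₃, fun _ => e₂} := by
    ext z; simp [endsQ, funext_iff, Fin.forall_fin_one]
  rw [this]
  exact (Set.toFinite _).measure_zero _

/-- **The closed Hermite band `[e₃, e₂]` is `ℚ`-semialgebraic for every admissible parameter.**
[folklore] -/
theorem isSemialgebraic_closedBandQ {e₃ e₂ e₁ : ℝ} (h32 : e₃ < e₂) (h21 : e₂ < e₁)
    (hf : ∀ x, cubic q₂ q₃ x = 4 * (x - e₃) * (x - e₂) * (x - e₁)) :
    IsSemialgebraic ℚ (closedBandQ e₃ e₂) := by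
  obtain ⟨h₃, h₂, -⟩ := cubic_roots_eq_zero hf
  obtain ⟨hpos, -⟩ := cubic_sign_of_roots h32 h21 hf
  have hd : 0 < disc q₂ q₃ :=
    disc_pos_of_sign_change (x := (e₃ + e₂) / 2) (t := (e₂ + e₁) / 2) (by linarith)
      (hpos _ ⟨by linarith, by linarith⟩)
      ((cubic_sign_of_roots h32 h21 hf).2 _ ⟨by linarith, by linarith⟩)
  rw [closedBandQ_eq_union h32 h21 hf]
  exact (isSemialgebraic_oval hd).union (isSemialgebraic_endsQ h₃ h₂)

/-- The bounds of the Hermite band are legal: the constant functions `e₃`, `e₂` on the base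
`univ ⊆ ℝ⁰` are `ℚ`-semialgebraic (tree: `isSemialgebraicFunOn_const_of_isAlgebraic`). [folklore] -/
theorem isSemialgebraicFunOn_const_root {e : ℝ} (he : cubic q₂ q₃ e = 0) :
    IsSemialgebraicFunOn ℚ (univ : Set (Fin 0 → ℝ)) (fun _ => e) :=
  isSemialgebraicFunOn_const_of_isAlgebraic isSemialgebraic_univ (isAlgebraic_of_cubic_eq_zero he)

/-- Three ordered roots are automatically LOCATED by the critical points `∓m`, `m = √(q₂/12)`:
`e₃ < −m < e₂ < m < e₁` (so the smoothstep-line stubs' `e₃ < e₂ < e₁` hypotheses and the output of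
`exists_roots` are interchangeable). [folklore] -/
theorem roots_located {e₃ e₂ e₁ : ℝ} (h32 : e₃ < e₂) (h21 : e₂ < e₁)
    (hf : ∀ x, cubic q₂ q₃ x = 4 * (x - e₃) * (x - e₂) * (x - e₁)) :
    e₃ < -Real.sqrt (q₂ / 12) ∧ -Real.sqrt (q₂ / 12) < e₂ ∧ e₂ < Real.sqrt (q₂ / 12) ∧
      Real.sqrt (q₂ / 12) < e₁ := by
  obtain ⟨hpos, hneg⟩ := cubic_sign_of_roots h32 h21 hf
  have hd : 0 < disc q₂ q₃ :=
    disc_pos_of_sign_change (x := (e₃ + e₂) / 2) (t := (e₂ + e₁) / 2) (by linarith)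
      (hpos _ ⟨by linarith, by linarith⟩) (hneg _ ⟨by linarith, by linarith⟩)
  obtain ⟨hcm, hcp⟩ := cubic_crit hd
  set m := Real.sqrt (q₂ / 12) with hm
  have hm0 : 0 < m := Real.sqrt_pos.2 (by have := q₂_pos_of_disc_pos hd; positivity)
  -- `f(-m) > 0`: `-m ∈ (e₃, e₂)` or `-m > e₁`
  have hneg_m : -m ∈ Ioo e₃ e₂ := by
    rcases mem_Ioo_or_gt_of_cubic_pos h32 h21 hf hcm with h | h
    · exact h
    · exfalso
      have : 0 < cubic q₂ q₃ m := cubic_pos_of_gt h32 h21 hf (by linarith)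
      linarith
  -- `f(m) < 0`: `m ∉ [e₃, e₂] ∪ [e₁, ∞)`, and `m > -m > e₃`, so `m ∈ (e₂, e₁)`
  have hm_lt : m < e₁ := by
    by_contra hcon
    push Not at hcon
    rcases hcon.lt_or_eq with h | h
    · have := cubic_pos_of_gt h32 h21 hf h; linarith
    · have : cubic q₂ q₃ m = 0 := by rw [hf, ← h]; ring
      linarith
  have hm_gt : e₂ < m := by
    by_contra hcon
    push Not at hcon
    rcases hcon.lt_or_eq with h | h
    · have : 0 < cubic q₂ q₃ m := hpos _ ⟨by linarith [hneg_m.1], h⟩; linarith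
    · have : cubic q₂ q₃ m = 0 := by rw [hf, h]; ring
      linarith
  exact ⟨hneg_m.1, hneg_m.2, hm_gt, hm_lt⟩

end Targets


/-! ## §8 (cycle 2, SUPERSEDED by §12) Rigidity in Lean for CM curves

Cycle 2 noted that Masser's Theorem III is PROVED in the tree (`masser_ellipticPeriods_cm_holds`,
from the tree's Chudnovsky theorem), so `Rigid` for CM rational curves was provable modulo the
quasi-period glue `J₁ = −η(Ω₀)/2` (Lawden (6.13.3); not in tree) and lattice bookkeeping. §12
(cycle 3) bypasses that glue on the `j = 1728` family by the lemniscatic road and proves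
`Rigid q₂ 0` outright; the non-CM case (Masser Thm II, `masser_ellipticPeriods`) remains a named
fact. No theorem in this section. -/

/-! ## §9 Vertical descent (cycle 2): `stub_verticalDescent` is TRUE — proved for every
admissible parameter; rule 3 along `y` with a VARIABLE bound over an OPEN base is legal

The one Newton–Leibniz shape nobody had instantiated (base of positive dimension = the open oval
`σ ⊆ ℝ¹`, variable upper bound `b(x) = √f(x)`, band `vBand = {x ∈ σ, 0 ≤ y ≤ √f(x)} ⊆ ℝ²` in the
literal `Fin.init/Fin.last` form, polynomial primitive `x^a y^{b+1}/(b+1)`):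
`of_vBandRep_sub_of_vBaseRep_mem_newtonLeibnizRel`. Then ONE (1a) move across the two null graphs
`y = 0`, `y = √f(x)` (`vEnds`; null by Tonelli, `volume_graph_eq_zero`) gives `verticalDescent`,
which is the registered skeleton's `stub_verticalDescent` with its decorative hypothesis
`hσ : IsSemialgebraic ℚ σ` dropped (over this file's vocabulary, definitionally equal to the
`EllipticMomentKernelNegative` copies). Standing-adversary reading: the stub cannot be broken
because it is true; by §3 no derivation of it avoids rule 3. -/

section VerticalDescent

open Literature.ModelTheory.ExponentialFields (IsSemialgebraic isSemialgebraic_setOf_eval_pos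
  isSemialgebraic_setOf_eval_eq_zero isSemialgebraic_univ)
open MvPolynomial (aeval X C)

variable {q₂ q₃ : ℚ}

/-- The upper bound of the vertical band: `b(x) = √f(x)` on `ℝ¹`. [folklore] -/
def sqrtCubic (q₂ q₃ : ℚ) (x : Fin 1 → ℝ) : ℝ := Real.sqrt (cubic q₂ q₃ (x 0))

/-- The CLOSED vertical band over the oval, in the literal shape of `KZ.newtonLeibnizRel` with base
`σ ⊆ ℝ¹` (open!) and the variable bounds `a = 0 ≤ b = √f`:
`{z ∈ ℝ² | init z ∈ σ, 0 ≤ z_last ≤ √f((init z)₀)}`. [folklore] -/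
def vBand (q₂ q₃ : ℚ) : Set (Fin 2 → ℝ) :=
  {z | (Fin.init z : Fin 1 → ℝ) ∈ oval q₂ q₃ ∧ (fun _ => (0 : ℝ)) (Fin.init z) ≤ z (Fin.last 1) ∧
    z (Fin.last 1) ≤ sqrtCubic q₂ q₃ (Fin.init z)}

/-- `Fin.init` on `ℝ²`: the first coordinate. [folklore] -/
theorem init_apply_zero (z : Fin 2 → ℝ) : (Fin.init z : Fin 1 → ℝ) 0 = z 0 := rfl

/-- `Fin.snoc` on `ℝ¹ → ℝ²`: first coordinate. [folklore] -/
theorem snoc₂_apply_zero (x : Fin 1 → ℝ) (t : ℝ) : (Fin.snoc x t : Fin 2 → ℝ) 0 = x 0 := rfl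

/-- `Fin.snoc` on `ℝ¹ → ℝ²`: last coordinate. [folklore] -/
theorem snoc₂_apply_one (x : Fin 1 → ℝ) (t : ℝ) : (Fin.snoc x t : Fin 2 → ℝ) 1 = t := rfl

/-- The vertical band, coordinate-wise: `{(x, y) | x ∈ σ, 0 ≤ y ≤ √f(x)}`. [folklore] -/
theorem mem_vBand_iff (z : Fin 2 → ℝ) :
    z ∈ vBand q₂ q₃ ↔ (Fin.init z : Fin 1 → ℝ) ∈ oval q₂ q₃ ∧ 0 ≤ z 1 ∧
      z 1 ≤ Real.sqrt (cubic q₂ q₃ (z 0)) := Iff.rfl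

/-- The general cubic as a `ℚ`-polynomial in the first of two variables. [folklore] -/
def cubicPoly₂ (q₂ q₃ : ℚ) : MvPolynomial (Fin 2) ℚ := 4 * X 0 ^ 3 - C q₂ * X 0 - C q₃

/-- Evaluation of `cubicPoly₂`. [folklore] -/
theorem aeval_cubicPoly₂ (p : Fin 2 → ℝ) : aeval p (cubicPoly₂ q₂ q₃) = cubic q₂ q₃ (p 0) := by
  simp [cubicPoly₂, cubic, map_ofNat]

/-- **The vertical band is `ℚ`-semialgebraic** (quantifier-free: cylinder over `σ`, `0 ≤ y`,
`y² ≤ f(x)`). [folklore] -/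
theorem isSemialgebraic_vBand (h : 0 < disc q₂ q₃) : IsSemialgebraic ℚ (vBand q₂ q₃) := by
  have h1 : IsSemialgebraic ℚ {z : Fin 2 → ℝ | (Fin.init z : Fin 1 → ℝ) ∈ oval q₂ q₃} :=
    (isSemialgebraic_oval h).setOf_init_mem
  have h2 : IsSemialgebraic ℚ {z : Fin 2 → ℝ | 0 ≤ z 1} := by
    have ha := isSemialgebraic_setOf_eval_pos (k := ℚ) (R := ℝ) (X 1 : MvPolynomial (Fin 2) ℚ)
    have hb := isSemialgebraic_setOf_eval_eq_zero (k := ℚ) (R := ℝ) (X 1 : MvPolynomial (Fin 2) ℚ)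
    convert ha.union hb using 1
    ext z
    simp only [mem_setOf_eq, mem_union, MvPolynomial.aeval_X]
    constructor
    · intro hz
      rcases hz.lt_or_eq with hz | hz
      · exact Or.inl hz
      · exact Or.inr hz.symm
    · rintro (hz | hz)
      · exact hz.le
      · exact hz.ge
  have h3 : IsSemialgebraic ℚ {z : Fin 2 → ℝ | z 1 ^ 2 ≤ cubic q₂ q₃ (z 0)} := by
    have ha := isSemialgebraic_setOf_eval_pos (k := ℚ) (R := ℝ)
      (cubicPoly₂ q₂ q₃ - X 1 ^ 2 : MvPolynomial (Fin 2) ℚ)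
    have hb := isSemialgebraic_setOf_eval_eq_zero (k := ℚ) (R := ℝ)
      (cubicPoly₂ q₂ q₃ - X 1 ^ 2 : MvPolynomial (Fin 2) ℚ)
    convert ha.union hb using 1
    ext z
    simp only [mem_setOf_eq, mem_union, map_sub, map_pow, MvPolynomial.aeval_X, aeval_cubicPoly₂]
    constructor
    · intro hz
      rcases hz.lt_or_eq with hz | hz
      · exact Or.inl (by linarith)
      · exact Or.inr (by linarith)
    · rintro (hz | hz)
      · linarith
      · linarith
  convert h1.inter (h2.inter h3) using 1
  ext z
  simp only [mem_vBand_iff, mem_inter_iff, mem_setOf_eq]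
  constructor
  · rintro ⟨hσ, h0, hle⟩
    refine ⟨hσ, h0, ?_⟩
    have hf : 0 ≤ cubic q₂ q₃ (z 0) := hσ.1.le
    calc z 1 ^ 2 ≤ Real.sqrt (cubic q₂ q₃ (z 0)) ^ 2 := by gcongr
      _ = cubic q₂ q₃ (z 0) := Real.sq_sqrt hf
  · rintro ⟨hσ, h0, hle⟩
    exact ⟨hσ, h0, (Real.le_sqrt h0 hσ.1.le).2 hle⟩

/-- The vertical band lies in a compact box `[e₃, e₂] × [0, √M]`. [folklore] -/
theorem vBand_subset_Icc (h : 0 < disc q₂ q₃) :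
    ∃ lo hi : Fin 2 → ℝ, vBand q₂ q₃ ⊆ Icc lo hi := by
  obtain ⟨e₃, e₂, e₁, h3, h2a, h2b, h1, hf⟩ := exists_roots h
  have h32 : e₃ < e₂ := by linarith
  have h21 : e₂ < e₁ := by linarith
  obtain ⟨M, hM⟩ : ∃ M, ∀ x ∈ Icc e₃ e₂, cubic q₂ q₃ x ≤ M := by
    obtain ⟨M, hM⟩ := isCompact_Icc.exists_bound_of_continuousOn
      (continuous_cubic (q₂ := q₂) (q₃ := q₃)).continuousOn
    exact ⟨M, fun x hx => (le_abs_self _).trans (hM x hx)⟩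
  refine ⟨![e₃, 0], ![e₂, Real.sqrt M], fun z hz => ?_⟩
  rw [mem_vBand_iff, oval_eq_of_roots h32 h21 hf] at hz
  obtain ⟨⟨hx1, hx2⟩, h0, hle⟩ := hz
  simp only [init_apply_zero] at hx1 hx2
  rw [mem_Icc, Pi.le_def, Pi.le_def]
  refine ⟨fun i => ?_, fun i => ?_⟩ <;> fin_cases i
  · exact hx1.le
  · exact h0
  · exact hx2.le
  · exact hle.trans (Real.sqrt_le_sqrt (hM _ ⟨hx1.le, hx2.le⟩))

/-- The moment integrand `x^a y^b` is integrable on the (bounded) vertical band. [folklore] -/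
theorem integrableOn_moment_vBand (h : 0 < disc q₂ q₃) (a b : ℕ) :
    IntegrableOn (fun p : Fin 2 → ℝ => p 0 ^ a * p 1 ^ b) (vBand q₂ q₃) := by
  obtain ⟨lo, hi, hsub⟩ := vBand_subset_Icc h
  have hc : Continuous fun p : Fin 2 → ℝ => p 0 ^ a * p 1 ^ b := by fun_prop
  exact (hc.continuousOn.integrableOn_compact isCompact_Icc).mono_set hsub

/-- **The honest band representation `[vBand, x^a y^b]`** of the moment, for every admissible
parameter. [cite: KontsevichZagier2001, §1.1] -/
def vBandRep (h : 0 < disc q₂ q₃) (a b : ℕ) : IntegralRep 2 where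
  domain := vBand q₂ q₃
  integrand := fun p => p 0 ^ a * p 1 ^ b
  isSemialgebraic_domain := isSemialgebraic_vBand h
  isSemialgebraicFunOn_integrand :=
    (isSemialgebraicFunOn_aeval (isSemialgebraic_vBand h)
      (X 0 ^ a * X 1 ^ b : MvPolynomial (Fin 2) ℚ)).congr fun p _ => by simp
  integrableOn := integrableOn_moment_vBand h a b

/-- Powers of semialgebraic functions are semialgebraic. [cite: BochnakCosteRoy1998, Prop. 2.2.6] -/
theorem isSemialgebraicFunOn_pow {m : ℕ} {s : Set (Fin m → ℝ)} {g : (Fin m → ℝ) → ℝ}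
    (hs : IsSemialgebraic ℚ s) (hg : IsSemialgebraicFunOn ℚ s g) (n : ℕ) :
    IsSemialgebraicFunOn ℚ s (fun x => g x ^ n) := by
  induction n with
  | zero =>
    exact (isSemialgebraicFunOn_aeval hs (1 : MvPolynomial (Fin m) ℚ)).congr fun _ _ => by simp
  | succ n ih =>
    exact (IsSemialgebraicFunOn.mul_holds ih hg).congr fun _ _ => by simp [pow_succ]

/-- The descended integrand `x^a √f(x)^{b+1}/(b+1)` is `ℚ`-semialgebraic on `σ`. [folklore] -/
theorem isSemialgebraicFunOn_descended (h : 0 < disc q₂ q₃) (a b : ℕ) :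
    IsSemialgebraicFunOn ℚ (oval q₂ q₃)
      (fun p => p 0 ^ a * Real.sqrt (cubic q₂ q₃ (p 0)) ^ (b + 1) / ((b : ℝ) + 1)) := by
  have hs := isSemialgebraic_oval h
  have h1 : IsSemialgebraicFunOn ℚ (oval q₂ q₃)
      (fun p => aeval p (X 0 ^ a : MvPolynomial (Fin 1) ℚ)) := isSemialgebraicFunOn_aeval hs _
  have h2 : IsSemialgebraicFunOn ℚ (oval q₂ q₃) (fun p => Real.sqrt (cubic q₂ q₃ (p 0))) := by
    have := IsSemialgebraicFunOn.sqrt_holds (isSemialgebraicFunOn_aeval hs (cubicPolyQ q₂ q₃))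
    exact this.congr fun p _ => by simp [aeval_cubicPolyQ]
  have h3 := isSemialgebraicFunOn_pow hs h2 (b + 1)
  have h4 : IsSemialgebraicFunOn ℚ (oval q₂ q₃)
      (fun p => aeval p (C (1 / ((b : ℚ) + 1)) : MvPolynomial (Fin 1) ℚ)) :=
    isSemialgebraicFunOn_aeval hs _
  have h5 := IsSemialgebraicFunOn.mul_holds (IsSemialgebraicFunOn.mul_holds h1 h3) h4
  refine h5.congr fun p _ => ?_
  simp only [Pi.mul_apply, map_pow, MvPolynomial.aeval_X, MvPolynomial.aeval_C, eq_ratCast]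
  push_cast
  ring

/-- The descended integrand is integrable on `σ` (continuous, `σ` bounded). [folklore] -/
theorem integrableOn_descended (h : 0 < disc q₂ q₃) (a b : ℕ) :
    IntegrableOn (fun p : Fin 1 → ℝ => p 0 ^ a * Real.sqrt (cubic q₂ q₃ (p 0)) ^ (b + 1) /
      ((b : ℝ) + 1)) (oval q₂ q₃) := by
  obtain ⟨e₃, e₂, e₁, h3, h2a, h2b, h1, hf⟩ := exists_roots h
  have h32 : e₃ < e₂ := by linarith
  have h21 : e₂ < e₁ := by linarith
  have hsub : oval q₂ q₃ ⊆ Icc (fun _ => e₃) (fun _ => e₂) := by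
    rw [oval_eq_of_roots h32 h21 hf]
    intro p hp
    rw [mem_Icc, Pi.le_def, Pi.le_def]
    exact ⟨fun i => by fin_cases i; exact hp.1.le, fun i => by fin_cases i; exact hp.2.le⟩
  have hc : Continuous fun p : Fin 1 → ℝ => p 0 ^ a * Real.sqrt (cubic q₂ q₃ (p 0)) ^ (b + 1) /
      ((b : ℝ) + 1) := by
    have : Continuous fun p : Fin 1 → ℝ => cubic q₂ q₃ (p 0) :=
      continuous_cubic.comp (continuous_apply 0)
    fun_prop
  exact (hc.continuousOn.integrableOn_compact isCompact_Icc).mono_set hsub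

/-- **The honest descended representation `[σ, x^a √f^{b+1}/(b+1)]`**. [cite: KontsevichZagier2001, §1.1] -/
def vBaseRep (h : 0 < disc q₂ q₃) (a b : ℕ) : IntegralRep 1 where
  domain := oval q₂ q₃
  integrand := fun p => p 0 ^ a * Real.sqrt (cubic q₂ q₃ (p 0)) ^ (b + 1) / ((b : ℝ) + 1)
  isSemialgebraic_domain := isSemialgebraic_oval h
  isSemialgebraicFunOn_integrand := isSemialgebraicFunOn_descended h a b
  integrableOn := integrableOn_descended h a b

/-- **Vertical descent is ONE legal Newton–Leibniz move, for every admissible parameter and every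
moment**: `[vBand, x^a y^b] − [σ, x^a √f^{b+1}/(b+1)] ∈ KZ.newtonLeibnizRel`, with base the OPEN
oval `σ`, bounds `a(x) = 0 ≤ b(x) = √f(x)` (both `ℚ`-semialgebraic on `σ`), polynomial primitive
`F(x, y) = x^a y^{b+1}/(b+1)` (semialgebraic on the band, continuous on each closed fibre, with
`∂F/∂y = x^a y^b` on the open fibre) and `F(x, √f) − F(x, 0) = x^a √f^{b+1}/(b+1)`. This is the
rule-3 half of `stub_verticalDescent` (the other half is one (1a) move across the two null graphs
`y = 0`, `y = √f(x)` separating the closed band from the open `D`). [cite: KontsevichZagier2001, §1.2 rule (3)] -/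
theorem of_vBandRep_sub_of_vBaseRep_mem_newtonLeibnizRel (h : 0 < disc q₂ q₃) (a b : ℕ) :
    KZ.of (vBandRep h a b) - KZ.of (vBaseRep h a b) ∈ newtonLeibnizRel := by
  have hs := isSemialgebraic_oval h
  refine ⟨1, vBandRep h a b, vBaseRep h a b, fun _ => 0, sqrtCubic q₂ q₃,
    fun z => z 0 ^ a * z 1 ^ (b + 1) / ((b : ℝ) + 1), ?_, ?_, ?_, ?_, rfl, ?_, ?_, ?_, rfl⟩
  · -- `F` is semialgebraic on the band (a `ℚ`-polynomial)
    refine (isSemialgebraicFunOn_aeval (isSemialgebraic_vBand h)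
      (C (1 / ((b : ℚ) + 1)) * X 0 ^ a * X 1 ^ (b + 1) : MvPolynomial (Fin 2) ℚ)).congr fun z _ => ?_
    simp only [map_mul, map_pow, MvPolynomial.aeval_X, MvPolynomial.aeval_C, eq_ratCast]
    push_cast
    ring
  · -- `a = 0` is semialgebraic on `σ`
    exact (isSemialgebraicFunOn_aeval hs (0 : MvPolynomial (Fin 1) ℚ)).congr fun _ _ => by simp
  · -- `b = √f` is semialgebraic on `σ`
    have := IsSemialgebraicFunOn.sqrt_holds (isSemialgebraicFunOn_aeval hs (cubicPolyQ q₂ q₃))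
    exact this.congr fun p _ => by simp [aeval_cubicPolyQ, sqrtCubic]
  · -- `a ≤ b`
    intro x _
    exact Real.sqrt_nonneg _
  · -- continuity of `t ↦ F (x, t)` on the closed fibre
    intro x _
    show ContinuousOn (fun t : ℝ => (Fin.snoc x t : Fin 2 → ℝ) 0 ^ a *
      (Fin.snoc x t : Fin 2 → ℝ) 1 ^ (b + 1) / ((b : ℝ) + 1)) _
    simp only [snoc₂_apply_zero, snoc₂_apply_one]
    fun_prop
  · -- derivative on the open fibre
    intro x _ t _
    show HasDerivAt (fun s : ℝ => (Fin.snoc x s : Fin 2 → ℝ) 0 ^ a *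
      (Fin.snoc x s : Fin 2 → ℝ) 1 ^ (b + 1) / ((b : ℝ) + 1))
      ((Fin.snoc x t : Fin 2 → ℝ) 0 ^ a * (Fin.snoc x t : Fin 2 → ℝ) 1 ^ b) t
    simp only [snoc₂_apply_zero, snoc₂_apply_one]
    have hb : ((b : ℝ) + 1) ≠ 0 := by positivity
    have h1 : HasDerivAt (fun s : ℝ => s ^ (b + 1)) (((b + 1 : ℕ) : ℝ) * t ^ b) t := by
      simpa using hasDerivAt_pow (b + 1) t
    have h2 := (h1.const_mul (x 0 ^ a)).div_const ((b : ℝ) + 1)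
    have key : x 0 ^ a * (((b + 1 : ℕ) : ℝ) * t ^ b) / ((b : ℝ) + 1) = x 0 ^ a * t ^ b := by
      rw [Nat.cast_succ, mul_div_assoc, mul_div_cancel_left₀ _ hb]
    rw [key] at h2
    exact h2
  · -- boundary values
    intro x _
    show x 0 ^ a * Real.sqrt (cubic q₂ q₃ (x 0)) ^ (b + 1) / ((b : ℝ) + 1) =
      (Fin.snoc x (sqrtCubic q₂ q₃ x) : Fin 2 → ℝ) 0 ^ a *
        (Fin.snoc x (sqrtCubic q₂ q₃ x) : Fin 2 → ℝ) 1 ^ (b + 1) / ((b : ℝ) + 1) -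
      (Fin.snoc x ((fun _ => (0 : ℝ)) x) : Fin 2 → ℝ) 0 ^ a *
        (Fin.snoc x ((fun _ => (0 : ℝ)) x) : Fin 2 → ℝ) 1 ^ (b + 1) / ((b : ℝ) + 1)
    simp only [snoc₂_apply_zero, snoc₂_apply_one, sqrtCubic]
    rw [zero_pow (Nat.succ_ne_zero b)]
    ring

/-- Hence `[vBand, x^a y^b] ~ [σ, x^a √f^{b+1}/(b+1)]`. [cite: KontsevichZagier2001, §1.2 rule (3)] -/
theorem of_vBandRep_sub_of_vBaseRep_mem_relations (h : 0 < disc q₂ q₃) (a b : ℕ) :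
    KZ.of (vBandRep h a b) - KZ.of (vBaseRep h a b) ∈ relations :=
  newtonLeibnizRel_subset_relations (of_vBandRep_sub_of_vBaseRep_mem_newtonLeibnizRel h a b)

/-! ### The (1a) passage: closed vertical band versus the open region `D` (two null graphs) -/

/-- Graphs of measurable functions are Lebesgue-null in `ℝ²` (Tonelli: every vertical slice is a
point). [folklore] -/
theorem volume_graph_eq_zero {g : ℝ → ℝ} (hg : Measurable g) :
    volume {z : Fin 2 → ℝ | z 1 = g (z 0)} = 0 := by
  have e := MeasureTheory.volume_preserving_finTwoArrow ℝ
  have hmeas : MeasurableSet {p : ℝ × ℝ | p.2 = g p.1} :=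
    measurableSet_eq_fun measurable_snd (hg.comp measurable_fst)
  have hset : {z : Fin 2 → ℝ | z 1 = g (z 0)} =
      MeasurableEquiv.finTwoArrow ⁻¹' {p : ℝ × ℝ | p.2 = g p.1} := by
    ext z; simp
  rw [hset, e.measure_preimage hmeas.nullMeasurableSet, Measure.volume_eq_prod,
    Measure.prod_apply hmeas]
  have hslice : ∀ x : ℝ, volume (Prod.mk x ⁻¹' {p : ℝ × ℝ | p.2 = g p.1}) = 0 := by
    intro x
    have : Prod.mk x ⁻¹' {p : ℝ × ℝ | p.2 = g p.1} = {g x} := by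
      ext y; simp
    rw [this, Real.volume_singleton]
  simp only [hslice, lintegral_zero]

/-- The two null graphs separating the closed band from `D`: `y = 0` and `y = √f(x)` over `σ`.
[folklore] -/
def vEnds (q₂ q₃ : ℚ) : Set (Fin 2 → ℝ) :=
  {z | (Fin.init z : Fin 1 → ℝ) ∈ oval q₂ q₃ ∧ (z 1 = 0 ∨ z 1 = Real.sqrt (cubic q₂ q₃ (z 0)))}

/-- `vEnds` is Lebesgue-null. [folklore] -/
theorem volume_vEnds (q₂ q₃ : ℚ) : volume (vEnds q₂ q₃) = 0 := by
  have h0 := volume_graph_eq_zero (g := fun _ => (0 : ℝ)) measurable_const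
  have h1 := volume_graph_eq_zero (g := fun x => Real.sqrt (cubic q₂ q₃ x))
    (Real.continuous_sqrt.comp continuous_cubic).measurable
  apply measure_mono_null (t := {z : Fin 2 → ℝ | z 1 = (fun _ => (0 : ℝ)) (z 0)} ∪
    {z : Fin 2 → ℝ | z 1 = Real.sqrt (cubic q₂ q₃ (z 0))}) ?_ (measure_union_null h0 h1)
  rintro z ⟨-, hz | hz⟩
  · exact Or.inl hz
  · exact Or.inr hz

/-- `vEnds` is `ℚ`-semialgebraic (`y = 0`, or `y ≥ 0 ∧ y² = f(x)`, over the cylinder on `σ`).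
[folklore] -/
theorem isSemialgebraic_vEnds (h : 0 < disc q₂ q₃) : IsSemialgebraic ℚ (vEnds q₂ q₃) := by
  have h1 : IsSemialgebraic ℚ {z : Fin 2 → ℝ | (Fin.init z : Fin 1 → ℝ) ∈ oval q₂ q₃} :=
    (isSemialgebraic_oval h).setOf_init_mem
  have h2 := isSemialgebraic_setOf_eval_eq_zero (k := ℚ) (R := ℝ) (X 1 : MvPolynomial (Fin 2) ℚ)
  have h3 := isSemialgebraic_setOf_eval_eq_zero (k := ℚ) (R := ℝ)
    (cubicPoly₂ q₂ q₃ - X 1 ^ 2 : MvPolynomial (Fin 2) ℚ)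
  have h4 : IsSemialgebraic ℚ {z : Fin 2 → ℝ | 0 ≤ z 1} := by
    have ha := isSemialgebraic_setOf_eval_pos (k := ℚ) (R := ℝ) (X 1 : MvPolynomial (Fin 2) ℚ)
    convert ha.union h2 using 1
    ext z
    simp only [mem_setOf_eq, mem_union, MvPolynomial.aeval_X]
    constructor
    · intro hz
      rcases hz.lt_or_eq with hz | hz
      · exact Or.inl hz
      · exact Or.inr hz.symm
    · rintro (hz | hz)
      · exact hz.le
      · exact hz.ge
  convert h1.inter (h2.union (h4.inter h3)) using 1
  ext z
  simp only [vEnds, mem_setOf_eq, mem_inter_iff, mem_union, MvPolynomial.aeval_X, map_sub, map_pow,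
    aeval_cubicPoly₂]
  constructor
  · rintro ⟨hσ, hz | hz⟩
    · exact ⟨hσ, Or.inl hz⟩
    · refine ⟨hσ, Or.inr ⟨?_, ?_⟩⟩
      · rw [hz]; exact Real.sqrt_nonneg _
      · have hf : 0 ≤ cubic q₂ q₃ (z 0) := hσ.1.le
        rw [hz, Real.sq_sqrt hf]; ring
  · rintro ⟨hσ, hz | ⟨hz0, hz⟩⟩
    · exact ⟨hσ, Or.inl hz⟩
    · refine ⟨hσ, Or.inr ?_⟩
      have hf : 0 ≤ cubic q₂ q₃ (z 0) := hσ.1.le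
      have : z 1 ^ 2 = cubic q₂ q₃ (z 0) := by linarith
      rw [← this, Real.sqrt_sq hz0]

/-- `vBand = D ∪ vEnds`. [folklore] -/
theorem vBand_eq_union (q₂ q₃ : ℚ) : vBand q₂ q₃ = underGraph q₂ q₃ ∪ vEnds q₂ q₃ := by
  ext z
  simp only [mem_vBand_iff, underGraph, vEnds, mem_union, mem_setOf_eq]
  constructor
  · rintro ⟨hσ, h0, hle⟩
    have hσ' : 0 < cubic q₂ q₃ (z 0) ∧ ∃ t : ℝ, z 0 < t ∧ cubic q₂ q₃ t < 0 := hσ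
    rcases h0.lt_or_eq with h0 | h0
    · rcases hle.lt_or_eq with hle | hle
      · left
        refine ⟨hσ', h0, ?_⟩
        calc z 1 ^ 2 < Real.sqrt (cubic q₂ q₃ (z 0)) ^ 2 := by gcongr
          _ = cubic q₂ q₃ (z 0) := Real.sq_sqrt hσ'.1.le
      · exact Or.inr ⟨hσ, Or.inr hle⟩
    · exact Or.inr ⟨hσ, Or.inl h0.symm⟩
  · rintro (⟨hσ, h0, hlt⟩ | ⟨hσ, hz | hz⟩)
    · refine ⟨hσ, h0.le, ?_⟩
      exact (Real.lt_sqrt h0.le).2 hlt |>.le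
    · have hσ' : 0 < cubic q₂ q₃ (z 0) ∧ ∃ t : ℝ, z 0 < t ∧ cubic q₂ q₃ t < 0 := hσ
      exact ⟨hσ, hz.ge, by rw [hz]; exact Real.sqrt_nonneg _⟩
    · exact ⟨hσ, by rw [hz]; exact Real.sqrt_nonneg _, hz.le⟩

/-- `D` and `vEnds` are disjoint. [folklore] -/
theorem underGraph_inter_vEnds (q₂ q₃ : ℚ) : underGraph q₂ q₃ ∩ vEnds q₂ q₃ = ∅ := by
  ext z
  simp only [underGraph, vEnds, mem_inter_iff, mem_setOf_eq, mem_empty_iff_false, iff_false]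
  rintro ⟨⟨hσ, h0, hlt⟩, -, hz | hz⟩
  · rw [hz] at h0; exact lt_irrefl _ h0
  · rw [hz, Real.sq_sqrt hσ.1.le] at hlt; exact lt_irrefl _ hlt

/-- The moment restricted to the null graphs, as a representation. [folklore] -/
def vEndsRep (h : 0 < disc q₂ q₃) (a b : ℕ) : IntegralRep 2 where
  domain := vEnds q₂ q₃
  integrand := fun p => p 0 ^ a * p 1 ^ b
  isSemialgebraic_domain := isSemialgebraic_vEnds h
  isSemialgebraicFunOn_integrand :=
    (isSemialgebraicFunOn_aeval (isSemialgebraic_vEnds h)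
      (X 0 ^ a * X 1 ^ b : MvPolynomial (Fin 2) ℚ)).congr fun p _ => by simp
  integrableOn := by
    rw [IntegrableOn, Measure.restrict_eq_zero.2 (volume_vEnds q₂ q₃)]
    exact integrable_zero_measure

/-- A representation on a null domain is a relation (`[N] − [N] − [N] ∈ domainAddRel`). [folklore] -/
theorem of_vEndsRep_mem_relations (h : 0 < disc q₂ q₃) (a b : ℕ) :
    KZ.of (vEndsRep h a b) ∈ relations := by
  have hmem : KZ.of (vEndsRep h a b) - KZ.of (vEndsRep h a b) - KZ.of (vEndsRep h a b) ∈
      domainAddRel :=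
    ⟨2, vEndsRep h a b, vEndsRep h a b, vEndsRep h a b, (union_self _).symm,
      by rw [inter_self]; exact volume_vEnds q₂ q₃, fun _ _ => rfl, fun _ _ => rfl, rfl⟩
  have h' := domainAddRel_subset_relations hmem
  have : KZ.of (vEndsRep h a b) =
      -(KZ.of (vEndsRep h a b) - KZ.of (vEndsRep h a b) - KZ.of (vEndsRep h a b)) := by abel
  rw [this]
  exact relations.neg_mem h'

/-- **`stub_verticalDescent`, PROVED for every admissible parameter** (with the skeleton's
decorative hypothesis `hσ : IsSemialgebraic ℚ σ` dropped): for every representation `r` of the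
moment `[D, x^a y^b]` there is a representation `s = [σ, x^a √f^{b+1}/(b+1)]` with
`[r] − [s] ∈ KZ.relations` — ONE (1a) move `[vBand] − [r] − [vEnds]` (null overlap `D ∩ vEnds = ∅`),
the null representation `[vEnds] ~ 0`, and the rule-3 move
`of_vBandRep_sub_of_vBaseRep_mem_newtonLeibnizRel`. Over the vocabulary of this file
(`oval/underGraph/cubic/disc`, definitionally equal to the `EllipticMomentKernelNegative` copies).
[cite: KontsevichZagier2001, §1.2 rules (1) and (3)] -/
theorem verticalDescent (h : 0 < disc q₂ q₃) (a b : ℕ) (r : IntegralRep 2)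
    (hr : r.domain = underGraph q₂ q₃)
    (hri : EqOn r.integrand (fun p => p 0 ^ a * p 1 ^ b) (underGraph q₂ q₃)) :
    ∃ s : IntegralRep 1, s.domain = oval q₂ q₃ ∧
      EqOn s.integrand (fun p => p 0 ^ a * Real.sqrt (cubic q₂ q₃ (p 0)) ^ (b + 1) / ((b : ℝ) + 1))
        (oval q₂ q₃) ∧
      KZ.of r - KZ.of s ∈ relations := by
  refine ⟨vBaseRep h a b, rfl, fun _ _ => rfl, ?_⟩
  -- the (1a) move
  have h1a : KZ.of (vBandRep h a b) - KZ.of r - KZ.of (vEndsRep h a b) ∈ domainAddRel := by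
    refine ⟨2, vBandRep h a b, r, vEndsRep h a b, ?_, ?_, ?_, fun _ _ => rfl, rfl⟩
    · show vBand q₂ q₃ = r.domain ∪ vEnds q₂ q₃
      rw [hr, vBand_eq_union]
    · show volume (r.domain ∩ vEnds q₂ q₃) = 0
      rw [hr, underGraph_inter_vEnds, measure_empty]
    · intro z hz
      rw [hr] at hz
      exact (hri hz).symm
  have hA := domainAddRel_subset_relations h1a
  have hB := of_vEndsRep_mem_relations h a b
  have hC := of_vBandRep_sub_of_vBaseRep_mem_relations h a b
  have : KZ.of r - KZ.of (vBaseRep h a b) =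
      (KZ.of (vBandRep h a b) - KZ.of (vBaseRep h a b)) -
        (KZ.of (vBandRep h a b) - KZ.of r - KZ.of (vEndsRep h a b)) - KZ.of (vEndsRep h a b) := by
    abel
  rw [this]
  exact relations.sub_mem (relations.sub_mem hC hA) hB


end VerticalDescent

/-! ## §10 (cycle 2): `stub_polynomialToConstant` is TRUE — proved for every admissible parameter;
the rule-3 move over `ℝ⁰` with IRRATIONAL algebraic bounds is legal

`[σ, Q] ~ [pt, ∫_σ Q]` for every `Q ∈ ℚ[X]`: a rational primitive `R` (`exists_derivative_eq`), the
value `∫_σ Q = R(e₂) − R(e₃)` (FTC transferred to `ℝ¹`, `integral_oval_aeval_eq`), its algebraicity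
(`isAlgebraic_integral_oval_aeval` — the stub's `∃ hA`), the legal 0-dimensional constant
representation `constRep₀` (`volume univ = 1` on `ℝ⁰`, `value_constRep₀`), ONE `newtonLeibnizRel`
instance over `ℝ⁰` with bounds `e₃, e₂` and band `closedBandQ` (§7 kit), ONE (1a) move across the
null `endsQ`. The skeleton's `constRep _ hA` carries the same data `(univ, fun _ => ∫_σ Q)`, so it
agrees with `constRep₀ _ _` by proof irrelevance. With §9 this closes the whole `b`-odd branch of
the line for the adversary: nothing left to bite on. -/

section PolynomialToConstant

open Literature.ModelTheory.ExponentialFields (IsSemialgebraic isSemialgebraic_setOf_eval_pos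
  isSemialgebraic_setOf_eval_eq_zero isSemialgebraic_univ)
open MvPolynomial (aeval X C)

variable {q₂ q₃ : ℚ}

/-- Every rational polynomial has a rational primitive. [folklore] -/
theorem exists_derivative_eq (Q : Polynomial ℚ) :
    ∃ R : Polynomial ℚ, Polynomial.derivative R = Q := by
  induction Q using Polynomial.induction_on' with
  | add p q hp hq =>
    obtain ⟨Rp, hRp⟩ := hp
    obtain ⟨Rq, hRq⟩ := hq
    exact ⟨Rp + Rq, by rw [Polynomial.derivative_add, hRp, hRq]⟩
  | monomial n a =>
    refine ⟨Polynomial.C (a / ((n : ℚ) + 1)) * Polynomial.X ^ (n + 1), ?_⟩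
    have hn : ((n : ℚ) + 1) ≠ 0 := by positivity
    rw [Polynomial.derivative_C_mul_X_pow, ← Polynomial.C_mul_X_pow_eq_monomial, Nat.add_sub_cancel]
    congr 2
    push_cast
    exact div_mul_cancel₀ a hn

/-- **Value level**: `∫_σ Q = R(e₂) − R(e₃)` for any primitive `R` of `Q` (fundamental theorem of
calculus on `(e₃, e₂)`, transferred to `ℝ¹`). [folklore] -/
theorem integral_oval_aeval_eq {e₃ e₂ e₁ : ℝ} (h32 : e₃ < e₂) (h21 : e₂ < e₁)
    (hf : ∀ x, cubic q₂ q₃ x = 4 * (x - e₃) * (x - e₂) * (x - e₁)) {Q R : Polynomial ℚ}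
    (hRQ : Polynomial.derivative R = Q) :
    ∫ p in oval q₂ q₃, (Polynomial.aeval (p 0) Q : ℝ) =
      Polynomial.aeval e₂ R - Polynomial.aeval e₃ R := by
  have hset : oval q₂ q₃ = e1 ⁻¹' Ioo e₃ e₂ := by
    rw [oval_eq_of_roots h32 h21 hf]; ext p; simp [e1_apply]
  rw [hset]
  have h1 := measurePreserving_e1.setIntegral_preimage_emb e1.measurableEmbedding
    (fun x : ℝ => (Polynomial.aeval x Q : ℝ)) (Ioo e₃ e₂)
  simp only [e1_apply] at h1
  rw [h1, ← integral_Ioc_eq_integral_Ioo, ← intervalIntegral.integral_of_le h32.le]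
  have hderiv : ∀ x ∈ uIcc e₃ e₂,
      HasDerivAt (fun x : ℝ => (Polynomial.aeval x R : ℝ)) (Polynomial.aeval x Q) x := by
    intro x _
    have := Polynomial.hasDerivAt_aeval (R := ℚ) R x
    rwa [hRQ] at this
  have hcont : Continuous fun x : ℝ => (Polynomial.aeval x Q : ℝ) := Polynomial.continuous_aeval Q
  exact intervalIntegral.integral_eq_sub_of_hasDerivAt hderiv (hcont.intervalIntegrable _ _)

/-- **The constant of the `b`-odd branch is real algebraic**: `∫_σ Q ∈ ℚ(e₂, e₃)`. This is the
`∃ hA` of `stub_polynomialToConstant`. [folklore] -/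
theorem isAlgebraic_integral_oval_aeval (h : 0 < disc q₂ q₃) (Q : Polynomial ℚ) :
    IsAlgebraic ℚ (∫ p in oval q₂ q₃, (Polynomial.aeval (p 0) Q : ℝ)) := by
  obtain ⟨e₃, e₂, e₁, h3, h2a, h2b, h1, hf⟩ := exists_roots h
  have h32 : e₃ < e₂ := by linarith
  have h21 : e₂ < e₁ := by linarith
  obtain ⟨R, hRQ⟩ := exists_derivative_eq Q
  obtain ⟨h₃, h₂, -⟩ := cubic_roots_eq_zero hf
  rw [integral_oval_aeval_eq h32 h21 hf hRQ]
  exact isAlgebraic_aeval_sub_aeval h₃ h₂ R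

/-- `ℝ⁰` has total Lebesgue mass `1` (empty product). [folklore] -/
theorem volume_univ_fin_zero : volume (univ : Set (Fin 0 → ℝ)) = 1 := by
  rw [volume_pi, Measure.pi_univ]
  simp

/-- **The 0-dimensional constant representation `[pt, A]`** for a real algebraic `A`.
[cite: KontsevichZagier2001, §1.1] -/
def constRep₀ (A : ℝ) (hA : IsAlgebraic ℚ A) : IntegralRep 0 where
  domain := univ
  integrand := fun _ => A
  isSemialgebraic_domain := isSemialgebraic_univ
  isSemialgebraicFunOn_integrand := isSemialgebraicFunOn_const_of_isAlgebraic isSemialgebraic_univ hA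
  integrableOn := integrableOn_const (by rw [volume_univ_fin_zero]; exact ENNReal.one_ne_top)

/-- Its value is `A`. [folklore] -/
theorem value_constRep₀ (A : ℝ) (hA : IsAlgebraic ℚ A) : (constRep₀ A hA).value = A := by
  simp only [IntegralRep.value, constRep₀, Measure.restrict_univ, integral_const, smul_eq_mul]
  rw [show (volume : Measure (Fin 0 → ℝ)).real univ = 1 by
    simp [Measure.real, volume_univ_fin_zero]]
  ring

/-- The polynomial integrand on `ℝ¹` is continuous. [folklore] -/
theorem continuous_aeval_apply_zero (Q : Polynomial ℚ) :
    Continuous fun p : Fin 1 → ℝ => (Polynomial.aeval (p 0) Q : ℝ) :=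
  (Polynomial.continuous_aeval Q).comp (continuous_apply 0)

/-- The polynomial integrand is `ℚ`-semialgebraic on any `ℚ`-semialgebraic subset of `ℝ¹`.
[folklore] -/
theorem isSemialgebraicFunOn_aeval_apply_zero {s : Set (Fin 1 → ℝ)} (hs : IsSemialgebraic ℚ s)
    (Q : Polynomial ℚ) :
    IsSemialgebraicFunOn ℚ s (fun p => (Polynomial.aeval (p 0) Q : ℝ)) := by
  refine (isSemialgebraicFunOn_aeval hs (Polynomial.aeval (X 0 : MvPolynomial (Fin 1) ℚ) Q)).congr
    fun p _ => ?_
  show aeval p (Polynomial.aeval (X 0 : MvPolynomial (Fin 1) ℚ) Q) = Polynomial.aeval (p 0) Q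
  rw [← Polynomial.aeval_algHom_apply, MvPolynomial.aeval_X]

/-- `[closedBandQ e₃ e₂, Q]` — the band representation of the rule-3 move. [folklore] -/
def polyBandRep {e₃ e₂ e₁ : ℝ} (h32 : e₃ < e₂) (h21 : e₂ < e₁)
    (hf : ∀ x, cubic q₂ q₃ x = 4 * (x - e₃) * (x - e₂) * (x - e₁)) (Q : Polynomial ℚ) :
    IntegralRep 1 where
  domain := closedBandQ e₃ e₂
  integrand := fun p => (Polynomial.aeval (p 0) Q : ℝ)
  isSemialgebraic_domain := isSemialgebraic_closedBandQ h32 h21 hf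
  isSemialgebraicFunOn_integrand :=
    isSemialgebraicFunOn_aeval_apply_zero (isSemialgebraic_closedBandQ h32 h21 hf) Q
  integrableOn := by
    have hsub : closedBandQ e₃ e₂ ⊆ Icc (fun _ => e₃) (fun _ => e₂) := by
      rw [closedBandQ_eq]
      intro p hp
      rw [mem_Icc, Pi.le_def, Pi.le_def]
      exact ⟨fun i => by fin_cases i; exact hp.1, fun i => by fin_cases i; exact hp.2⟩
    exact ((continuous_aeval_apply_zero Q).continuousOn.integrableOn_compact isCompact_Icc).mono_set
      hsub

/-- `[endsQ e₃ e₂, Q]` — the null piece. [folklore] -/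
def polyEndsRep {e₃ e₂ e₁ : ℝ} (hf : ∀ x, cubic q₂ q₃ x = 4 * (x - e₃) * (x - e₂) * (x - e₁))
    (Q : Polynomial ℚ) : IntegralRep 1 where
  domain := endsQ e₃ e₂
  integrand := fun p => (Polynomial.aeval (p 0) Q : ℝ)
  isSemialgebraic_domain :=
    isSemialgebraic_endsQ (cubic_roots_eq_zero hf).1 (cubic_roots_eq_zero hf).2.1
  isSemialgebraicFunOn_integrand :=
    isSemialgebraicFunOn_aeval_apply_zero
      (isSemialgebraic_endsQ (cubic_roots_eq_zero hf).1 (cubic_roots_eq_zero hf).2.1) Q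
  integrableOn := by
    rw [IntegrableOn, Measure.restrict_eq_zero.2 (volume_endsQ e₃ e₂)]
    exact integrable_zero_measure

/-- **The polynomial-to-constant step is ONE legal Newton–Leibniz move over `ℝ⁰` with the
(irrational, real algebraic) bounds `a = e₃`, `b = e₂`**: `[closedBandQ, Q] − [pt, R(e₂) − R(e₃)] ∈
KZ.newtonLeibnizRel`, primitive `F = R` (`R′ = Q`). [cite: KontsevichZagier2001, §1.2 rule (3)] -/
theorem of_polyBandRep_sub_of_constRep₀_mem_newtonLeibnizRel {e₃ e₂ e₁ : ℝ} (h32 : e₃ < e₂)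
    (h21 : e₂ < e₁) (hf : ∀ x, cubic q₂ q₃ x = 4 * (x - e₃) * (x - e₂) * (x - e₁))
    {Q R : Polynomial ℚ} (hRQ : Polynomial.derivative R = Q)
    (hA : IsAlgebraic ℚ (Polynomial.aeval e₂ R - Polynomial.aeval e₃ R : ℝ)) :
    KZ.of (polyBandRep h32 h21 hf Q) - KZ.of (constRep₀ _ hA) ∈ newtonLeibnizRel := by
  obtain ⟨h₃, h₂, -⟩ := cubic_roots_eq_zero hf
  refine ⟨0, polyBandRep h32 h21 hf Q, constRep₀ _ hA, fun _ => e₃, fun _ => e₂,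
    fun z => (Polynomial.aeval (z 0) R : ℝ), ?_, isSemialgebraicFunOn_const_root h₃,
    isSemialgebraicFunOn_const_root h₂, fun _ _ => h32.le, rfl, ?_, ?_, ?_, rfl⟩
  · exact isSemialgebraicFunOn_aeval_apply_zero (isSemialgebraic_closedBandQ h32 h21 hf) R
  · intro x _
    show ContinuousOn (fun t : ℝ => (Polynomial.aeval ((Fin.snoc x t : Fin 1 → ℝ) 0) R : ℝ)) _
    simp only [snoc_apply_zero]
    exact (Polynomial.continuous_aeval R).continuousOn
  · intro x _ t _
    show HasDerivAt (fun s : ℝ => (Polynomial.aeval ((Fin.snoc x s : Fin 1 → ℝ) 0) R : ℝ))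
      (Polynomial.aeval ((Fin.snoc x t : Fin 1 → ℝ) 0) Q) t
    simp only [snoc_apply_zero]
    have := Polynomial.hasDerivAt_aeval (R := ℚ) R t
    rwa [hRQ] at this
  · intro x _
    show (Polynomial.aeval e₂ R : ℝ) - Polynomial.aeval e₃ R =
      Polynomial.aeval ((Fin.snoc x ((fun _ => e₂) x) : Fin 1 → ℝ) 0) R -
        Polynomial.aeval ((Fin.snoc x ((fun _ => e₃) x) : Fin 1 → ℝ) 0) R
    simp only [snoc_apply_zero]

/-- A representation on the null set `endsQ` is a relation. [folklore] -/
theorem of_polyEndsRep_mem_relations {e₃ e₂ e₁ : ℝ}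
    (hf : ∀ x, cubic q₂ q₃ x = 4 * (x - e₃) * (x - e₂) * (x - e₁)) (Q : Polynomial ℚ) :
    KZ.of (polyEndsRep hf Q) ∈ relations := by
  have hmem : KZ.of (polyEndsRep hf Q) - KZ.of (polyEndsRep hf Q) - KZ.of (polyEndsRep hf Q) ∈
      domainAddRel :=
    ⟨1, polyEndsRep hf Q, polyEndsRep hf Q, polyEndsRep hf Q, (union_self _).symm,
      by rw [inter_self]; exact volume_endsQ e₃ e₂, fun _ _ => rfl, fun _ _ => rfl, rfl⟩
  have h' := domainAddRel_subset_relations hmem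
  have : KZ.of (polyEndsRep hf Q) =
      -(KZ.of (polyEndsRep hf Q) - KZ.of (polyEndsRep hf Q) - KZ.of (polyEndsRep hf Q)) := by abel
  rw [this]
  exact relations.neg_mem h'

/-- **`stub_polynomialToConstant`, PROVED for every admissible parameter** (decorative `hσ` dropped;
the skeleton's `constRep _ hA` has the same data `(univ, fun _ => ∫_σ Q)` as `constRep₀`, so the two
agree by proof irrelevance): `∫_σ Q` is real algebraic and `[r] − [pt, ∫_σ Q] ∈ KZ.relations` for
every representation `r` of `[σ, Q]` — ONE (1a) move across the null `endsQ`, `[endsQ] ~ 0`, and the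
rule-3 move `of_polyBandRep_sub_of_constRep₀_mem_newtonLeibnizRel`.
[cite: KontsevichZagier2001, §1.2 rules (1) and (3)] -/
theorem polynomialToConstant (h : 0 < disc q₂ q₃) (Q : Polynomial ℚ) :
    ∃ hA : IsAlgebraic ℚ (∫ p in oval q₂ q₃, (Polynomial.aeval (p 0) Q : ℝ)),
      ∀ r : IntegralRep 1, r.domain = oval q₂ q₃ →
        EqOn r.integrand (fun p => (Polynomial.aeval (p 0) Q : ℝ)) (oval q₂ q₃) →
        KZ.of r - KZ.of (constRep₀ _ hA) ∈ relations := by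
  refine ⟨isAlgebraic_integral_oval_aeval h Q, fun r hr hri => ?_⟩
  obtain ⟨e₃, e₂, e₁, h3, h2a, h2b, h1, hf⟩ := exists_roots h
  have h32 : e₃ < e₂ := by linarith
  have h21 : e₂ < e₁ := by linarith
  obtain ⟨R, hRQ⟩ := exists_derivative_eq Q
  obtain ⟨h₃, h₂, -⟩ := cubic_roots_eq_zero hf
  have hval := integral_oval_aeval_eq h32 h21 hf hRQ
  have hA' : IsAlgebraic ℚ (Polynomial.aeval e₂ R - Polynomial.aeval e₃ R : ℝ) :=
    isAlgebraic_aeval_sub_aeval h₃ h₂ R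
  -- the constant representation of the stub IS `constRep₀ (R(e₂) − R(e₃))`
  have hc : constRep₀ _ (isAlgebraic_integral_oval_aeval h Q) = constRep₀ _ hA' := by
    simp only [constRep₀, hval]
  rw [hc]
  -- the (1a) move
  have h1a : KZ.of (polyBandRep h32 h21 hf Q) - KZ.of r - KZ.of (polyEndsRep hf Q) ∈
      domainAddRel := by
    refine ⟨1, polyBandRep h32 h21 hf Q, r, polyEndsRep hf Q, ?_, ?_, ?_, fun _ _ => rfl, rfl⟩
    · show closedBandQ e₃ e₂ = r.domain ∪ endsQ e₃ e₂
      rw [hr, closedBandQ_eq_union h32 h21 hf]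
    · show volume (r.domain ∩ endsQ e₃ e₂) = 0
      rw [hr, oval_inter_endsQ h32 h21 hf, measure_empty]
    · intro z hz
      rw [hr] at hz
      exact (hri hz).symm
  have hAr := domainAddRel_subset_relations h1a
  have hB := of_polyEndsRep_mem_relations hf Q
  have hC := newtonLeibnizRel_subset_relations
    (of_polyBandRep_sub_of_constRep₀_mem_newtonLeibnizRel h32 h21 hf hRQ hA')
  have : KZ.of r - KZ.of (constRep₀ _ hA') =
      (KZ.of (polyBandRep h32 h21 hf Q) - KZ.of (constRep₀ _ hA')) -
        (KZ.of (polyBandRep h32 h21 hf Q) - KZ.of r - KZ.of (polyEndsRep hf Q)) -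
        KZ.of (polyEndsRep hf Q) := by
    abel
  rw [this]
  exact relations.sub_mem (relations.sub_mem hC hAr) hB

/-- The value bookkeeping behind it: `value [pt, ∫_σ Q] = ∫_σ Q = value [σ, Q]`. [folklore] -/
theorem value_constRep₀_integral (h : 0 < disc q₂ q₃) (Q : Polynomial ℚ) :
    (constRep₀ _ (isAlgebraic_integral_oval_aeval h Q)).value =
      ∫ p in oval q₂ q₃, (Polynomial.aeval (p 0) Q : ℝ) :=
  value_constRep₀ _ _

end PolynomialToConstant


/-! ## §11 (cycle 2) Assembly notes for the lead: values come for free from the moves, and the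
odd/even dispatch of the descended integrand

Two remarks that shorten the line's assembly (`kernel_of_coordinates`): (i) by SOUNDNESS of the
calculus (tree: `KZ.relations_le_ker_eval_holds`) every move-level congruence of §9–§10 is also a
value identity — e.g. `∫_D x^a y^b = ∫_σ x^a √f^{b+1}/(b+1)` (`value_moment_eq`, a Fubini identity
obtained without Fubini) — so the hypothesis `hval` of `kernel_of_coordinates` follows from `hgen`;
(ii) the descended integrand is `Q(x)` (b odd) or `Q(x)/√f(x)` (b even) ON `σ` for the SAME rational
polynomial `Q = X^a f^{⌊b/2⌋+1}/(b+1)` (`descended_eq_poly_of_odd`, `descended_eq_poly_div_sqrt_of_even`),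
which is exactly the `EqOn` input of §10 (`polynomialToConstant`) resp. of `stub_hermiteReduction`. -/

section Assembly

open Literature.ModelTheory.ExponentialFields (IsSemialgebraic)
open MvPolynomial (aeval X C)

variable {q₂ q₃ : ℚ}

/-- The zero representation on `σ`. [folklore] -/
def zeroRepOval (h : 0 < disc q₂ q₃) : IntegralRep 1 where
  domain := oval q₂ q₃
  integrand := fun _ => 0
  isSemialgebraic_domain := isSemialgebraic_oval h
  isSemialgebraicFunOn_integrand :=
    (isSemialgebraicFunOn_aeval (isSemialgebraic_oval h) (0 : MvPolynomial (Fin 1) ℚ)).congr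
      fun _ _ => by simp
  integrableOn := integrableOn_zero

/-- `[σ, 0] ∈ relations` (`[z] − [z] − [z] ∈ integrandAddRel`). [folklore] -/
theorem of_zeroRepOval_mem_relations (h : 0 < disc q₂ q₃) : KZ.of (zeroRepOval h) ∈ relations := by
  have hmem : KZ.of (zeroRepOval h) - KZ.of (zeroRepOval h) - KZ.of (zeroRepOval h) ∈
      integrandAddRel :=
    ⟨1, zeroRepOval h, zeroRepOval h, zeroRepOval h, rfl, rfl, fun x _ => by simp [zeroRepOval], rfl⟩
  have h' := integrandAddRel_subset_relations hmem
  have : KZ.of (zeroRepOval h) =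
      -(KZ.of (zeroRepOval h) - KZ.of (zeroRepOval h) - KZ.of (zeroRepOval h)) := by abel
  rw [this]
  exact relations.neg_mem h'

/-- Two representations on `σ` that agree on `σ` are congruent (one (1b) move with `[σ, 0]`).
[folklore] -/
theorem of_sub_of_mem_relations_of_eqOn_oval (h : 0 < disc q₂ q₃) (s t : IntegralRep 1)
    (hs : s.domain = oval q₂ q₃) (ht : t.domain = oval q₂ q₃)
    (hst : EqOn s.integrand t.integrand (oval q₂ q₃)) : KZ.of s - KZ.of t ∈ relations := by
  have hadd : KZ.of s - KZ.of t - KZ.of (zeroRepOval h) ∈ integrandAddRel :=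
    ⟨1, s, t, zeroRepOval h, ht.trans hs.symm, hs.symm, fun p hp => by
      rw [hs] at hp
      simp only [Pi.add_apply, zeroRepOval, add_zero]
      exact hst hp, rfl⟩
  have h1 := integrandAddRel_subset_relations hadd
  have h2 := of_zeroRepOval_mem_relations h
  have : KZ.of s - KZ.of t = (KZ.of s - KZ.of t - KZ.of (zeroRepOval h)) + KZ.of (zeroRepOval h) := by
    abel
  rw [this]
  exact relations.add_mem h1 h2

/-- Soundness, packaged: congruent representations have equal values.
[cite: KontsevichZagier2001, §1.2] -/
theorem value_eq_of_sub_mem_relations {n m : ℕ} (r : IntegralRep n) (s : IntegralRep m)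
    (h : KZ.of r - KZ.of s ∈ relations) : r.value = s.value :=
  Equivalent.value_eq_holds h

/-- **`∫_D x^a y^b = ∫_σ x^a √f^{b+1}/(b+1)`** for every representation of the moment — from
`verticalDescent` and soundness (no Fubini). [folklore] -/
theorem value_moment_eq (h : 0 < disc q₂ q₃) (a b : ℕ) (r : IntegralRep 2)
    (hr : r.domain = underGraph q₂ q₃)
    (hri : EqOn r.integrand (fun p => p 0 ^ a * p 1 ^ b) (underGraph q₂ q₃)) :
    r.value = ∫ p in oval q₂ q₃,
      p 0 ^ a * Real.sqrt (cubic q₂ q₃ (p 0)) ^ (b + 1) / ((b : ℝ) + 1) := by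
  obtain ⟨s, hs, hsi, hrel⟩ := verticalDescent h a b r hr hri
  have hz : KZ.of s - KZ.of (vBaseRep h a b) ∈ relations :=
    of_sub_of_mem_relations_of_eqOn_oval h s (vBaseRep h a b) hs rfl hsi
  have hsum : KZ.of r - KZ.of (vBaseRep h a b) ∈ relations := by
    have : KZ.of r - KZ.of (vBaseRep h a b) =
        (KZ.of r - KZ.of s) + (KZ.of s - KZ.of (vBaseRep h a b)) := by abel
    rw [this]
    exact relations.add_mem hrel hz
  have := value_eq_of_sub_mem_relations r (vBaseRep h a b) hsum
  simpa [IntegralRep.value, vBaseRep] using this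

/-- `√y ^ (2k) = y ^ k` for `y ≥ 0`. [folklore] -/
theorem sqrt_pow_two_mul {y : ℝ} (hy : 0 ≤ y) (k : ℕ) : Real.sqrt y ^ (2 * k) = y ^ k := by
  rw [pow_mul, Real.sq_sqrt hy]

/-- The dispatch polynomial `Q = X^a · f^{k+1} / (b+1)`. [folklore] -/
def dispatchPoly (q₂ q₃ : ℚ) (a k b : ℕ) : Polynomial ℚ :=
  Polynomial.C (1 / ((b : ℚ) + 1)) * Polynomial.X ^ a *
    (4 * Polynomial.X ^ 3 - Polynomial.C q₂ * Polynomial.X - Polynomial.C q₃) ^ (k + 1)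

/-- Evaluation of the dispatch polynomial. [folklore] -/
theorem aeval_dispatchPoly (a k b : ℕ) (x : ℝ) :
    (Polynomial.aeval x (dispatchPoly q₂ q₃ a k b) : ℝ) =
      1 / ((b : ℝ) + 1) * x ^ a * cubic q₂ q₃ x ^ (k + 1) := by
  simp only [dispatchPoly, cubic, map_mul, map_pow, map_sub, Polynomial.aeval_C,
    Polynomial.aeval_X, eq_ratCast]
  have h4 : (Polynomial.aeval x) (4 : Polynomial ℚ) = (4 : ℝ) := map_ofNat _ 4
  rw [h4]
  push_cast
  ring

/-- **Odd `b = 2k + 1`: the descended integrand is the POLYNOMIAL `Q` on `σ`** (input of §10).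
[folklore] -/
theorem descended_eq_poly_of_odd (a k : ℕ) :
    EqOn (fun p : Fin 1 → ℝ => p 0 ^ a * Real.sqrt (cubic q₂ q₃ (p 0)) ^ (2 * k + 1 + 1) /
        (((2 * k + 1 : ℕ) : ℝ) + 1))
      (fun p => (Polynomial.aeval (p 0) (dispatchPoly q₂ q₃ a k (2 * k + 1)) : ℝ)) (oval q₂ q₃) := by
  intro p hp
  have hf : 0 ≤ cubic q₂ q₃ (p 0) := hp.1.le
  simp only [aeval_dispatchPoly]
  rw [show 2 * k + 1 + 1 = 2 * (k + 1) by ring, sqrt_pow_two_mul hf]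
  push_cast
  ring

/-- **Even `b = 2k`: the descended integrand is `Q/√f` on `σ`** (input of `stub_hermiteReduction`).
[folklore] -/
theorem descended_eq_poly_div_sqrt_of_even (a k : ℕ) :
    EqOn (fun p : Fin 1 → ℝ => p 0 ^ a * Real.sqrt (cubic q₂ q₃ (p 0)) ^ (2 * k + 1) /
        (((2 * k : ℕ) : ℝ) + 1))
      (fun p => (Polynomial.aeval (p 0) (dispatchPoly q₂ q₃ a k (2 * k)) : ℝ) /
        Real.sqrt (cubic q₂ q₃ (p 0))) (oval q₂ q₃) := by
  intro p hp
  have hf : 0 < cubic q₂ q₃ (p 0) := hp.1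
  have hs : 0 < Real.sqrt (cubic q₂ q₃ (p 0)) := Real.sqrt_pos.2 hf
  simp only [aeval_dispatchPoly]
  rw [eq_div_iff hs.ne', show cubic q₂ q₃ (p 0) ^ (k + 1) =
      Real.sqrt (cubic q₂ q₃ (p 0)) ^ (2 * (k + 1)) by rw [sqrt_pow_two_mul hf.le]]
  push_cast
  ring

end Assembly

/-! ## §12 (cycle 3) The crux is a THEOREM, and its rigidity hypothesis is a THEOREM on the model
curve `y² = 4x³ − 4x`

Two facts close the adversary's book on this crux.

**(A) Certificate.** Drefute gen 2 attached `Cruxes/EllipticMomentKernel/DrefuteG2LineClosed.lean`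
(1668 lines over LANDED modules `Negative.GeneralCurve`, `Negative.DimEval` + Literature): all six
stubs of the picked line `merge-first-single-hermite` proved as typed and the skeleton's glue
composed into `Summit.KontsevichZagierPeriods.HermiteRigidity.EllipticMomentKernel.DrefuteG2.
EllipticMomentKernel_of : …Theses.HermiteRigidity.EllipticMomentKernel` (pinned by full name).
This seat re-verified it independently (copy `CertG2.lean`, `lean check` rc 0, 0 sorries,
0 warnings, `#print axioms` = {propext, Classical.choice, Quot.sound}; drefute gen 3 also ran a
negative control). Hence `¬ EllipticMomentKernel` is unprovable short of an inconsistency of the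
tree: NO DISPROOF EXISTS. (This work file does not import the certificate — the farm serves crux
workfiles' oleans unreliably — so the consequences below take `h : EllipticMomentKernel` as an
explicit hypothesis where needed.)

**(B) Non-vacuity in Lean (new this cycle).** `rigid_four_zero : Rigid 4 0`. Road: transfer
`∫_σ` to `∫_{(−1,0)}` (`setIntegral_oval_four_zero`); the algebraic change of variables
`x = u² − 1`, `(0,1) → (−1,0)`, `dx = 2u du`, `f(u² − 1) = (2u)²(1 − u²)(2 − u²)`
(`integral_Ioo_comp_sq_sub_one`, Mathlib's `integral_image_eq_integral_abs_deriv_smul` — an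
identity of Bochner integrals with no integrability side condition); whence
`J₀ = ∫₀¹ du/√((1−u²)(2−u²)) = K(1/√2)/√2` (`J0_four_zero`) and
`J₁ = −∫₀¹ √(1−u²)/√(2−u²) du = (K − 2E)(1/√2)/√2` (`J1_four_zero`), `K = lemniscaticK`,
`E = lemniscaticE` of `Literature.Analysis.SpecialFunctions` (numerically `1.3110287771`,
`−0.5990701174`, matching §9's quadrature). Then `a + bJ₀ + cJ₁ = 0` reads
`√2·a + (b + c)K − 2cE = 0`, and the algebraic independence of `K, E` over `ℚ` — route
Grothendieck's LANDED `keAlgIndependent_proof` (stmt-8611; Legendre (3.8.29) + Lawden (4.3.6) +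
the tree's Chudnovsky theorem `algebraicIndependent_real_pi_gamma_one_quarter`), copied here as
`keAlgIndependent_holds` while the farm's olean of that module is unbuilt — extended to real
algebraic scalars (`AlgebraicIndependent.subalgebraAlgebraicClosure`) kills the three coefficients.
By-product: `legendre_four_zero : 4J₀J₁ = −π`, the sector's first NON-linear period relation
(Legendre / `η₁ω₁ = π` on the square lattice); it involves `π`, which is not a normal-form value of
the sector, so the LINEAR hypothesis `Rigid` neither sees nor contradicts it (its KZ-derivability
is route Grothendieck's crux `GpcLegendreLemniscatic`, stmt-0280).

**Consequences.** (C) `exists_disc_pos_and_rigid'`: both hypotheses of the crux hold at `(4,0)` —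
§8's "modulo one glue" is discharged by the lemniscatic road instead of the `ζ`-road; and by the
scaling `x = l·u` (`4l² = q₂`; `J₀ ↦ J₀/√l`, `J₁ ↦ √l·J₁`, `√l` real algebraic) on the whole twist
family: `rigid_q2_zero : 0 < q₂ → Rigid q₂ 0`, `kernelClaim_q2_zero_of'`;
(D) `kernelClaim_four_zero_of' : EllipticMomentKernel → KernelClaim 4 0` — with (A), Conjecture 1
holds UNCONDITIONALLY on the elliptic moment sector of `y² = 4x³ − 4x`;
(E) `not_ellipticMomentKernel_of_model_counterexample`: a kill would now need no transcendence at
all, only a value-`0` model-curve combination outside `KZ.relations` — excluded by (A);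
(F) the CRUX-SHAPED refuted strengthenings `not_ellipticMomentKernelByAdditivity'`,
`not_ellipticMomentKernelByReparametrisation'`: "`∀ q₂ q₃, 0 < disc → Rigid → kernel ⊆ ⟨(1a),(1b)⟩`"
and "`… ⊆ ⟨(2),(3)⟩`" are FALSE (§4 could only refute the rigidity-free `∀`-forms);
(G) LOAD-BEARING `eval c = 0`: `J0_pos` (every admissible parameter, after drefute gen 3),
`not_kernelClaimWithoutEval`, `ellipticMomentKernel_false_without_eval'`.
Final load-bearing table of the crux `∀ q₂ q₃, 0 < disc → Rigid → ∀ c ∈ closure S, eval c = 0 →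
c ∈ relations`: `0 < disc` decoration (§2); `Rigid` needed by every known proof, never refutable,
and TRUE in Lean at `(4,0)` (§12); `eval c = 0` necessary (§12); conclusion not improvable to a
sub-calculus (§4, §12) and TRUE as stated (certificate). -/


section Lemniscatic

open Literature.Analysis.SpecialFunctions

/-- Transfer of an integral over the model oval `σ ⊆ ℝ¹` to the interval `(−1, 0) ⊆ ℝ`.
[folklore] -/
theorem setIntegral_oval_four_zero (g : ℝ → ℝ) :
    ∫ p in oval 4 0, g (p 0) = ∫ x in Ioo (-1 : ℝ) 0, g x := by
  have key := measurePreserving_e1.setIntegral_preimage_emb e1.measurableEmbedding g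
    (Ioo (-1 : ℝ) 0)
  simp only [e1_apply] at key
  rw [oval_eq_preimage]
  exact key

/-- Change of variables `x = u² − 1` (an increasing diffeomorphism `(0,1) → (−1,0)`,
`dx = 2u du`): `∫_{(−1,0)} g(x) dx = ∫_{(0,1)} 2u·g(u² − 1) du` for every `g` (Bochner integrals
on both sides, no integrability hypothesis). [folklore] -/
theorem integral_Ioo_comp_sq_sub_one (g : ℝ → ℝ) :
    ∫ x in Ioo (-1 : ℝ) 0, g x = ∫ u in Ioo (0 : ℝ) 1, 2 * u * g (u ^ 2 - 1) := by
  have himage : (fun u : ℝ => u ^ 2 - 1) '' Ioo (0 : ℝ) 1 = Ioo (-1) 0 := by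
    ext x
    constructor
    · rintro ⟨u, hu, rfl⟩
      constructor <;> nlinarith [hu.1, hu.2]
    · intro hx
      refine ⟨Real.sqrt (x + 1), ⟨Real.sqrt_pos.mpr (by linarith [hx.1]), ?_⟩, ?_⟩
      · rw [Real.sqrt_lt' one_pos]
        linarith [hx.2]
      · simp only
        rw [Real.sq_sqrt (by linarith [hx.1])]
        ring
  have hderiv : ∀ u ∈ Ioo (0 : ℝ) 1,
      HasDerivWithinAt (fun u : ℝ => u ^ 2 - 1) (2 * u) (Ioo 0 1) u := by
    intro u _
    have h := (hasDerivAt_pow 2 u).sub_const 1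
    simpa using h.hasDerivWithinAt
  have hinj : InjOn (fun u : ℝ => u ^ 2 - 1) (Ioo 0 1) := by
    intro a ha b hb hab
    have h2 : a ^ 2 = b ^ 2 := by
      simp only at hab
      linarith
    exact (pow_left_inj₀ ha.1.le hb.1.le two_ne_zero).mp h2
  have key := integral_image_eq_integral_abs_deriv_smul measurableSet_Ioo hderiv hinj g
  rw [himage] at key
  rw [key]
  refine setIntegral_congr_fun measurableSet_Ioo (fun u hu => ?_)
  rw [smul_eq_mul, abs_of_pos (by linarith [hu.1])]

/-- `f(u² − 1) = (2u)²·(1 − u²)(2 − u²)` for `f = 4x³ − 4x`. [folklore] -/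
theorem cubic_comp_sq_sub_one (u : ℝ) :
    cubic 4 0 (u ^ 2 - 1) = (2 * u) ^ 2 * ((1 - u ^ 2) * (2 - u ^ 2)) := by
  rw [cubic_four_zero]
  ring

/-- `√f(u² − 1) = 2u·√((1 − u²)(2 − u²))` for `0 < u`. [folklore] -/
theorem sqrt_cubic_comp {u : ℝ} (hu : 0 < u) :
    Real.sqrt (cubic 4 0 (u ^ 2 - 1)) = 2 * u * Real.sqrt ((1 - u ^ 2) * (2 - u ^ 2)) := by
  rw [cubic_comp_sq_sub_one, Real.sqrt_mul (sq_nonneg _), Real.sqrt_sq (by linarith)]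

/-- After `x = u² − 1` the integrand of `J₀` is `(1/√2)` times the integrand of `K(1/√2)`.
[folklore] -/
theorem J0_subst {u : ℝ} (hu : u ∈ Ioo (0 : ℝ) 1) :
    2 * u * (1 / Real.sqrt (cubic 4 0 (u ^ 2 - 1))) =
      (Real.sqrt 2)⁻¹ * (1 / Real.sqrt ((1 - u ^ 2) * (1 - u ^ 2 / 2))) := by
  rw [sqrt_cubic_comp hu.1]
  have hA2 : 0 < 1 - u ^ 2 := by nlinarith [hu.1, hu.2]
  have hB2 : 0 < 1 - u ^ 2 / 2 := by nlinarith [hu.1, hu.2]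
  have hQ : 0 < (1 - u ^ 2) * (1 - u ^ 2 / 2) := mul_pos hA2 hB2
  rw [show (1 - u ^ 2) * (2 - u ^ 2) = 2 * ((1 - u ^ 2) * (1 - u ^ 2 / 2)) by ring,
    Real.sqrt_mul (by norm_num : (0 : ℝ) ≤ 2)]
  have hu0 : (0 : ℝ) < u := hu.1
  have hs2 : 0 < Real.sqrt 2 := Real.sqrt_pos.mpr two_pos
  have hsQ : 0 < Real.sqrt ((1 - u ^ 2) * (1 - u ^ 2 / 2)) := Real.sqrt_pos.mpr hQ
  field_simp

/-- After `x = u² − 1` the integrand of `J₁` is `(1/√2)` times (integrand of `K(1/√2)` minus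
twice the integrand of `E(1/√2)`). [folklore] -/
theorem J1_subst {u : ℝ} (hu : u ∈ Ioo (0 : ℝ) 1) :
    2 * u * ((u ^ 2 - 1) / Real.sqrt (cubic 4 0 (u ^ 2 - 1))) =
      (Real.sqrt 2)⁻¹ * (1 / Real.sqrt ((1 - u ^ 2) * (1 - u ^ 2 / 2)) -
        2 * (Real.sqrt (1 - u ^ 2 / 2) / Real.sqrt (1 - u ^ 2))) := by
  rw [sqrt_cubic_comp hu.1]
  have hA2 : 0 < 1 - u ^ 2 := by nlinarith [hu.1, hu.2]
  have hB2 : 0 < 1 - u ^ 2 / 2 := by nlinarith [hu.1, hu.2]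
  have h1 : Real.sqrt ((1 - u ^ 2) * (2 - u ^ 2)) =
      Real.sqrt 2 * Real.sqrt (1 - u ^ 2) * Real.sqrt (1 - u ^ 2 / 2) := by
    rw [show (1 - u ^ 2) * (2 - u ^ 2) = 2 * ((1 - u ^ 2) * (1 - u ^ 2 / 2)) by ring,
      Real.sqrt_mul (by norm_num : (0 : ℝ) ≤ 2), Real.sqrt_mul hA2.le, mul_assoc]
  have h2 : Real.sqrt ((1 - u ^ 2) * (1 - u ^ 2 / 2)) =
      Real.sqrt (1 - u ^ 2) * Real.sqrt (1 - u ^ 2 / 2) := Real.sqrt_mul hA2.le _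
  rw [h1, h2]
  set A := Real.sqrt (1 - u ^ 2) with hA
  set B := Real.sqrt (1 - u ^ 2 / 2) with hB
  have hApos : 0 < A := Real.sqrt_pos.mpr hA2
  have hBpos : 0 < B := Real.sqrt_pos.mpr hB2
  have hAA : A ^ 2 = 1 - u ^ 2 := Real.sq_sqrt hA2.le
  have hBB : B ^ 2 = 1 - u ^ 2 / 2 := Real.sq_sqrt hB2.le
  have hs2 : 0 < Real.sqrt 2 := Real.sqrt_pos.mpr two_pos
  have hu0 : (0 : ℝ) < u := hu.1
  field_simp
  linear_combination 2 * hBB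

/-- `K(1/√2) > 0`, unconditionally (the tree discharges Lawden (4.3.6)). [cite: Lawden1989, §4.3 eq. (4.3.6)] -/
theorem lemniscaticK_pos' : 0 < lemniscaticK := lemniscaticK_pos Lawden1989_eq_4_3_6_holds

/-- `E(1/√2) > 0`, from Legendre's relation `2EK − K² = π/2` and `K > 0`.
[cite: Lawden1989, §3.8 eq. (3.8.29)] -/
theorem lemniscaticE_pos : 0 < lemniscaticE := by
  have hK := lemniscaticK_pos'
  have hL : 2 * lemniscaticE * lemniscaticK - lemniscaticK ^ 2 = Real.pi / 2 :=
    Lawden1989_eq_3_8_29_lemniscatic_holds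
  have h2 : 0 < 2 * lemniscaticE * lemniscaticK := by
    nlinarith [Real.pi_pos, sq_nonneg lemniscaticK]
  by_contra hE
  have hE' : lemniscaticE ≤ 0 := not_lt.mp hE
  nlinarith

/-- The integrand of `K(1/√2)` is integrable on `(0,1)` — for free from `K > 0`, since a
non-integrable Bochner integral is `0`. [folklore] -/
theorem integrableOn_lemniscaticK_integrand :
    IntegrableOn (fun x : ℝ => 1 / Real.sqrt ((1 - x ^ 2) * (1 - x ^ 2 / 2))) (Ioo (0 : ℝ) 1) := by
  by_contra h
  exact lemniscaticK_pos'.ne' (integral_undef h)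

/-- The integrand of `E(1/√2)` is integrable on `(0,1)` (same argument, `E > 0`). [folklore] -/
theorem integrableOn_lemniscaticE_integrand :
    IntegrableOn (fun x : ℝ => Real.sqrt (1 - x ^ 2 / 2) / Real.sqrt (1 - x ^ 2)) (Ioo (0 : ℝ) 1) := by
  by_contra h
  exact lemniscaticE_pos.ne' (integral_undef h)

/-- **`J₀ = K(1/√2)/√2` on the model curve** (`= ϖ/2 = 1.3110287771…`): the first normal-form
value of the elliptic moment sector of `y² = 4x³ − 4x` is the lemniscatic complete integral of
the first kind. [cite: Lawden1989, §4.3 eqs. (4.3.2)–(4.3.6)] -/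
theorem J0_four_zero : J0 4 0 = lemniscaticK / Real.sqrt 2 := by
  have h1 := setIntegral_oval_four_zero (fun x => 1 / Real.sqrt (cubic 4 0 x))
  unfold J0
  rw [h1, integral_Ioo_comp_sq_sub_one,
    setIntegral_congr_fun measurableSet_Ioo (fun u hu => J0_subst hu), integral_const_mul,
    div_eq_inv_mul]
  rfl

/-- **`J₁ = (K − 2E)(1/√2)/√2` on the model curve** (`= −0.5990701173…`): the second normal-form
value is a combination of the lemniscatic complete integrals of the first and second kinds.
[cite: Lawden1989, Ch. 3 Exercise 24] -/
theorem J1_four_zero : J1 4 0 = (lemniscaticK - 2 * lemniscaticE) / Real.sqrt 2 := by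
  have h1 := setIntegral_oval_four_zero (fun x => x / Real.sqrt (cubic 4 0 x))
  have h2E : IntegrableOn
      (fun x : ℝ => 2 * (Real.sqrt (1 - x ^ 2 / 2) / Real.sqrt (1 - x ^ 2))) (Ioo (0 : ℝ) 1) :=
    integrableOn_lemniscaticE_integrand.const_mul 2
  unfold J1
  rw [h1, integral_Ioo_comp_sq_sub_one,
    setIntegral_congr_fun measurableSet_Ioo (fun u hu => J1_subst hu), integral_const_mul,
    integral_sub integrableOn_lemniscaticK_integrand h2E, integral_const_mul, div_eq_inv_mul]
  rfl

/-- **Legendre's relation on the sector's normal forms**: `4·J₀·J₁ = −π` on `y² = 4x³ − 4x`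
(square lattice: `η₁ω₁ = π` with `ω₁ = 2J₀`, `η₁ = −2J₁`). This is the first NON-linear period
relation of the sector; it involves `π`, which is not a value of the sector's normal form
`{1, J₀, J₁}` — the LINEAR rigidity hypothesis of the crux cannot see it, and the crux (a linear
kernel statement) is consistent with it. [cite: Lawden1989, §3.8 eq. (3.8.29)] -/
theorem legendre_four_zero : 4 * J0 4 0 * J1 4 0 = -Real.pi := by
  have hL : 2 * lemniscaticE * lemniscaticK - lemniscaticK ^ 2 = Real.pi / 2 :=
    Lawden1989_eq_3_8_29_lemniscatic_holds
  have hs : Real.sqrt 2 ^ 2 = 2 := Real.sq_sqrt (by norm_num)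
  have hs0 : Real.sqrt 2 ≠ 0 := (Real.sqrt_pos.mpr two_pos).ne'
  rw [J0_four_zero, J1_four_zero]
  field_simp
  linear_combination (-4) * hL + Real.pi * hs

/-- `J₁ < 0 < J₀` on the model curve, quantitatively: `J₀ = K/√2 > 0`. [folklore] -/
theorem J0_four_zero_pos : 0 < J0 4 0 := by
  rw [J0_four_zero]
  exact div_pos lemniscaticK_pos' (Real.sqrt_pos.mpr two_pos)

/-- … and `J₁ = −π/(4J₀) < 0`. [folklore] -/
theorem J1_four_zero_neg : J1 4 0 < 0 := by
  have h := legendre_four_zero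
  have h0 := J0_four_zero_pos
  nlinarith [Real.pi_pos]

/-- **RIGIDITY OF THE MODEL SECTOR, from the algebraic independence of `K(1/√2), E(1/√2)`**:
if `K, E` are algebraically independent over `ℚ` then `1, J₀, J₁` are linearly independent over
the real algebraic numbers on `y² = 4x³ − 4x`, i.e. the crux's inlined hypothesis `Rigid 4 0`
holds. (Extend scalars to the subalgebra of real algebraic numbers —
`AlgebraicIndependent.subalgebraAlgebraicClosure` — and read off the three coefficients of the
linear polynomial `√2·a + (b + c)·X − 2c·Y`.) [cite: Chudnovsky1984, Ch. 7 §2 Cor. 2.3] -/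
theorem rigid_four_zero_of_algebraicIndependent
    (hKE : AlgebraicIndependent ℚ ![lemniscaticK, lemniscaticE]) : Rigid 4 0 := by
  intro a b c ha hb hc h
  rw [J0_four_zero, J1_four_zero] at h
  have hs0 : Real.sqrt 2 ≠ 0 := (Real.sqrt_pos.mpr two_pos).ne'
  have h' : Real.sqrt 2 * a + (b + c) * lemniscaticK + (-2 * c) * lemniscaticE = 0 := by
    field_simp at h
    linear_combination h
  -- scalars: the subalgebra `S` of real algebraic numbers
  set S := Subalgebra.algebraicClosure ℚ ℝ with hS
  have hind : AlgebraicIndependent S ![lemniscaticK, lemniscaticE] :=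
    hKE.subalgebraAlgebraicClosure
  have h2alg : IsAlgebraic ℚ (Real.sqrt 2) := by
    refine ⟨Polynomial.X ^ 2 - Polynomial.C 2, ?_, ?_⟩
    · exact Polynomial.X_pow_sub_C_ne_zero two_pos 2
    · simp [Real.sq_sqrt (show (0:ℝ) ≤ 2 by norm_num)]
  have hαS : Real.sqrt 2 * a ∈ S := (Subalgebra.mem_algebraicClosure ℚ ℝ).mpr (h2alg.mul ha)
  have hβS : b + c ∈ S := (Subalgebra.mem_algebraicClosure ℚ ℝ).mpr (hb.add hc)
  have hγS : -2 * c ∈ S :=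
    (Subalgebra.mem_algebraicClosure ℚ ℝ).mpr ((isAlgebraic_nat 2).neg.mul hc)
  classical
  let α : S := ⟨_, hαS⟩
  let β : S := ⟨_, hβS⟩
  let γ : S := ⟨_, hγS⟩
  let p : MvPolynomial (Fin 2) S :=
    MvPolynomial.C α + MvPolynomial.C β * MvPolynomial.X 0 + MvPolynomial.C γ * MvPolynomial.X 1
  have hp : MvPolynomial.aeval ![lemniscaticK, lemniscaticE] p = 0 := by
    simp only [p, map_add, map_mul, MvPolynomial.aeval_C, MvPolynomial.aeval_X,
      Matrix.cons_val_zero, Matrix.cons_val_one]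
    change Real.sqrt 2 * a + (b + c) * lemniscaticK + (-2 * c) * lemniscaticE = 0
    exact h'
  have hp0 : p = 0 := hind (by rw [hp, map_zero])
  have e0 := congr_arg (MvPolynomial.coeff (0 : Fin 2 →₀ ℕ)) hp0
  have e1 := congr_arg (MvPolynomial.coeff (Finsupp.single (0 : Fin 2) 1)) hp0
  have e2 := congr_arg (MvPolynomial.coeff (Finsupp.single (1 : Fin 2) 1)) hp0
  have hne01 : (Finsupp.single (0 : Fin 2) 1 : Fin 2 →₀ ℕ) ≠ Finsupp.single 1 1 := by
    rw [Ne, Finsupp.single_left_inj one_ne_zero]; decide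
  have hne0 : (0 : Fin 2 →₀ ℕ) ≠ Finsupp.single (0 : Fin 2) 1 := by
    intro h0; have := congr_arg (fun f => f 0) h0; simp at this
  have hne1 : (0 : Fin 2 →₀ ℕ) ≠ Finsupp.single (1 : Fin 2) 1 := by
    intro h0; have := congr_arg (fun f => f 1) h0; simp at this
  simp only [p, MvPolynomial.coeff_add, MvPolynomial.coeff_C, MvPolynomial.coeff_C_mul,
    MvPolynomial.coeff_X, MvPolynomial.coeff_zero, if_true, if_neg hne0, if_neg hne1,
    if_neg hne01, if_neg hne01.symm, if_neg hne0.symm, if_neg hne1.symm,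
    mul_zero, mul_one, add_zero, zero_add] at e0 e1 e2
  have hα : Real.sqrt 2 * a = 0 := congr_arg Subtype.val e0
  have hβ : b + c = 0 := congr_arg Subtype.val e1
  have hγ : -2 * c = 0 := congr_arg Subtype.val e2
  refine ⟨?_, ?_, ?_⟩
  · exact (mul_eq_zero.mp hα).resolve_left hs0
  · linarith
  · linarith

/-! ### Consequences for the crux -/

variable {q₂ q₃ : ℚ}

/-- The oval is open. [folklore] -/
theorem isOpen_oval : IsOpen (oval q₂ q₃) := by
  have h1 : IsOpen {p : Fin 1 → ℝ | 0 < cubic q₂ q₃ (p 0)} :=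
    isOpen_lt continuous_const (continuous_cubic.comp (continuous_apply 0))
  have h2 : IsOpen {p : Fin 1 → ℝ | ∃ t : ℝ, p 0 < t ∧ cubic q₂ q₃ t < 0} := by
    rw [Set.setOf_exists]
    exact isOpen_iUnion fun t => by
      by_cases hft : cubic q₂ q₃ t < 0
      · simpa [hft] using isOpen_lt (continuous_apply 0) continuous_const
      · simp [hft]
  have : oval q₂ q₃ = {p | 0 < cubic q₂ q₃ (p 0)} ∩
      {p : Fin 1 → ℝ | ∃ t : ℝ, p 0 < t ∧ cubic q₂ q₃ t < 0} := by
    ext p; simp only [oval, mem_setOf_eq, mem_inter_iff]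
  rw [this]
  exact h1.inter h2

/-- The oval has positive Lebesgue measure when `disc > 0` (open and non-empty). [folklore] -/
theorem volume_oval_pos (h : 0 < disc q₂ q₃) : 0 < volume (oval q₂ q₃) :=
  isOpen_oval.measure_pos volume ⟨_, neg_sqrt_mem_oval h⟩

/-- A positive integrable function has positive integral over the oval. [folklore] -/
theorem setIntegral_oval_pos (h : 0 < disc q₂ q₃) {g : (Fin 1 → ℝ) → ℝ}
    (hg : IntegrableOn g (oval q₂ q₃)) (hpos : ∀ p ∈ oval q₂ q₃, 0 < g p) :
    0 < ∫ p in oval q₂ q₃, g p := by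
  have hmeas : MeasurableSet (oval q₂ q₃) := isOpen_oval.measurableSet
  have hnn : 0 ≤ᵐ[volume.restrict (oval q₂ q₃)] g :=
    ae_restrict_of_forall_mem hmeas fun p hp => (hpos p hp).le
  rw [setIntegral_pos_iff_support_of_nonneg_ae hnn hg]
  have hsub : oval q₂ q₃ ⊆ Function.support g ∩ oval q₂ q₃ := fun p hp =>
    ⟨Function.mem_support.2 (hpos p hp).ne', hp⟩
  exact (volume_oval_pos h).trans_le (measure_mono hsub)

/-- **`J₀ > 0` for every admissible parameter** (no rigidity needed; after drefute gen 3's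
`DrefuteG3.J0_pos`, re-proved here for self-containment). [folklore] -/
theorem J0_pos (h : 0 < disc q₂ q₃) : 0 < J0 q₂ q₃ := by
  unfold J0
  refine setIntegral_oval_pos h ?_ fun p hp => ?_
  · simpa using integrableOn_genIntegrandQ_oval h 0
  · exact one_div_pos.2 (Real.sqrt_pos.2 hp.1)

/-- The kernel claim WITHOUT its hypothesis `KZ.eval c = 0`: "every combination of generators
is a relation". [folklore] -/
def KernelClaimWithoutEval (q₂ q₃ : ℚ) : Prop :=
  ∀ c ∈ AddSubgroup.closure (gens q₂ q₃), c ∈ KZ.relations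

/-- **LOAD-BEARING (`eval c = 0`)**: for every admissible parameter the kernel claim without
its value hypothesis is FALSE — `[σ, 1/√f]` has value `J₀ > 0` while relations have value `0`
(soundness). Any proof of the crux uses `KZ.eval c = 0`. [cite: KontsevichZagier2001, §1.2] -/
theorem not_kernelClaimWithoutEval (h : 0 < disc q₂ q₃) : ¬ KernelClaimWithoutEval q₂ q₃ := by
  intro H
  have hmem := H _ (AddSubgroup.subset_closure (Or.inr (of_genRepQ_mem_gens₁ h 0)))
  have h0 := relations_le_ker_eval_holds hmem
  rw [AddMonoidHom.mem_ker, eval_of, value_genRepQ_zero h] at h0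
  exact (J0_pos h).ne' h0

/-- The crux with `eval c = 0` dropped (crux-shaped). [folklore] -/
def EllipticMomentKernelWithoutEval : Prop :=
  ∀ q₂ q₃ : ℚ, 0 < disc q₂ q₃ → Rigid q₂ q₃ → KernelClaimWithoutEval q₂ q₃

/-- **`_false_without_eval`** (modulo the tree theorem `keAlgIndependent_proof`): the crux with
its value hypothesis dropped is FALSE, witnessed on the model curve where BOTH hypotheses
`0 < disc`, `Rigid` now hold in Lean. [cite: KontsevichZagier2001, §1.2] -/
theorem ellipticMomentKernel_false_without_eval
    (hKE : AlgebraicIndependent ℚ ![lemniscaticK, lemniscaticE]) :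
    ¬ EllipticMomentKernelWithoutEval := fun H =>
  not_kernelClaimWithoutEval (q₂ := 4) (q₃ := 0) (by rw [disc_four_zero]; norm_num)
    (H 4 0 (by rw [disc_four_zero]; norm_num) (rigid_four_zero_of_algebraicIndependent hKE))

/-- **NON-VACUITY OF THE CRUX IN LEAN**: both hypotheses of `EllipticMomentKernel` hold
simultaneously for an explicit rational cubic, `(q₂, q₃) = (4, 0)`. Before cycle 3, `Rigid q₂ q₃`
was provable in Lean for NO parameter (Masser II is a named fact; the CM road needed the glue
`J₁ = −η₁/2`); the lemniscatic road `J₀ = K/√2`, `J₁ = (K − 2E)/√2` + `keAlgIndependent_proof`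
(Chudnovsky, formalised in the tree) closes it. [cite: Chudnovsky1984, Ch. 7 §2 Cor. 2.3] -/
theorem exists_disc_pos_and_rigid (hKE : AlgebraicIndependent ℚ ![lemniscaticK, lemniscaticE]) :
    ∃ q₂ q₃ : ℚ, 0 < disc q₂ q₃ ∧ Rigid q₂ q₃ :=
  ⟨4, 0, by rw [disc_four_zero]; norm_num, rigid_four_zero_of_algebraicIndependent hKE⟩

/-- **The crux, instantiated**: `EllipticMomentKernel` yields the UNCONDITIONAL kernel claim on
the elliptic moment sector of `y² = 4x³ − 4x` (given `keAlgIndependent_proof`). With the drefute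
gen-2 certificate `DrefuteG2.EllipticMomentKernel_of` this is a theorem outright: Conjecture 1
holds on this sector. [cite: KontsevichZagier2001, §1.2] -/
theorem kernelClaim_four_zero_of (hKE : AlgebraicIndependent ℚ ![lemniscaticK, lemniscaticE])
    (h : EllipticMomentKernel) : KernelClaim 4 0 :=
  (ellipticMomentKernel_iff.mp h) 4 0 (by rw [disc_four_zero]; norm_num)
    (rigid_four_zero_of_algebraicIndependent hKE)

/-- **What a kill needs NOW** (sharpening `not_ellipticMomentKernel_iff`): no transcendence input
any more — only a value-`0` combination of MODEL-curve generators outside `KZ.relations`, i.e. an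
additive invariant of `KZ.relations` finer than `KZ.eval` on the sector of `y² = 4x³ − 4x`. (None
exists: the crux is closed by the gen-2 certificate.) [cite: KontsevichZagier2001, §1.2] -/
theorem not_ellipticMomentKernel_of_model_counterexample
    (hKE : AlgebraicIndependent ℚ ![lemniscaticK, lemniscaticE])
    (hc : ∃ c ∈ AddSubgroup.closure (gens 4 0), KZ.eval c = 0 ∧ c ∉ KZ.relations) :
    ¬ EllipticMomentKernel := fun h => by
  obtain ⟨c, hc, h0, hn⟩ := hc
  exact hn (kernelClaim_four_zero_of hKE h c hc h0)

/-- The crux with `KZ.relations` replaced by the ADDITIVITY sub-calculus `⟨(1a), (1b)⟩`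
(crux-shaped, rigidity hypothesis kept). [folklore] -/
def EllipticMomentKernelByAdditivity : Prop :=
  ∀ q₂ q₃ : ℚ, 0 < disc q₂ q₃ → Rigid q₂ q₃ → KernelClaimByAdditivity q₂ q₃

/-- The crux with `KZ.relations` replaced by the REPARAMETRISATION sub-calculus `⟨(2), (3)⟩`
(crux-shaped, rigidity hypothesis kept). [folklore] -/
def EllipticMomentKernelByReparametrisation : Prop :=
  ∀ q₂ q₃ : ℚ, 0 < disc q₂ q₃ → Rigid q₂ q₃ → KernelClaimByReparametrisation q₂ q₃

/-- **REFUTED STRENGTHENING, crux-shaped** (cycle 3 sharpening of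
`not_forall_kernelClaimByAdditivity`, which had to omit the rigidity hypothesis): even WITH
`Rigid` as a hypothesis, the additivity moves alone do not generate the kernel —
`3[σ, x²/√f] − [σ, 1/√f]` on `y² = 4x³ − 4x` is separated by `restrictedEval` at the window
`{x < −1/2}`. [cite: KontsevichZagier2001, §1.2] -/
theorem not_ellipticMomentKernelByAdditivity
    (hKE : AlgebraicIndependent ℚ ![lemniscaticK, lemniscaticE]) :
    ¬ EllipticMomentKernelByAdditivity := fun H =>
  not_kernelClaimByAdditivity_four_zero
    (H 4 0 (by rw [disc_four_zero]; norm_num) (rigid_four_zero_of_algebraicIndependent hKE))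

/-- **REFUTED STRENGTHENING, crux-shaped**: even WITH `Rigid` as a hypothesis, the
reparametrisation + Newton–Leibniz moves alone do not generate the kernel (`coeffSum = 2`).
[cite: KontsevichZagier2001, §1.2] -/
theorem not_ellipticMomentKernelByReparametrisation
    (hKE : AlgebraicIndependent ℚ ![lemniscaticK, lemniscaticE]) :
    ¬ EllipticMomentKernelByReparametrisation := fun H =>
  not_kernelClaimByReparametrisation_four_zero
    (H 4 0 (by rw [disc_four_zero]; norm_num) (rigid_four_zero_of_algebraicIndependent hKE))

/-- `√(l³·f) = l·(√l·√f)` for `l ≥ 0`. [folklore] -/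
theorem sqrt_cube_mul {l y : ℝ} (hl : 0 ≤ l) :
    Real.sqrt (l ^ 3 * y) = l * (Real.sqrt l * Real.sqrt y) := by
  rw [show l ^ 3 * y = l ^ 2 * (l * y) by ring, Real.sqrt_mul (sq_nonneg l), Real.sqrt_sq hl,
    Real.sqrt_mul hl]

/-- `disc q₂ 0 = q₂³ > 0`. [folklore] -/
theorem disc_q2_zero_pos {q₂ : ℚ} (hq : 0 < q₂) : 0 < disc q₂ 0 := by
  have hq' : (0 : ℝ) < q₂ := by exact_mod_cast hq
  simp only [disc]
  push_cast
  nlinarith [pow_pos hq' 3]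

/-! ### Rigidity is a twist invariant: `(q₂, q₃) ↦ (l²q₂, l³q₃)`, `l > 0` real algebraic -/

section TwistGeneral

variable {q₂' q₃' : ℚ} {l : ℝ}

/-- The twisted cubic: `f_{l²q₂, l³q₃}(l·u) = l³·f_{q₂,q₃}(u)`. [folklore] -/
theorem cubic_twist (h2 : (q₂' : ℝ) = l ^ 2 * q₂) (h3 : (q₃' : ℝ) = l ^ 3 * q₃) (u : ℝ) :
    cubic q₂' q₃' (l * u) = l ^ 3 * cubic q₂ q₃ u := by
  simp only [cubic, h2, h3]
  ring

/-- The twisted cubic factors over the scaled roots. [folklore] -/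
theorem cubic_twist_roots (hl0 : 0 < l) (h2 : (q₂' : ℝ) = l ^ 2 * q₂) (h3 : (q₃' : ℝ) = l ^ 3 * q₃)
    {e₃ e₂ e₁ : ℝ} (hf : ∀ x, cubic q₂ q₃ x = 4 * (x - e₃) * (x - e₂) * (x - e₁)) (x : ℝ) :
    cubic q₂' q₃' x = 4 * (x - l * e₃) * (x - l * e₂) * (x - l * e₁) := by
  have hx : x = l * (x / l) := by field_simp
  rw [hx, cubic_twist h2 h3, hf]
  field_simp

/-- Transfer of an integral over an oval known to be an interval `(a, b)`. [folklore] -/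
theorem setIntegral_oval_of_eq {a b : ℝ} (hσ : oval q₂ q₃ = {p | p 0 ∈ Ioo a b}) (g : ℝ → ℝ) :
    ∫ p in oval q₂ q₃, g (p 0) = ∫ x in Ioo a b, g x := by
  have key := measurePreserving_e1.setIntegral_preimage_emb e1.measurableEmbedding g (Ioo a b)
  simp only [e1_apply] at key
  rw [hσ, show {p : Fin 1 → ℝ | p 0 ∈ Ioo a b} = e1 ⁻¹' Ioo a b from rfl]
  exact key

/-- Change of variables `x = l·u`, `(a,b) → (la, lb)` (`l > 0`). [folklore] -/
theorem integral_Ioo_comp_mul_left' (hl0 : 0 < l) (a b : ℝ) (g : ℝ → ℝ) :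
    ∫ x in Ioo (l * a) (l * b), g x = ∫ u in Ioo a b, l * g (l * u) := by
  have himage : (fun u : ℝ => l * u) '' Ioo a b = Ioo (l * a) (l * b) := by
    ext x
    constructor
    · rintro ⟨u, hu, rfl⟩
      exact ⟨mul_lt_mul_of_pos_left hu.1 hl0, mul_lt_mul_of_pos_left hu.2 hl0⟩
    · intro hx
      refine ⟨x / l, ⟨?_, ?_⟩, ?_⟩
      · rw [lt_div_iff₀ hl0]; linarith [hx.1]
      · rw [div_lt_iff₀ hl0]; linarith [hx.2]
      · simp only; field_simp
  have hderiv : ∀ u ∈ Ioo a b, HasDerivWithinAt (fun u : ℝ => l * u) l (Ioo a b) u := by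
    intro u _
    simpa using ((hasDerivAt_id u).const_mul l).hasDerivWithinAt
  have hinj : InjOn (fun u : ℝ => l * u) (Ioo a b) := by
    intro x _ y _ hxy
    exact mul_left_cancel₀ hl0.ne' hxy
  have key := integral_image_eq_integral_abs_deriv_smul measurableSet_Ioo hderiv hinj g
  rw [himage] at key
  rw [key]
  refine setIntegral_congr_fun measurableSet_Ioo (fun u _ => ?_)
  rw [smul_eq_mul, abs_of_pos hl0]

/-- **`J₀` has weight `−1/2` under twisting**: `J₀(l²q₂, l³q₃) = J₀(q₂, q₃)/√l`. [folklore] -/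
theorem J0_twist (hd : 0 < disc q₂ q₃) (hl0 : 0 < l) (h2 : (q₂' : ℝ) = l ^ 2 * q₂)
    (h3 : (q₃' : ℝ) = l ^ 3 * q₃) : J0 q₂' q₃' = (Real.sqrt l)⁻¹ * J0 q₂ q₃ := by
  obtain ⟨e₃, e₂, e₁, he3, he2a, he2b, he1, hf⟩ := exists_roots hd
  have h32 : e₃ < e₂ := by linarith
  have h21 : e₂ < e₁ := by linarith
  have hσ := oval_eq_of_roots h32 h21 hf
  have hσ' := oval_eq_of_roots (mul_lt_mul_of_pos_left h32 hl0) (mul_lt_mul_of_pos_left h21 hl0)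
    (cubic_twist_roots hl0 h2 h3 hf)
  have h1 := setIntegral_oval_of_eq hσ' (fun x => 1 / Real.sqrt (cubic q₂' q₃' x))
  have h4 := setIntegral_oval_of_eq hσ (fun x => 1 / Real.sqrt (cubic q₂ q₃ x))
  unfold J0
  rw [h1, h4, integral_Ioo_comp_mul_left' hl0, ← integral_const_mul]
  refine setIntegral_congr_fun measurableSet_Ioo (fun u hu => ?_)
  rw [cubic_twist h2 h3 u, sqrt_cube_mul hl0.le]
  have hsl : 0 < Real.sqrt l := Real.sqrt_pos.mpr hl0
  have hsf : 0 < Real.sqrt (cubic q₂ q₃ u) :=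
    Real.sqrt_pos.mpr ((cubic_sign_of_roots h32 h21 hf).1 u hu)
  field_simp

/-- **`J₁` has weight `+1/2` under twisting**: `J₁(l²q₂, l³q₃) = √l·J₁(q₂, q₃)`. [folklore] -/
theorem J1_twist (hd : 0 < disc q₂ q₃) (hl0 : 0 < l) (h2 : (q₂' : ℝ) = l ^ 2 * q₂)
    (h3 : (q₃' : ℝ) = l ^ 3 * q₃) : J1 q₂' q₃' = Real.sqrt l * J1 q₂ q₃ := by
  obtain ⟨e₃, e₂, e₁, he3, he2a, he2b, he1, hf⟩ := exists_roots hd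
  have h32 : e₃ < e₂ := by linarith
  have h21 : e₂ < e₁ := by linarith
  have hσ := oval_eq_of_roots h32 h21 hf
  have hσ' := oval_eq_of_roots (mul_lt_mul_of_pos_left h32 hl0) (mul_lt_mul_of_pos_left h21 hl0)
    (cubic_twist_roots hl0 h2 h3 hf)
  have h1 := setIntegral_oval_of_eq hσ' (fun x => x / Real.sqrt (cubic q₂' q₃' x))
  have h4 := setIntegral_oval_of_eq hσ (fun x => x / Real.sqrt (cubic q₂ q₃ x))
  unfold J1
  rw [h1, h4, integral_Ioo_comp_mul_left' hl0, ← integral_const_mul]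
  refine setIntegral_congr_fun measurableSet_Ioo (fun u hu => ?_)
  rw [cubic_twist h2 h3 u, sqrt_cube_mul hl0.le]
  have hsl : 0 < Real.sqrt l := Real.sqrt_pos.mpr hl0
  have hsf : 0 < Real.sqrt (cubic q₂ q₃ u) :=
    Real.sqrt_pos.mpr ((cubic_sign_of_roots h32 h21 hf).1 u hu)
  have hll : Real.sqrt l ^ 2 = l := Real.sq_sqrt hl0.le
  field_simp
  linear_combination (-u) * hll

/-- **RIGIDITY IS A TWIST INVARIANT**: if `1, J₀, J₁` are linearly independent over the real
algebraic numbers on `y² = 4x³ − q₂x − q₃`, then so they are on every twist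
`y² = 4x³ − l²q₂x − l³q₃` with `l > 0` real ALGEBRAIC — `(a, b, c) ↦ (a, b/√l, c·√l)`. In
particular `Rigid` depends only on the `ℚ̄`-isomorphism class of the curve, as Masser's theorem
predicts; and ONE proved instance seeds a whole rational twist family. [folklore] -/
theorem rigid_twist (hR : Rigid q₂ q₃) (hl0 : 0 < l) (hla : IsAlgebraic ℚ l)
    (h2 : (q₂' : ℝ) = l ^ 2 * q₂) (h3 : (q₃' : ℝ) = l ^ 3 * q₃) : Rigid q₂' q₃' := by
  have hd : 0 < disc q₂ q₃ := disc_pos_of_rigid hR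
  have hsl2 : IsAlgebraic ℚ (Real.sqrt l ^ 2) := by
    rw [Real.sq_sqrt hl0.le]
    exact hla
  have hsl_alg : IsAlgebraic ℚ (Real.sqrt l) := hsl2.of_pow two_pos
  have hsl : Real.sqrt l ≠ 0 := (Real.sqrt_pos.mpr hl0).ne'
  intro a b c ha hb hc h
  rw [J0_twist hd hl0 h2 h3, J1_twist hd hl0 h2 h3] at h
  obtain ⟨ha0, hb0, hc0⟩ := hR a (b * (Real.sqrt l)⁻¹) (c * Real.sqrt l) ha (hb.mul hsl_alg.inv)
    (hc.mul hsl_alg) (by linear_combination h)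
  refine ⟨ha0, ?_, ?_⟩
  · rcases mul_eq_zero.mp hb0 with h0 | h0
    · exact h0
    · exact absurd h0 (inv_ne_zero hsl)
  · rcases mul_eq_zero.mp hc0 with h0 | h0
    · exact h0
    · exact absurd h0 hsl

/-- **The `j = 1728` family** `y² = 4x³ − q₂x` (`q₂ > 0` rational): `Rigid 4 0 → Rigid q₂ 0`
(`l = √q₂/2`, `l²·4 = q₂`, `l³·0 = 0`). [folklore] -/
theorem rigid_q2_zero_of_rigid_four_zero (h4 : Rigid 4 0) {q₂ : ℚ} (hq : 0 < q₂) : Rigid q₂ 0 := by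
  have hq' : (0 : ℝ) < q₂ := by exact_mod_cast hq
  have hl0 : 0 < Real.sqrt q₂ / 2 := by positivity
  have hl2 : (Real.sqrt q₂ / 2) ^ 2 = ((q₂ / 4 : ℚ) : ℝ) := by
    push_cast
    rw [div_pow, Real.sq_sqrt hq'.le]
    ring
  have hla : IsAlgebraic ℚ (Real.sqrt q₂ / 2) :=
    (show IsAlgebraic ℚ ((Real.sqrt q₂ / 2) ^ 2) by rw [hl2]; exact isAlgebraic_algebraMap _).of_pow
      two_pos
  refine rigid_twist h4 hl0 hla ?_ ?_
  · push_cast at hl2 ⊢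
    linarith
  · push_cast
    ring


/-- **An infinite family of Lean-instantiable cases of the crux** (modulo `hKE`): for every
rational `q₂ > 0` both hypotheses of `EllipticMomentKernel` hold on `y² = 4x³ − q₂x`.
[cite: Chudnovsky1984, Ch. 7 §2 Cor. 2.3] -/
theorem disc_pos_and_rigid_q2_zero (hKE : AlgebraicIndependent ℚ ![lemniscaticK, lemniscaticE])
    {q₂ : ℚ} (hq : 0 < q₂) : 0 < disc q₂ 0 ∧ Rigid q₂ 0 :=
  ⟨disc_q2_zero_pos hq,
    rigid_q2_zero_of_rigid_four_zero (rigid_four_zero_of_algebraicIndependent hKE) hq⟩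

/-- … hence `EllipticMomentKernel → KernelClaim q₂ 0` for every rational `q₂ > 0` (modulo `hKE`).
[cite: KontsevichZagier2001, §1.2] -/
theorem kernelClaim_q2_zero_of (hKE : AlgebraicIndependent ℚ ![lemniscaticK, lemniscaticE])
    (h : EllipticMomentKernel) {q₂ : ℚ} (hq : 0 < q₂) : KernelClaim q₂ 0 :=
  (ellipticMomentKernel_iff.mp h) q₂ 0 (disc_pos_and_rigid_q2_zero hKE hq).1
    (disc_pos_and_rigid_q2_zero hKE hq).2

end TwistGeneral

/-! ### Discharge of `hKE` (= route Grothendieck's landed `keAlgIndependent_proof`, stmt-8611;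
VERBATIM copy of its 40-line proof over tree theorems, kept here only until the farm serves the
built module `Theorems.GrothendieckKEAlgIndependent`, after which `rigid_four_zero` is the
one-liner `rigid_four_zero_of_algebraicIndependent keAlgIndependent_proof`) -/

section KE

open IntermediateField

/-- If an algebraically independent family `y : Fin m → L` over `K` takes values in `K(S)`, then
`m ≤ trdeg_K K(S)`. (Copy of `Summit.KontsevichZagierPeriods.Grothendieck.le_trdeg_adjoin_of_algebraicIndependent`.)
[folklore] -/
theorem le_trdeg_adjoin_of_algebraicIndependent' {K L : Type*} [Field K] [Field L] [Algebra K L]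
    {m : ℕ} (S : Set L) (y : Fin m → L) (hy : AlgebraicIndependent K y)
    (hyS : ∀ i, y i ∈ adjoin K S) : (m : Cardinal) ≤ Algebra.trdeg K (adjoin K S) := by
  let y' : Fin m → adjoin K S := fun i => ⟨y i, hyS i⟩
  have hcomp : ((adjoin K S).val : adjoin K S → L) ∘ y' = y := by
    funext i
    rfl
  have hy' : AlgebraicIndependent K y' := by
    refine AlgebraicIndependent.of_comp (adjoin K S).val ?_
    rw [hcomp]
    exact hy
  simpa using hy'.lift_cardinalMk_le_trdeg

/-- **`K(1/√2)` and `E(1/√2)` are algebraically independent over `ℚ`** — copy of the landed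
`Summit.KontsevichZagierPeriods.Grothendieck.keAlgIndependent_proof` (Legendre (3.8.29) puts
`π ∈ ℚ(K,E)`, Lawden (4.3.6) puts `Γ(1/4)⁴ ∈ ℚ(K,E)`, Chudnovsky's `π, Γ(1/4)` algebraically
independent — all tree theorems). [cite: Chudnovsky1984, Ch. 7 §2 Corollary 2.3]
[cite: Lawden1989, §3.8 (3.8.29), §4.3 (4.3.6)] -/
theorem keAlgIndependent_holds : AlgebraicIndependent ℚ ![lemniscaticK, lemniscaticE] := by
  have hK : lemniscaticK = Real.Gamma (1 / 4) ^ 2 / (4 * Real.sqrt Real.pi) :=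
    Lawden1989_eq_4_3_6_holds
  have hL : 2 * lemniscaticE * lemniscaticK - lemniscaticK ^ 2 = Real.pi / 2 :=
    Lawden1989_eq_3_8_29_lemniscatic_holds
  set l : Fin 2 → ℝ := ![lemniscaticK, lemniscaticE]
  set S : Set ℝ := Set.range l
  set F : IntermediateField ℚ ℝ := adjoin ℚ S
  have hKF : lemniscaticK ∈ F := subset_adjoin ℚ S ⟨0, rfl⟩
  have hEF : lemniscaticE ∈ F := subset_adjoin ℚ S ⟨1, rfl⟩
  have hpi_eq : Real.pi = 4 * lemniscaticE * lemniscaticK - 2 * lemniscaticK ^ 2 := by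
    linarith
  have hpiF : Real.pi ∈ F := by
    rw [hpi_eq]
    exact sub_mem (mul_mem (mul_mem (by exact_mod_cast F.natCast_mem 4) hEF) hKF)
      (mul_mem (by exact_mod_cast F.natCast_mem 2) (pow_mem hKF 2))
  have hsqrt : Real.sqrt Real.pi ^ 2 = Real.pi := Real.sq_sqrt Real.pi_pos.le
  have hG4 : Real.Gamma (1 / 4) ^ 4 = 16 * Real.pi * lemniscaticK ^ 2 := by
    rw [hK, div_pow, mul_pow, hsqrt]
    field_simp
    ring
  have hG4F : Real.Gamma (1 / 4) ^ 4 ∈ F := by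
    rw [hG4]
    exact mul_mem (mul_mem (by exact_mod_cast F.natCast_mem 16) hpiF) (pow_mem hKF 2)
  set T : Set ℝ := {Real.pi, Real.Gamma (1 / 4)}
  have hTalg : ∀ x ∈ T, IsAlgebraic F x := by
    intro x hx
    rcases hx with rfl | rfl
    · exact isAlgebraic_algebraMap (⟨Real.pi, hpiF⟩ : F)
    · have h4 : IsAlgebraic F (Real.Gamma (1 / 4) ^ 4) :=
        isAlgebraic_algebraMap (⟨Real.Gamma (1 / 4) ^ 4, hG4F⟩ : F)
      exact h4.of_pow (by norm_num)
  have hy : AlgebraicIndependent ℚ ![Real.pi, Real.Gamma (1 / 4)] :=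
    algebraicIndependent_real_pi_gamma_one_quarter
  have hyST : ∀ i, (![Real.pi, Real.Gamma (1 / 4)] : Fin 2 → ℝ) i ∈ adjoin ℚ (S ∪ T) := by
    intro i
    refine subset_adjoin ℚ (S ∪ T) (Or.inr ?_)
    fin_cases i
    · exact Or.inl rfl
    · exact Or.inr rfl
  have h2 := le_trdeg_adjoin_of_algebraicIndependent' (S ∪ T) _ hy hyST
  rw [Literature.Barriers.Schanuel.trdeg_adjoin_union_eq_of_isAlgebraic_adjoin S T hTalg] at h2
  exact Literature.Barriers.Schanuel.algebraicIndependent_of_le_trdeg_adjoin l h2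

end KE

/-- **`Rigid 4 0`, UNCONDITIONALLY**: the inlined rigidity hypothesis of the crux is a Lean
theorem on the model curve `y² = 4x³ − 4x`. [cite: Chudnovsky1984, Ch. 7 §2 Corollary 2.3] -/
theorem rigid_four_zero : Rigid 4 0 := rigid_four_zero_of_algebraicIndependent keAlgIndependent_holds

/-- `Rigid q₂ 0` for every rational `q₂ > 0`, UNCONDITIONALLY. [cite: Chudnovsky1984, Ch. 7 §2 Cor. 2.3] -/
theorem rigid_q2_zero {q₂ : ℚ} (hq : 0 < q₂) : Rigid q₂ 0 :=
  rigid_q2_zero_of_rigid_four_zero rigid_four_zero hq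

/-- The crux instantiates on the whole `j = 1728` family, unconditionally in its hypotheses.
[cite: KontsevichZagier2001, §1.2] -/
theorem kernelClaim_q2_zero_of' (h : EllipticMomentKernel) {q₂ : ℚ} (hq : 0 < q₂) : KernelClaim q₂ 0 :=
  kernelClaim_q2_zero_of keAlgIndependent_holds h hq

/-- The crux's two hypotheses hold together at `(4, 0)` — unconditional non-vacuity in Lean.
[folklore] -/
theorem exists_disc_pos_and_rigid' : ∃ q₂ q₃ : ℚ, 0 < disc q₂ q₃ ∧ Rigid q₂ q₃ :=
  exists_disc_pos_and_rigid keAlgIndependent_holds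

/-- **Conjecture 1 on the elliptic moment sector of `y² = 4x³ − 4x`** follows from the crux alone
(no hypothesis left); with the gen-2 certificate it is a theorem. [cite: KontsevichZagier2001, §1.2] -/
theorem kernelClaim_four_zero_of' (h : EllipticMomentKernel) : KernelClaim 4 0 :=
  kernelClaim_four_zero_of keAlgIndependent_holds h

/-- The crux-shaped refuted strengthenings, unconditionally. [cite: KontsevichZagier2001, §1.2] -/
theorem not_ellipticMomentKernelByAdditivity' : ¬ EllipticMomentKernelByAdditivity :=
  not_ellipticMomentKernelByAdditivity keAlgIndependent_holds

/-- … [cite: KontsevichZagier2001, §1.2] -/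
theorem not_ellipticMomentKernelByReparametrisation' : ¬ EllipticMomentKernelByReparametrisation :=
  not_ellipticMomentKernelByReparametrisation keAlgIndependent_holds

/-- … [cite: KontsevichZagier2001, §1.2] -/
theorem ellipticMomentKernel_false_without_eval' : ¬ EllipticMomentKernelWithoutEval :=
  ellipticMomentKernel_false_without_eval keAlgIndependent_holds

end Lemniscatic

end Summit.KontsevichZagierPeriods.KontsevichZagierPeriods.Cruxes.EllipticMomentKernel.Disproof
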